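/-
Copyright: statement-level skeleton of a published paper (lit-balaban cell, Phase-2 proof seat p26 gen 41). No claims beyond
what the kernel checks below.
-/
import Mathlib
import Literature.MathematicalPhysics.QuantumFieldTheory.Balaban1983to89.B3Eq39FromFeynmanRules

/-!
# B3 — T. Bałaban, *(Higgs)₂,₃ quantum fields in a finite volume. III. Renormalization*, CMP **88** (1983) 411–445
[Balaban1983Higgs3] — pp. 439–440 [PDF 29–30]: **«the expressions corresponding to these graphs» — THE VECTOR SELF-ENERGY PICTURES
(3.25) EVALUATED BY THE FEYNMAN RULES AND COMPARED WITH THE LEFT SIDE OF (3.26)** — the general evaluator of `B3GraphAmplitude` /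
`B3GraphAmplitudeRules` RUN on p18's four graphs `g325a`, `g325b`, `g325c`, `g325d` (the pictures (3.25): two vertices (1.8)_{1,0} joined
by two φ′-lines, each differentiated once / one doubly differentiated and one plain; the φ′-loop at the vertex (1.10)_{2,0}; the φ′-loop at
the vertex (1.8)_{2,0} — all A′-legs external) in closed form for arbitrary kernels, background and joint external fields; at zero
background with the free kernels the values are the four terms `T₁`, `T₂`, `T₃`, `T₄` of the left side of (3.26) (FILE 6 of the evaluator;
FILE 5 = `B3Eq39FromFeynmanRules` did the same for (3.6)₁/(3.9))

statement-level skeleton of published theorems with citation tags; proofs where landed; nothing here is a claim about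
the Yang–Mills mass gap

PDF held: `paper:balaban1983-higgs-2-3-quantum-fields-finite-volume` (journal page = PDF page + 410); pp. 439–440 [PDF 29–30] read by
this seat (text layer `p0029.txt`/`p0030.txt`, 2026-08-23: *"The next class of graphs is the class of self-energy graphs for vector
fields …"*, the four signs `−, +, −, −` of the left side of (3.26)); the formulas of (3.26) are taken from r15's verified transcription in
`B3Sect3VectorSelfEnergy` (×4 render of p. 440), pp. 413–414/420/433 as in FILEs 1–5.

CITATION HEADER (lean-in-tree rule).  lit-balaban TYPED SKELETON (HOME `run/shared/lean/pub/lit-balaban/`), PHASE 2, seat p26 gen 41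
(unit `lit-balaban-p26`, the evaluator lineage: `B3GraphAmplitude` p361338 (FILE 1), `B3GraphAmplitudeRules` p362438 (FILE 2),
`B3Eq36TadpoleExpressions` p363523 (FILE 3), `B3ExpansionFromFeynmanRules` p363747/p364487 (FILE 4), `B3Eq39FromFeynmanRules` p365665
(FILE 5)); free-target protocol G.5-34(d), TAKING #2 (HOME/STATUS.md 2026-08-23T13:17Z).  ROW **B3.Eq3.25-3.32** of
`HOME/lit-balaban-r15/ROWS-B3.md` (pp. 439–442; fold owner r15; head `proved` — r15's `B3Sect3VectorSelfEnergy` and its sequels; this file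
is an OPTIONAL located member of its (3.25)/(3.26) cell, zero head weight), also **B3.Def@420** (E(G, ·) run on four more pictures).
CONSUMES BY NAME, nothing re-declared: p18's `B3Sect3LowestOrderGraphs.{g325a, g325b, g325c, g325d}`, `B3Eq37Pictures.{kind36, sLeg, vLeg}`;
FILE 1's `amp`, `SLeg`/`VLeg`/`OLeg`, `sPairing`/`vPairing`, `SLine`/`VLine`/`ExtSLeg`/`ExtVLeg`, `Pairing.isLower_iff/mate_eq/
not_isLower_of_none`, `spartner_eq_some_iff`, `vpartner_eq_none_iff`, `sRank`/`vRank`/`oRank`, `vertexFactor`, `sLineFactor`,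
`vLineFactor`, `oLineFactor`, `prodExtV`; FILE 2's `Model`, `Loc`, `rulesOf`, `rule18`, `rule110`, `pleg18`, `vlegs`, `basisE`, `basisV`,
`graphAmp`; FILE 3's `basisE_eq`, `opCoeff`, `pleg110_basisE`; FILE 5's `dKs`, `dq`, `dKs_single`, `sum_dKs_single`, `vterm`, `pleg18_basisE`,
`vlegs_one_basisV`, `dKernelT`, `siteBlock`, `inner_covDeriv_zero_basisE`, `dKs_zero`, `siteBlock_diag`, `inner_q_q`; the typer's
`HiggsLattice.{ChargeData, covDeriv, Site.shift, PBond}`, `HiggsCovariance.E`.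

THE PRINTED TEXT (verbatim; r15's transcription, checked against the text layer).  p. 439 [PDF 29]: *"The next class of graphs is the
class of self-energy graphs for vector fields. The graphs of lowest order are [four pictures] (D = −d + 2), (3.25) and they form a
renormalized class of graphs connected by Ward-Takahashi identities (2.26) and (2.27). Let us analyze in detail the expressions
corresponding to these graphs."*  p. 440 [PDF 30]: *"Applying the same transformations as for (3.9), we get
− Σ_{x,x′} η^{2d} Σ_{μ,μ′=1}^d g(x)A_μ(x) tr q²(G^η_{(j)}(0)∂^{η*}_{μ′})(x,x′)(G^η_{(j′)}(0)∂^{η*}_μ)(x′,x) g′(x′)A′_{μ′}(x′)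
+ Σ_{x,x′} η^{2d} Σ_{μ,μ′=1}^d g(x)A_μ(x) tr q² G^η_{(j)}(0;x,x′)(∂^η_{μ′}G^η_{(j′)}(0)∂^{η*}_μ)(x′,x) g′(x′)A′_{μ′}(x′)
− Σ_x η^d Σ_{μ=1}^d g(x)A_μ(x)g′(x)A′_μ(x) tr q² G^η_{(j″)}(0,x,x) − Σ_x η^d Σ_{μ=1}^d g(x)A_μ(x)g′(x)A′_μ(x) tr q² η(G^η_{(j″)}(0)∂^{η*}_μ)(x,x)
= −[…] + {…} + {…}, (3.26) where A, A′ are external vector field legs."* (the right side of (3.26) — the Taylor rearrangement — is r15's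
`eq326` and is not touched here).  The vertices (p. 413): (1.8)_{n,n′} = `e^{n+n′}((−1)^{n+n′}η^{n+n′−1}/(n!n′!)) Σ_b η^d[(D^η_B̃φ′)(b)·
q^{n+n′}φ′(b₋)](g_kA′_b)^n(Ã_b)^{n′}`, (1.10)_{n,n′} = `e^{n+n′}(η^{n+n′−2}/(n!n′!)) Σ_b η^d[φ′(b₋)·q^{n+n′}φ′(b₋)](g_kA′_b)^n(Ã_b)^{n′}`
(typer's `B3Eq18VertexExpansion.vertex18/vertex110`; FILE 2's polarized `rule18`/`rule110`); p. 414: *"each pair is replaced by the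
corresponding propagator"*.

READING (declared).  (a) THE GENERAL EVALUATIONS (§3, §7): for arbitrary model data, localization weights, line kernels and joint
external fields the index form of FILE 1 is summed out, exactly as in FILE 5: bond deltas of the polarized A′-legs (here EXTERNAL: what is
left is the joint external vector field read at the vertices' bonds, `A(b,b′)` resp. `A(b,b)`), site deltas of the undifferentiated
φ′-legs, and the differentiated legs contracting their line kernel with the covariant derivative of the basis fields (`dK1`/`dK2`: a line
differentiated at ONE end — print's `(G∂^{η*})` —, FILE 5's `dKs`: at both ends — print's `(∂^ηG∂^{η*})`).  (b) THE FREE SPECIALIZATION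
(§5, §7) = print's setting (p. 433 *"we put B̃ = 0"*, propagators `G^η_{(j)}(0)`): `B̃ = 0`, every φ′-line a scale piece `G ⊗ 1_N` (identity
internal structure, a HYPOTHESIS on the supplied kernel), all bonds summed, each vertex's localization weight a site function read at `b₋`
(p. 420; the cut-off `g_k` of (1.8)/(1.10) stays as a factor: `g = g₀·g_k`, `g′ = g₁·g_k`; at the one-vertex pictures print's `g(x)g′(x)` at
the same point is the weight `g₀g₁`).  (c) ORIENTATION: FILE 1 reads a line kernel from its lower endpoint; print reads the propagator of
each line of (3.26) from `x` resp. from `x′` as displayed; for the SYMMETRIC propagators `G^η_{(j)}(0)` of Sect. 3 the two readings agree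
(`dKernelL_of_symm`, `d2KernelT_of_symm`) — symmetry of the supplied kernel is a hypothesis of the `_print` theorems, the natural
(orientation-free) closed forms are stated first.  (d) `tr q²` IS the trace `Σ_a e_a·q(qe_a)` of `q²` on `W = ℝ^N` (`trq2`), produced by
the closed φ′-loop: the crossed loop of (3.25)₁ gives `Σ_{c,c′}(qe_c)_{c′}(qe_{c′})_c = +tr q²`, the direct loop of (3.25)₂ gives `Σ_c
(qe_c)·(qe_c) = −tr q²`, the local loops give `Σ_a e_a·q²e_a = tr q²`.  (e) CARRIERS: r15's `kerA`/`kerB`/`pairSum`/`legFar`/`term3`/`term4`/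
`lhs326`/`dAdjKernel`/`d2Kernel` live on the tree's other torus carrier (`Setup.Site`); as in FILE 5 they are RESTATED here on the
(Higgs)₂,₃ carrier symbol by symbol (`kerAT`, `kerBT`, `pairSumT`, `legFarT`, `term3T`, `term4T`, `lhs326T`, `dKernelR`, `d2KernelT`) —
the cell's honest word is «RESTATED on the HiggsLattice carrier», not «identified with r15's declarations»; the dictionary is (3.25)₁ ↔
`kerA` (`graphAmp_g325a_free_print`), (3.25)₂ ↔ `kerB` (`graphAmp_g325b_free_print`), (3.25)₃ ↔ `term3` (`graphAmp_g325c_free`), (3.25)₄ ↔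
`term4` (`graphAmp_g325d_free`), the class ↔ `lhs326` (`class325_free_print`); p39's `B3Eq326GraphKernelParts` (estimates of `kerA`/`kerB`)
is not used.
(f) THE RELATIVE SIGN (reading note, used nowhere): under one and the same typed set of rules — FILE 2's (1.8)/(1.10) as printed and
FILE 1's pairings — the kernel finds `E((3.25)₁) = +e²·T₁`, `E((3.25)₂) = −e²·T₂`, `E((3.25)₃) = +(e²/2)·T₃`, `E((3.25)₄) = +(e²/2)·T₄` per
attachment of `A`, `A′`, hence `ΣE(3.25) = −e²·(−T₁ + T₂ − T₃ − T₄)` = `−e²` × (the printed left side of (3.26)), whereas for (3.8)/(3.9)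
FILE 5 found `+e²` × (3.9): print's RELATIVE signs inside (3.26) are confirmed, its GLOBAL sign relative to (3.9) is opposite.  The global
sign of a renormalized class is immaterial for Proposition 1 (absolute values are bounded) and for (3.27)–(3.29); print does not display
the coupling constants or an overall sign convention for *"the expressions corresponding to these graphs"*, so this is recorded for the
fold owner as a READING NOTE, not as an erratum.

WHAT IS TYPED / PROVED (definitions with bodies + theorems; no `Prop` fact, no `sorry`; standard axioms).  §1 legs/lines of `g325a`,
`g325b` in the evaluator's vocabulary (`ta`, `tv`, `sotherA/B`, `votherA/B`, `slowerA/B_iff` decided on the closed instances `g325a 1 le_rfl`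
/ `g325b 1 le_rfl` — definitionally the same pairings —, `lineA0/A1`, `lineB0/B1`, **`univ_slineA/B`** (TWO φ′-lines), `smateA/B`, the
`IsEmpty` instances (no A′-line, no external φ′-leg, no output), `evA/B`, `univ_extVLegA/B`); §2 **`dK1`**, **`dK2`** (a line kernel
differentiated at its first / second endpoint), `dK1/2_single`, **`sum_dK1/2_single`** (linearity), `dKernelL`, `dKernelR`, `d2KernelT`,
`d2KernelT_diag`, `dKernelL_eq_dKernelR_transpose`, `dKernelL_of_symm`, `d2KernelT_of_symm`, **`dK1_zero_free`**, **`dK2_zero_free`**,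
**`dKs_zero_free2`** (any two bonds), **`trq2`**, `sum_inner_q_single` (`= −tr q²`), **`sum_q_single_cross`** (`= +tr q²`); bookkeeping
`tAssign`, `tEquiv`, `sum_tAssign`, **`alpha_sum2`**, `bAssign`, **`beta_sum2`**; §3 `rule18_basis`, `graphAmp_eqA/B`, **`graphAmp_g325a`**
(`E = Φ(∅)Ψ(∅)·e² Σ_{b,b′∈S} w₀w₁ η^{2d} g_kg_k A(b,b′) Σ_{c,c′} dK1(Ks ℓ₀)(b,qe_c;(b′₋,c′))·dK2(Ks ℓ₁)((b₋,c);b′,qe_{c′})`),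
**`graphAmp_g325b`** (`… Σ_{c,c′} dKs(Ks ℓ₀)(b,qe_c;b′,qe_{c′})·Ks ℓ₁((b₋,c),(b′₋,c′))`); §4 `pairVA/B`, `prodExtV_pairVA/B`; §5 `pairSumT`,
`legFarT`, `kerAT`, `kerBT`, `twoGraphs326T`, **`free_evalA/B`**, **`graphAmp_g325a_free`**, **`graphAmp_g325b_free`**; §6 `mul_pairSumT`,
`kerAT_eq`, `kerBT_eq`, **`graphAmp_g325a_free_print`** (`= Φ(∅)Ψ(∅)·e²·T₁`), **`graphAmp_g325b_free_print`** (`= −Φ(∅)Ψ(∅)·e²·T₂`),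
**`graphAmp_g325ab_free_print`** (`E₁ + E₂ = −e²·(−T₁ + T₂)`); §7 `kindC/D`, `sc/vc/sd/vd`, `sotherC/D`, `votherC/D`, `slowerC/D_iff`,
`lineC/D`, `uniqueSLineC/D`, `smateCD`, `IsEmpty` instances, `evC/D`, `univ_extVLegC/D`, `vlegs_two_basisV`, `cAssign/dAssign`, `cEquiv/dEquiv`,
**`alpha_sumC/D`**, **`beta_sumC/D`**, `pairVC/D`, `prodExtV_pairVC/D`, `sum_opCoeff_sq_diag`, `sum_sq_single_apply`, `graphAmp_eqC/D`,
**`rule110_two_zero_basis`**, **`rule18_two_zero_basis`**, **`graphAmp_g325c`** (`E = Φ(∅)Ψ(∅)·(e²/2) Σ_b w η^d g_k² A(b,b) Σ_{a,a′}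
(e_a·q²e_{a′}) Ks((b₋,a),(b₋,a′))`), **`graphAmp_g325d`** (`… (e²η/2) … Σ_c dK1(Ks)(b,q²e_c;(b₋,c))`), `term3T`, `term4T`, **`free_evalC/D`**,
**`graphAmp_g325c_free`** (`= Φ(∅)Ψ(∅)·(e²/2)·T₃`), **`graphAmp_g325d_free`** (`= Φ(∅)Ψ(∅)·(e²/2)·T₄`); §8 **`lhs326T`** (r15's `lhs326`
on this carrier), `term3T/4T_swap`, `term3T/4T_loc`, **`class325_free_print`** (the four pictures, the local ones summed over the two
attachments of `A`, `A′`: `= −e²·lhs326T`).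
HONEST SCOPE.  (a) Identification with (3.26) RESTATED on the (Higgs)₂,₃ carrier (reading (e)); no carrier bridge is built.  (b) The free
kernels `G ⊗ 1_N`, their symmetry, `B̃ = 0`, all bonds and site-valued weights are HYPOTHESES of the `free`/`print` theorems; the general
theorems of §3, §7 hold for arbitrary kernels, backgrounds, bond sets and joint external fields.  (c) No `RClass` of FILE 4 is formed
here (the class (3.25) needs no relocation on its left side; the right side of (3.26) — localization at `x`, Taylor remainder — is r15's
`eq326` and p39's estimates, untouched); print's *"proper combinatorial factor"* (p. 414) is modelled only as the explicit sum over the two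
attachments of the external fields in §8.  (d) Nothing analytic: no estimate, no (3.27)–(3.32).  (e) The sign statement (f) above is a
kernel-checked identity between typed objects; whether print intends another overall convention for vector self-energy classes is not
decidable from the text and is not claimed.  Unit `lit-balaban-p26` gen 41 (literature-prover-lit-balaban-p26-g41-0), HOME
`run/shared/lean/pub/lit-balaban/`, 2026-08-23.
-/

open Finset
open scoped BigOperators InnerProductSpace

namespace Literature.MathematicalPhysics.QuantumFieldTheory.Balaban1983to89.B3Eq326FromFeynmanRules

open Literature.MathematicalPhysics.QuantumFieldTheory.Balaban1983to89.HiggsLattice (ChargeData covDeriv)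
open Literature.MathematicalPhysics.QuantumFieldTheory.Balaban1983to89.B3Prop1 (VertexKind)
open Literature.MathematicalPhysics.QuantumFieldTheory.Balaban1983to89.B3Cor23Concrete (Graph Leg)
open Literature.MathematicalPhysics.QuantumFieldTheory.Balaban1983to89.B3Sect3LowestOrderGraphs (g325a g325b g325c g325d)
open Literature.MathematicalPhysics.QuantumFieldTheory.Balaban1983to89.B3Eq37Pictures (kind36 sLeg vLeg)
open Literature.MathematicalPhysics.QuantumFieldTheory.Balaban1983to89.B3GraphAmplitude
open Literature.MathematicalPhysics.QuantumFieldTheory.Balaban1983to89.B3GraphAmplitudeRules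
open Literature.MathematicalPhysics.QuantumFieldTheory.Balaban1983to89.B3Eq36TadpoleExpressions (basisE_eq opCoeff pleg110_basisE)
open Literature.MathematicalPhysics.QuantumFieldTheory.Balaban1983to89.B3ExpansionFromFeynmanRules
open Literature.MathematicalPhysics.QuantumFieldTheory.Balaban1983to89.B3Eq39FromFeynmanRules (dKs dq dKs_single sum_dKs_single vterm
  pleg18_basisE vlegs_one_basisV dKernelT siteBlock inner_basisE_left inner_covDeriv_zero_basisE dKs_zero siteBlock_diag inner_q_q)

noncomputable section

variable {nbar : ℕ}

/-! ## §1 The legs and the lines of the pictures (3.25)₁ (p18's `g325a`) and (3.25)₂ (`g325b`) in the evaluator's vocabulary -/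

section Legs

/-- The φ′-leg `j` of the vertex `i` of a picture on two vertices (1.8)_{1,0} (`j = 0`: the differentiated leg, `j = 1`: the leg
`qφ′(b₋)`), as a φ′-leg of the evaluator — the same term for both pictures (3.25)₁, (3.25)₂ (same vertex kinds, p18's `kind36`).
[cite: Balaban1983Higgs3, (3.25) p.439] -/
def ta (i j : Fin 2) : SLeg kind36 := ⟨i, j⟩

/-- The A′-leg of the vertex `i` (external in all four pictures (3.25)). [cite: Balaban1983Higgs3, (3.25) p.439] -/
def tv (i : Fin 2) : VLeg kind36 := ⟨i, ⟨0, Nat.one_pos⟩⟩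

/-- `ta i j` is p18's leg `sLeg i j`. [cite: Balaban1983Higgs3, (3.25) p.439] -/
theorem ta_toLeg (i j : Fin 2) : (ta i j).toLeg = sLeg i j := rfl

/-- `tv i` is p18's leg `vLeg i`. [cite: Balaban1983Higgs3, (3.25) p.439] -/
theorem tv_toLeg (i : Fin 2) : (tv i).toLeg = vLeg i := rfl

/-- every φ′-leg is one of the four `ta i j`. [cite: Balaban1983Higgs3, (3.25) p.439] -/
theorem ta_cases : ∀ ℓ : SLeg kind36, ℓ = ta 0 0 ∨ ℓ = ta 1 0 ∨ ℓ = ta 0 1 ∨ ℓ = ta 1 1 := by decide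

/-- every A′-leg is one of the two `tv i`. [cite: Balaban1983Higgs3, (3.25) p.439] -/
theorem tv_cases : ∀ ℓ : VLeg kind36, ℓ = tv 0 ∨ ℓ = tv 1 := by decide

/-- the four φ′-legs are distinct. [cite: Balaban1983Higgs3, (3.25) p.439] -/
theorem ta_injective2 : ∀ i j i' j' : Fin 2, ta i j = ta i' j' → i = i' ∧ j = j' := by decide

/-- the two A′-legs are distinct. [cite: Balaban1983Higgs3, (3.25) p.439] -/
theorem tv_injective : Function.Injective tv := by
  intro i j h
  simp only [tv, Sigma.mk.inj_iff] at h
  exact h.1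

/-- The vertex `i` (`i = 0`: `x`, `i = 1`: `x′`) of (3.25)₁ as a vertex of p18's `g325a`. [cite: Balaban1983Higgs3, (3.25) p.439] -/
def vxa (nbar : ℕ) (hn : 1 ≤ nbar) (i : Fin 2) : Fin (g325a nbar hn).nV := i

/-- The vertex `i` of (3.25)₂ as a vertex of p18's `g325b`. [cite: Balaban1983Higgs3, (3.25) p.439] -/
def vxb (nbar : ℕ) (hn : 1 ≤ nbar) (i : Fin 2) : Fin (g325b nbar hn).nV := i

variable {hn : 1 ≤ nbar}

/-! ### (3.25)₁: the two φ′-lines join the differentiated leg of each vertex to the undifferentiated leg of the other -/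

/-- **The φ′-lines of (3.25)₁**: the partner of `ta i j` is `ta i.rev j.rev` (p18's `g325a.other`, verbatim: leg `j` of vertex `i` to
leg `1 − j` of the other vertex). [cite: Balaban1983Higgs3, (3.25) p.439] -/
theorem sotherA (i j : Fin 2) : (sPairing (g325a nbar hn)).other (ta i j) = some (ta i.rev j.rev) := by
  show spartner (g325a nbar hn) (ta i j) = some (ta i.rev j.rev)
  refine (spartner_eq_some_iff _ _ _).2 ?_
  fin_cases i <;> fin_cases j <;> rfl

/-- the A′-legs of (3.25)₁ are external. [cite: Balaban1983Higgs3, (3.25) p.439] -/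
theorem votherA (i : Fin 2) : (vPairing (g325a nbar hn)).other (tv i) = none := by
  show vpartner (g325a nbar hn) (tv i) = none
  refine (vpartner_eq_none_iff _ _).2 ?_
  fin_cases i <;> rfl

/-- `ta 0 0` and `ta 0 1` are the lower endpoints of the two φ′-lines of (3.25)₁, and the only ones. [cite: Balaban1983Higgs3, (3.25) p.439] -/
theorem slowerA_iff : ∀ ℓ : SLeg (g325a nbar hn).kind, (sPairing (g325a nbar hn)).isLower sRank ℓ = true ↔ ℓ = ta 0 0 ∨ ℓ = ta 0 1 := by
  show ∀ ℓ : SLeg (g325a 1 le_rfl).kind, (sPairing (g325a 1 le_rfl)).isLower sRank ℓ = true ↔ ℓ = ta 0 0 ∨ ℓ = ta 0 1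
  decide

/-- The φ′-line of (3.25)₁ through the differentiated leg of `x` (lower endpoint `ta 0 0`, mate `ta 1 1`). [cite: Balaban1983Higgs3, (3.25) p.439] -/
def lineA0 (nbar : ℕ) (hn : 1 ≤ nbar) : SLine (g325a nbar hn) := ⟨ta 0 0, (slowerA_iff _).2 (Or.inl rfl)⟩

/-- The φ′-line of (3.25)₁ through the undifferentiated leg of `x` (lower endpoint `ta 0 1`, mate `ta 1 0`). [cite: Balaban1983Higgs3, (3.25) p.439] -/
def lineA1 (nbar : ℕ) (hn : 1 ≤ nbar) : SLine (g325a nbar hn) := ⟨ta 0 1, (slowerA_iff _).2 (Or.inr rfl)⟩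

/-- the two φ′-lines of (3.25)₁ are distinct. [cite: Balaban1983Higgs3, (3.25) p.439] -/
theorem lineA0_ne_lineA1 : lineA0 nbar hn ≠ lineA1 nbar hn := by
  intro h
  have h' := congrArg Subtype.val h
  exact absurd (ta_injective2 _ _ _ _ h').2 (by decide)

/-- the φ′-lines of (3.25)₁ are exactly `lineA0`, `lineA1`. [cite: Balaban1983Higgs3, (3.25) p.439] -/
theorem univ_slineA : (univ : Finset (SLine (g325a nbar hn))) = {lineA0 nbar hn, lineA1 nbar hn} := by
  ext l
  simp only [Finset.mem_univ, Finset.mem_insert, Finset.mem_singleton, true_iff]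
  rcases (slowerA_iff l.1).1 l.2 with h | h
  · left; exact Subtype.ext h
  · right; exact Subtype.ext h

/-- the mates: `ta 0 0 ↦ ta 1 1`, `ta 0 1 ↦ ta 1 0`. [cite: Balaban1983Higgs3, (3.25) p.439] -/
theorem smateA : (sPairing (g325a nbar hn)).mate (ta 0 0) = ta 1 1 ∧ (sPairing (g325a nbar hn)).mate (ta 0 1) = ta 1 0 :=
  ⟨(sPairing (g325a nbar hn)).mate_eq (sotherA 0 0), (sPairing (g325a nbar hn)).mate_eq (sotherA 0 1)⟩

/-- (3.25)₁ has no internal A′-line. [cite: Balaban1983Higgs3, (3.25) p.439] -/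
instance instIsEmptyVLineA : IsEmpty (VLine (g325a nbar hn)) :=
  ⟨fun l => by
    have h := l.2
    rcases tv_cases l.1 with e | e <;> rw [e, (vPairing (g325a nbar hn)).not_isLower_of_none vRank (votherA _)] at h <;> exact Bool.false_ne_true h⟩

/-- (3.25)₁ has no external φ′-leg. [cite: Balaban1983Higgs3, (3.25) p.439] -/
instance instIsEmptyExtSLegA : IsEmpty (ExtSLeg (g325a nbar hn)) :=
  ⟨fun l => by
    have h := l.2
    rcases ta_cases l.1 with e | e | e | e <;> rw [e, sotherA] at h <;> cases h⟩

/-- no averaging output. [cite: Balaban1983Higgs3, (3.25) p.439] -/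
instance instIsEmptyOLegA : IsEmpty (OLeg (g325a nbar hn).kind) := ⟨fun ℓ => Fin.elim0 (ℓ.2 : Fin 0)⟩

/-- no averaging output (the vertex kinds (1.8)_{1,0} have no output slot). [cite: Balaban1983Higgs3, (3.25) p.439] -/
instance instIsEmptyOLeg36 : IsEmpty (OLeg kind36) := ⟨fun ℓ => Fin.elim0 (ℓ.2 : Fin 0)⟩

/-- The external A′-leg of the vertex `i` of (3.25)₁. [cite: Balaban1983Higgs3, (3.25) p.439] -/
def evA (nbar : ℕ) (hn : 1 ≤ nbar) (i : Fin 2) : ExtVLeg (g325a nbar hn) := ⟨tv i, votherA i⟩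

/-- `evA 0 ≠ evA 1`. [cite: Balaban1983Higgs3, (3.25) p.439] -/
theorem evA0_ne_evA1 : evA nbar hn 0 ≠ evA nbar hn 1 := fun h => absurd (tv_injective (congrArg Subtype.val h)) (by decide)

/-- the external A′-legs of (3.25)₁ are exactly `evA 0`, `evA 1`. [cite: Balaban1983Higgs3, (3.25) p.439] -/
theorem univ_extVLegA : (univ : Finset (ExtVLeg (g325a nbar hn))) = {evA nbar hn 0, evA nbar hn 1} := by
  ext l
  simp only [Finset.mem_univ, Finset.mem_insert, Finset.mem_singleton, true_iff]
  rcases tv_cases l.1 with h | h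
  · left; exact Subtype.ext h
  · right; exact Subtype.ext h

/-! ### (3.25)₂: one φ′-line joins the two differentiated legs, the other the two undifferentiated ones -/

/-- **The φ′-lines of (3.25)₂**: the partner of `ta i j` is `ta i.rev j` (p18's `g325b.other`: leg `j` to leg `j` of the other vertex).
[cite: Balaban1983Higgs3, (3.25) p.439] -/
theorem sotherB (i j : Fin 2) : (sPairing (g325b nbar hn)).other (ta i j) = some (ta i.rev j) := by
  show spartner (g325b nbar hn) (ta i j) = some (ta i.rev j)
  refine (spartner_eq_some_iff _ _ _).2 ?_
  fin_cases i <;> fin_cases j <;> rfl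

/-- the A′-legs of (3.25)₂ are external. [cite: Balaban1983Higgs3, (3.25) p.439] -/
theorem votherB (i : Fin 2) : (vPairing (g325b nbar hn)).other (tv i) = none := by
  show vpartner (g325b nbar hn) (tv i) = none
  refine (vpartner_eq_none_iff _ _).2 ?_
  fin_cases i <;> rfl

/-- `ta 0 0` and `ta 0 1` are the lower endpoints of the two φ′-lines of (3.25)₂, and the only ones. [cite: Balaban1983Higgs3, (3.25) p.439] -/
theorem slowerB_iff : ∀ ℓ : SLeg (g325b nbar hn).kind, (sPairing (g325b nbar hn)).isLower sRank ℓ = true ↔ ℓ = ta 0 0 ∨ ℓ = ta 0 1 := by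
  show ∀ ℓ : SLeg (g325b 1 le_rfl).kind, (sPairing (g325b 1 le_rfl)).isLower sRank ℓ = true ↔ ℓ = ta 0 0 ∨ ℓ = ta 0 1
  decide

/-- The φ′-line of (3.25)₂ through the two DIFFERENTIATED legs (lower endpoint `ta 0 0`, mate `ta 1 0`). [cite: Balaban1983Higgs3, (3.25) p.439] -/
def lineB0 (nbar : ℕ) (hn : 1 ≤ nbar) : SLine (g325b nbar hn) := ⟨ta 0 0, (slowerB_iff _).2 (Or.inl rfl)⟩

/-- The φ′-line of (3.25)₂ through the two UNDIFFERENTIATED legs (lower endpoint `ta 0 1`, mate `ta 1 1`). [cite: Balaban1983Higgs3, (3.25) p.439] -/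
def lineB1 (nbar : ℕ) (hn : 1 ≤ nbar) : SLine (g325b nbar hn) := ⟨ta 0 1, (slowerB_iff _).2 (Or.inr rfl)⟩

/-- the two φ′-lines of (3.25)₂ are distinct. [cite: Balaban1983Higgs3, (3.25) p.439] -/
theorem lineB0_ne_lineB1 : lineB0 nbar hn ≠ lineB1 nbar hn := by
  intro h
  have h' := congrArg Subtype.val h
  exact absurd (ta_injective2 _ _ _ _ h').2 (by decide)

/-- the φ′-lines of (3.25)₂ are exactly `lineB0`, `lineB1`. [cite: Balaban1983Higgs3, (3.25) p.439] -/
theorem univ_slineB : (univ : Finset (SLine (g325b nbar hn))) = {lineB0 nbar hn, lineB1 nbar hn} := by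
  ext l
  simp only [Finset.mem_univ, Finset.mem_insert, Finset.mem_singleton, true_iff]
  rcases (slowerB_iff l.1).1 l.2 with h | h
  · left; exact Subtype.ext h
  · right; exact Subtype.ext h

/-- the mates: `ta 0 0 ↦ ta 1 0`, `ta 0 1 ↦ ta 1 1`. [cite: Balaban1983Higgs3, (3.25) p.439] -/
theorem smateB : (sPairing (g325b nbar hn)).mate (ta 0 0) = ta 1 0 ∧ (sPairing (g325b nbar hn)).mate (ta 0 1) = ta 1 1 :=
  ⟨(sPairing (g325b nbar hn)).mate_eq (sotherB 0 0), (sPairing (g325b nbar hn)).mate_eq (sotherB 0 1)⟩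

/-- (3.25)₂ has no internal A′-line. [cite: Balaban1983Higgs3, (3.25) p.439] -/
instance instIsEmptyVLineB : IsEmpty (VLine (g325b nbar hn)) :=
  ⟨fun l => by
    have h := l.2
    rcases tv_cases l.1 with e | e <;> rw [e, (vPairing (g325b nbar hn)).not_isLower_of_none vRank (votherB _)] at h <;> exact Bool.false_ne_true h⟩

/-- (3.25)₂ has no external φ′-leg. [cite: Balaban1983Higgs3, (3.25) p.439] -/
instance instIsEmptyExtSLegB : IsEmpty (ExtSLeg (g325b nbar hn)) :=
  ⟨fun l => by
    have h := l.2
    rcases ta_cases l.1 with e | e | e | e <;> rw [e, sotherB] at h <;> cases h⟩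

/-- no averaging output. [cite: Balaban1983Higgs3, (3.25) p.439] -/
instance instIsEmptyOLegB : IsEmpty (OLeg (g325b nbar hn).kind) := ⟨fun ℓ => Fin.elim0 (ℓ.2 : Fin 0)⟩

/-- The external A′-leg of the vertex `i` of (3.25)₂. [cite: Balaban1983Higgs3, (3.25) p.439] -/
def evB (nbar : ℕ) (hn : 1 ≤ nbar) (i : Fin 2) : ExtVLeg (g325b nbar hn) := ⟨tv i, votherB i⟩

/-- `evB 0 ≠ evB 1`. [cite: Balaban1983Higgs3, (3.25) p.439] -/
theorem evB0_ne_evB1 : evB nbar hn 0 ≠ evB nbar hn 1 := fun h => absurd (tv_injective (congrArg Subtype.val h)) (by decide)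

/-- the external A′-legs of (3.25)₂ are exactly `evB 0`, `evB 1`. [cite: Balaban1983Higgs3, (3.25) p.439] -/
theorem univ_extVLegB : (univ : Finset (ExtVLeg (g325b nbar hn))) = {evB nbar hn 0, evB nbar hn 1} := by
  ext l
  simp only [Finset.mem_univ, Finset.mem_insert, Finset.mem_singleton, true_iff]
  rcases tv_cases l.1 with h | h
  · left; exact Subtype.ext h
  · right; exact Subtype.ext h

end Legs

/-! ## §2 Singly and doubly differentiated line kernels, the trace `tr q²`, index bookkeeping -/

section Kernels

variable {P : HiggsLattice.Params} {N k : ℕ}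

/-- **The kernel of a φ′-line differentiated at its FIRST endpoint** (a differentiated leg `(D^η_B̃ φ′)(b)` of (1.8) paired with an
undifferentiated leg at the index `r`): `Σ_p K(p, r)·[(D^η_B̃ δ_p)(b)·u]` — in print's notation for (3.26) the kernel `(∂^η G)` resp.
`(G∂^{η*})ᵀ` of the line, at a general background and contracted with `u`. [cite: Balaban1983Higgs3, (3.26) p.440] [cite: Balaban1983Higgs3, p.414] -/
def dK1 (C : ChargeData N) (B : HiggsLattice.VecField P 0) (K : HiggsLattice.Site P 0 × Fin N → HiggsLattice.Site P 0 × Fin N → ℝ)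
    (b : HiggsLattice.PBond P 0) (u : HiggsCovariance.E N) (r : HiggsLattice.Site P 0 × Fin N) : ℝ :=
  ∑ p : HiggsLattice.Site P 0 × Fin N, K p r * ⟪covDeriv C B (basisE p) b, u⟫_ℝ

/-- **The kernel of a φ′-line differentiated at its SECOND endpoint**: `Σ_{p′} K(r, p′)·[(D^η_B̃ δ_{p′})(b′)·u′]` — print's
`(G∂^{η*}_{μ′})(x, x′)` of (3.26) at a general background. [cite: Balaban1983Higgs3, (3.26) p.440] [cite: Balaban1983Higgs3, p.414] -/
def dK2 (C : ChargeData N) (B : HiggsLattice.VecField P 0) (K : HiggsLattice.Site P 0 × Fin N → HiggsLattice.Site P 0 × Fin N → ℝ)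
    (r : HiggsLattice.Site P 0 × Fin N) (b' : HiggsLattice.PBond P 0) (u' : HiggsCovariance.E N) : ℝ :=
  ∑ p' : HiggsLattice.Site P 0 × Fin N, K r p' * ⟪covDeriv C B (basisE p') b', u'⟫_ℝ

/-- `dK1` against `q e_c` in terms of FILE 5's `dq`. [cite: Balaban1983Higgs3, (3.26) p.440] -/
theorem dK1_single (C : ChargeData N) (B : HiggsLattice.VecField P 0) (K : HiggsLattice.Site P 0 × Fin N → HiggsLattice.Site P 0 × Fin N → ℝ)
    (b : HiggsLattice.PBond P 0) (c : Fin N) (r : HiggsLattice.Site P 0 × Fin N) :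
    dK1 C B K b (C.q (EuclideanSpace.single c (1 : ℝ))) r = ∑ p : HiggsLattice.Site P 0 × Fin N, K p r * dq C B p b c := rfl

/-- `dK2` against `q e_{c′}` in terms of `dq`. [cite: Balaban1983Higgs3, (3.26) p.440] -/
theorem dK2_single (C : ChargeData N) (B : HiggsLattice.VecField P 0) (K : HiggsLattice.Site P 0 × Fin N → HiggsLattice.Site P 0 × Fin N → ℝ)
    (r : HiggsLattice.Site P 0 × Fin N) (b' : HiggsLattice.PBond P 0) (c' : Fin N) :
    dK2 C B K r b' (C.q (EuclideanSpace.single c' (1 : ℝ))) = ∑ p' : HiggsLattice.Site P 0 × Fin N, K r p' * dq C B p' b' c' := rfl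

/-- kernel: a vector of `W = ℝ^N` is the sum of its components times the basis vectors. [folklore] -/
private theorem sum_smul_single' (u : HiggsCovariance.E N) : ∑ a : Fin N, u a • EuclideanSpace.single a (1 : ℝ) = u := by
  ext i
  simp [Finset.sum_apply, Pi.single_apply]

/-- **`dK1` is linear in the vector**: `Σ_c dK1(b, T e_c; r)·u_c = dK1(b, T u; r)`. [cite: Balaban1983Higgs3, (3.26) p.440] -/
theorem sum_dK1_single (C : ChargeData N) (B : HiggsLattice.VecField P 0) (K : HiggsLattice.Site P 0 × Fin N → HiggsLattice.Site P 0 × Fin N → ℝ)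
    (b : HiggsLattice.PBond P 0) (T : HiggsCovariance.E N →L[ℝ] HiggsCovariance.E N) (u : HiggsCovariance.E N) (r : HiggsLattice.Site P 0 × Fin N) :
    ∑ c : Fin N, dK1 C B K b (T (EuclideanSpace.single c (1 : ℝ))) r * u c = dK1 C B K b (T u) r := by
  unfold dK1
  conv_rhs => rw [← sum_smul_single' u]
  rw [map_sum]
  simp only [map_smul, inner_sum, real_inner_smul_right, Finset.mul_sum, Finset.sum_mul]
  rw [Finset.sum_comm]
  exact Finset.sum_congr rfl fun p _ => Finset.sum_congr rfl fun c _ => by ring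

/-- **`dK2` is linear in the vector**: `Σ_{c′} dK2(r; b′, T e_{c′})·u_{c′} = dK2(r; b′, T u)`. [cite: Balaban1983Higgs3, (3.26) p.440] -/
theorem sum_dK2_single (C : ChargeData N) (B : HiggsLattice.VecField P 0) (K : HiggsLattice.Site P 0 × Fin N → HiggsLattice.Site P 0 × Fin N → ℝ)
    (r : HiggsLattice.Site P 0 × Fin N) (b' : HiggsLattice.PBond P 0) (T : HiggsCovariance.E N →L[ℝ] HiggsCovariance.E N) (u : HiggsCovariance.E N) :
    ∑ c : Fin N, dK2 C B K r b' (T (EuclideanSpace.single c (1 : ℝ))) * u c = dK2 C B K r b' (T u) := by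
  unfold dK2
  conv_rhs => rw [← sum_smul_single' u]
  rw [map_sum]
  simp only [map_smul, inner_sum, real_inner_smul_right, Finset.mul_sum, Finset.sum_mul]
  rw [Finset.sum_comm]
  exact Finset.sum_congr rfl fun p _ => Finset.sum_congr rfl fun c _ => by ring

/-- **The kernel `(∂^η_μ G)(x, y)`**: the forward difference quotient of a kernel in its FIRST variable, `c[G(x+e_μ, y) − G(x, y)]`,
`c = η⁻¹` (for a symmetric `G` this is print's `(G∂^{η*}_μ)(y, x)`, r15's `dAdjKernel c μ G y x`). [cite: Balaban1983Higgs3, (3.26) p.440] -/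
def dKernelL (c : ℝ) (μ : Fin P.d) (G : HiggsLattice.Site P 0 → HiggsLattice.Site P 0 → ℝ) (x y : HiggsLattice.Site P 0) : ℝ :=
  c * (G (x.shift μ) y - G x y)

/-- **The kernel `(G∂^{η*}_μ)(y, x)` of (3.26)**: the forward difference quotient of a kernel in its SECOND variable,
`c[G(y, x+e_μ) − G(y, x)]`, `c = η⁻¹` — r15's `B3Sect3VectorSelfEnergy.dAdjKernel c μ G y x` symbol by symbol, on the (Higgs)₂,₃
torus carrier (the two torus carriers of the tree are not bridged). [cite: Balaban1983Higgs3, (3.26) p.440] -/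
def dKernelR (c : ℝ) (μ : Fin P.d) (G : HiggsLattice.Site P 0 → HiggsLattice.Site P 0 → ℝ) (y x : HiggsLattice.Site P 0) : ℝ :=
  c * (G y (x.shift μ) - G y x)

/-- **The kernel `(∂^η_μ G ∂^{η*}_{μ′})(x, x′)` of (3.26)**: `c²[G(x+e_μ, x′+e_{μ′}) − G(x+e_μ, x′) − G(x, x′+e_{μ′}) + G(x, x′)]` — r15's
`B3Sect3VectorSelfEnergy.d2Kernel c μ μ′ G x x′` symbol by symbol; on the diagonal `μ′ = μ` FILE 5's `dKernelT`.
[cite: Balaban1983Higgs3, (3.26) p.440] -/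
def d2KernelT (c : ℝ) (μ μ' : Fin P.d) (G : HiggsLattice.Site P 0 → HiggsLattice.Site P 0 → ℝ) (x x' : HiggsLattice.Site P 0) : ℝ :=
  c ^ 2 * (G (x.shift μ) (x'.shift μ') - G (x.shift μ) x' - G x (x'.shift μ') + G x x')

/-- on the diagonal `d2KernelT` is FILE 5's `dKernelT`. [cite: Balaban1983Higgs3, (3.9) p.435] -/
theorem d2KernelT_diag (c : ℝ) (μ : Fin P.d) (G : HiggsLattice.Site P 0 → HiggsLattice.Site P 0 → ℝ) :
    d2KernelT c μ μ G = dKernelT c μ G := rfl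

/-- the two single differences are transposes of each other: `(∂_μ G)(x, y) = (Gᵀ∂^*_μ)(y, x)`. [cite: Balaban1983Higgs3, (3.26) p.440] -/
theorem dKernelL_eq_dKernelR_transpose (c : ℝ) (μ : Fin P.d) (G : HiggsLattice.Site P 0 → HiggsLattice.Site P 0 → ℝ) (x y : HiggsLattice.Site P 0) :
    dKernelL c μ G x y = dKernelR c μ (fun a b => G b a) y x := rfl

/-- for a SYMMETRIC kernel `(∂_μ G)(x, y) = (G∂^*_μ)(y, x)` (print's propagators `G^η_{(j)}(0)` are symmetric). [cite: Balaban1983Higgs3, (3.26) p.440] -/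
theorem dKernelL_of_symm (c : ℝ) (μ : Fin P.d) (G : HiggsLattice.Site P 0 → HiggsLattice.Site P 0 → ℝ) (hG : ∀ a b, G a b = G b a)
    (x y : HiggsLattice.Site P 0) : dKernelL c μ G x y = dKernelR c μ G y x := by
  unfold dKernelL dKernelR
  rw [hG (x.shift μ) y, hG x y]

/-- for a symmetric kernel `(∂_μ G ∂^*_{μ′})(x, x′) = (∂_{μ′} G ∂^*_μ)(x′, x)`. [cite: Balaban1983Higgs3, (3.26) p.440] -/
theorem d2KernelT_of_symm (c : ℝ) (μ μ' : Fin P.d) (G : HiggsLattice.Site P 0 → HiggsLattice.Site P 0 → ℝ) (hG : ∀ a b, G a b = G b a)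
    (x x' : HiggsLattice.Site P 0) : d2KernelT c μ μ' G x x' = d2KernelT c μ' μ G x' x := by
  unfold d2KernelT
  rw [hG (x.shift μ) (x'.shift μ'), hG (x.shift μ) x', hG x (x'.shift μ'), hG x x']
  ring

/-- **`dK1` AT ZERO BACKGROUND WITH THE FREE KERNEL `G ⊗ 1_N`**: `dK1(b, u; (y, c)) = (∂^η_μ G)(x, y)·u_c` for `b = ⟨x, x+ηe_μ⟩`.
[cite: Balaban1983Higgs3, (3.26) p.440] -/
theorem dK1_zero_free (C : ChargeData N) (G : HiggsLattice.Site P 0 → HiggsLattice.Site P 0 → ℝ) (x : HiggsLattice.Site P 0) (μ : Fin P.d)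
    (u : HiggsCovariance.E N) (y : HiggsLattice.Site P 0) (c : Fin N) :
    dK1 C 0 (fun p p' => if p.2 = p'.2 then G p.1 p'.1 else 0) ⟨x, μ⟩ u (y, c) = dKernelL (P.mesh 0)⁻¹ μ G x y * u c := by
  unfold dK1
  simp only [inner_covDeriv_zero_basisE, Fintype.sum_prod_type, ite_mul, zero_mul, Finset.sum_ite_eq', Finset.mem_univ, if_true]
  simp only [mul_sub, Finset.sum_sub_distrib, mul_ite, mul_zero, Finset.sum_ite_eq, Finset.mem_univ, if_true]
  unfold dKernelL HiggsLattice.PBond.tgt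
  ring

/-- **`dK2` AT ZERO BACKGROUND WITH THE FREE KERNEL**: `dK2((y, c); b′, u′) = (G∂^{η*}_{μ′})(y, x′)·u′_c` for `b′ = ⟨x′, x′+ηe_{μ′}⟩`.
[cite: Balaban1983Higgs3, (3.26) p.440] -/
theorem dK2_zero_free (C : ChargeData N) (G : HiggsLattice.Site P 0 → HiggsLattice.Site P 0 → ℝ) (y : HiggsLattice.Site P 0) (c : Fin N)
    (x' : HiggsLattice.Site P 0) (μ' : Fin P.d) (u' : HiggsCovariance.E N) :
    dK2 C 0 (fun p p' => if p.2 = p'.2 then G p.1 p'.1 else 0) (y, c) ⟨x', μ'⟩ u' = dKernelR (P.mesh 0)⁻¹ μ' G y x' * u' c := by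
  unfold dK2
  simp only [inner_covDeriv_zero_basisE, Fintype.sum_prod_type]
  have h : ∀ (z : HiggsLattice.Site P 0) (a : Fin N), (if c = a then G y z else 0) * ((P.mesh 0)⁻¹ *
      ((if HiggsLattice.PBond.tgt ⟨x', μ'⟩ = z then u' a else 0) - (if x' = z then u' a else 0))) =
      if c = a then G y z * ((P.mesh 0)⁻¹ * ((if HiggsLattice.PBond.tgt ⟨x', μ'⟩ = z then u' c else 0) - (if x' = z then u' c else 0))) else 0 := by
    intro z a
    by_cases hc : c = a
    · subst hc; simp
    · simp [hc]
  simp only [h, Finset.sum_ite_eq, Finset.mem_univ, if_true]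
  simp only [mul_sub, Finset.sum_sub_distrib, mul_ite, mul_zero, Finset.sum_ite_eq, Finset.mem_univ, if_true]
  unfold dKernelR HiggsLattice.PBond.tgt
  ring

/-- **`dKs` AT ZERO BACKGROUND WITH THE FREE KERNEL, ANY TWO BONDS** (FILE 5's `dKs_zero_free` had parallel bonds): for `b = ⟨x, x+ηe_μ⟩`,
`b′ = ⟨x′, x′+ηe_{μ′}⟩`, `dKs(b, u; b′, u′) = (∂^η_μ G ∂^{η*}_{μ′})(x, x′)·(u·u′)`. [cite: Balaban1983Higgs3, (3.26) p.440] -/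
theorem dKs_zero_free2 (C : ChargeData N) (G : HiggsLattice.Site P 0 → HiggsLattice.Site P 0 → ℝ) (x x' : HiggsLattice.Site P 0)
    (μ μ' : Fin P.d) (u u' : HiggsCovariance.E N) :
    dKs C 0 (fun p p' => if p.2 = p'.2 then G p.1 p'.1 else 0) ⟨x, μ⟩ u ⟨x', μ'⟩ u' = d2KernelT (P.mesh 0)⁻¹ μ μ' G x x' * ⟪u, u'⟫_ℝ := by
  rw [dKs_zero]
  simp only [siteBlock_diag]
  unfold d2KernelT HiggsLattice.PBond.tgt
  ring

/-- **`tr q²`** — the trace of the square of the charge matrix over the internal space `W = ℝ^N`: `Σ_a e_a·q(q e_a)` (print's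
"tr q²" of (3.26); nonpositive for the antisymmetric `q`). [cite: Balaban1983Higgs3, (3.26) p.440] -/
def trq2 (C : ChargeData N) : ℝ :=
  ∑ a : Fin N, ⟪EuclideanSpace.single a (1 : ℝ), C.q (C.q (EuclideanSpace.single a (1 : ℝ)))⟫_ℝ

/-- The closed φ′-loop with both `q`'s on the same line pair: `Σ_c (q e_c)·(q e_c) = −tr q²`. [cite: Balaban1983Higgs3, (3.26) p.440] -/
theorem sum_inner_q_single (C : ChargeData N) :
    ∑ c : Fin N, ⟪C.q (EuclideanSpace.single c (1 : ℝ)), C.q (EuclideanSpace.single c (1 : ℝ))⟫_ℝ = -trq2 C := by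
  unfold trq2
  rw [← Finset.sum_neg_distrib]
  exact Finset.sum_congr rfl fun c _ => inner_q_q C _ _

/-- kernel: contracting the components of the `q e_c` against a vector reassembles `q`: `Σ_c (q e_c)_{a}·v_c = (q v)_a`. [folklore] -/
private theorem sum_q_single_apply (C : ChargeData N) (v : HiggsCovariance.E N) (a : Fin N) :
    ∑ c : Fin N, (C.q (EuclideanSpace.single c (1 : ℝ))) a * v c = (C.q v) a := by
  have hco : ∀ w : HiggsCovariance.E N, w a = ⟪EuclideanSpace.single a (1 : ℝ), w⟫_ℝ := fun w => by
    rw [EuclideanSpace.inner_single_left]; simp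
  rw [hco (C.q v)]
  conv_rhs => rw [← sum_smul_single' v, map_sum, inner_sum]
  refine Finset.sum_congr rfl fun c _ => ?_
  rw [hco (C.q (EuclideanSpace.single c 1)), map_smul, real_inner_smul_right, mul_comm]

/-- The closed φ′-loop with the two `q`'s on different lines (the crossed pairing): `Σ_{c,c′} (q e_c)_{c′}·(q e_{c′})_c = tr q²`.
[cite: Balaban1983Higgs3, (3.26) p.440] -/
theorem sum_q_single_cross (C : ChargeData N) :
    ∑ c : Fin N, ∑ c' : Fin N, (C.q (EuclideanSpace.single c (1 : ℝ))) c' * (C.q (EuclideanSpace.single c' (1 : ℝ))) c = trq2 C := by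
  rw [Finset.sum_comm]
  unfold trq2
  refine Finset.sum_congr rfl fun c' _ => ?_
  rw [sum_q_single_apply, EuclideanSpace.inner_single_left]
  simp

/-- kernel: a sum over the positively oriented bonds is the sum over initial points and directions. [folklore] -/
private theorem sum_bond {j : ℕ} (F : HiggsLattice.PBond P j → ℝ) :
    ∑ b, F b = ∑ x : HiggsLattice.Site P j, ∑ μ : Fin P.d, F ⟨x, μ⟩ := by
  let e : HiggsLattice.Site P j × Fin P.d ≃ HiggsLattice.PBond P j :=
    ⟨fun p => ⟨p.1, p.2⟩, fun b => (b.src, b.dir), fun _ => rfl, fun _ => rfl⟩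
  rw [← Fintype.sum_equiv e (fun p => F ⟨p.1, p.2⟩) F fun _ => rfl, Fintype.sum_prod_type]

/-- kernel: two outer sums over finite types commute with two inner sums over finsets. [folklore] -/
private theorem sum_comm4 {ι κ μ ν : Type*} [Fintype ι] [Fintype κ] (s : Finset μ) (t : Finset ν) (F : ι → κ → μ → ν → ℝ) :
    ∑ α, ∑ β, ∑ b ∈ s, ∑ b' ∈ t, F α β b b' = ∑ b ∈ s, ∑ b' ∈ t, ∑ α, ∑ β, F α β b b' := by
  have h1 : ∀ α, ∑ β, ∑ b ∈ s, ∑ b' ∈ t, F α β b b' = ∑ b ∈ s, ∑ b' ∈ t, ∑ β, F α β b b' := by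
    intro α
    rw [Finset.sum_comm]
    exact Finset.sum_congr rfl fun b _ => Finset.sum_comm
  simp only [h1]
  rw [Finset.sum_comm]
  exact Finset.sum_congr rfl fun b _ => Finset.sum_comm

end Kernels

/-! ### Index assignments of the four φ′-legs and the two A′-legs -/

section Assignments

variable {P : HiggsLattice.Params} {N : ℕ}

/-- kernel: a site delta on the first component of an index `(x, c)` leaves the sum over the internal index. [folklore] -/
private theorem sum_delta_fst {S : Type*} [Fintype S] [DecidableEq S] {N : ℕ} (x : S) (G : S × Fin N → ℝ) :
    ∑ r : S × Fin N, (if x = r.1 then (1 : ℝ) else 0) * G r = ∑ c : Fin N, G (x, c) := by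
  simp only [Fintype.sum_prod_type]
  rw [Finset.sum_eq_single x]
  · simp only [if_true, one_mul]
  · intro a _ ha
    simp only [if_neg (fun h : x = a => ha h.symm), zero_mul, Finset.sum_const_zero]
  · intro h
    exact absurd (Finset.mem_univ x) h

/-- kernel: distinctness of the four φ′-legs, in the forms used below. [cite: Balaban1983Higgs3, (3.25) p.439] -/
private theorem ta_ne : ta 1 0 ≠ ta 0 0 ∧ ta 0 1 ≠ ta 0 0 ∧ ta 0 1 ≠ ta 1 0 ∧ ta 1 1 ≠ ta 0 0 ∧ ta 1 1 ≠ ta 1 0 ∧ ta 1 1 ≠ ta 0 1 := by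
  decide

/-- The φ′-leg index assignment with prescribed values at the four legs (`p` on `ta 0 0`, `p′` on `ta 1 0`, `r` on `ta 0 1`, `r′` on
`ta 1 1`). [cite: Balaban1983Higgs3, (3.25) p.439] -/
def tAssign {X : Type*} (p p' r r' : X) : SLeg kind36 → X :=
  fun ℓ => if ℓ = ta 0 0 then p else if ℓ = ta 1 0 then p' else if ℓ = ta 0 1 then r else r'

/-- values of `tAssign`. [cite: Balaban1983Higgs3, (3.25) p.439] -/
theorem tAssign_apply {X : Type*} (p p' r r' : X) :
    tAssign p p' r r' (ta 0 0) = p ∧ tAssign p p' r r' (ta 1 0) = p' ∧ tAssign p p' r r' (ta 0 1) = r ∧ tAssign p p' r r' (ta 1 1) = r' := by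
  obtain ⟨h1, h2, h3, h4, h5, h6⟩ := ta_ne
  simp [tAssign, h1, h2, h3, h4, h5, h6]

/-- The values at the four legs ↔ the φ′-leg index assignments, as an equivalence. [cite: Balaban1983Higgs3, (3.25) p.439] -/
def tEquiv (X : Type*) : X × X × X × X ≃ (SLeg kind36 → X) where
  toFun q := tAssign q.1 q.2.1 q.2.2.1 q.2.2.2
  invFun α := (α (ta 0 0), α (ta 1 0), α (ta 0 1), α (ta 1 1))
  left_inv q := by
    obtain ⟨p, p', r, r'⟩ := q
    obtain ⟨e1, e2, e3, e4⟩ := tAssign_apply p p' r r'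
    simp only [e1, e2, e3, e4]
  right_inv α := by
    funext ℓ
    obtain ⟨e1, e2, e3, e4⟩ := tAssign_apply (α (ta 0 0)) (α (ta 1 0)) (α (ta 0 1)) (α (ta 1 1))
    rcases ta_cases ℓ with h | h | h | h <;> rw [h]
    · exact e1
    · exact e2
    · exact e3
    · exact e4

/-- **Re-parametrizing the sum over the φ′-leg index assignments by the values at the four legs.** [cite: Balaban1983Higgs3, (3.25) p.439] -/
theorem sum_tAssign {X : Type*} [Fintype X] (F : (SLeg kind36 → X) → ℝ) :
    ∑ α, F α = ∑ p : X, ∑ p' : X, ∑ r : X, ∑ r' : X, F (tAssign p p' r r') := by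
  rw [← Fintype.sum_equiv (tEquiv X) (fun q => F (tEquiv X q)) F fun _ => rfl]
  simp only [Fintype.sum_prod_type]
  rfl

/-- **The sum over the φ′-leg assignments with the two site deltas of the undifferentiated legs**: the differentiated legs `ta 0 0`,
`ta 1 0` run over all indices `p`, `p′`, the undifferentiated legs sit at the prescribed sites `x`, `x′` with free internal indices
`c`, `c′`. [cite: Balaban1983Higgs3, (3.25) p.439] -/
theorem alpha_sum2 {S : Type*} [Fintype S] [DecidableEq S] (x x' : S) (F : S × Fin N → S × Fin N → S × Fin N → S × Fin N → ℝ) :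
    ∑ α : SLeg kind36 → S × Fin N, (if x = (α (ta 0 1)).1 then (1 : ℝ) else 0) *
        ((if x' = (α (ta 1 1)).1 then (1 : ℝ) else 0) * F (α (ta 0 0)) (α (ta 1 0)) (α (ta 0 1)) (α (ta 1 1))) =
      ∑ p : S × Fin N, ∑ p' : S × Fin N, ∑ c : Fin N, ∑ c' : Fin N, F p p' (x, c) (x', c') := by
  rw [sum_tAssign]
  refine Finset.sum_congr rfl fun p _ => Finset.sum_congr rfl fun p' _ => ?_
  have happ : ∀ r r' : S × Fin N, tAssign p p' r r' (ta 0 0) = p ∧ tAssign p p' r r' (ta 1 0) = p' ∧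
      tAssign p p' r r' (ta 0 1) = r ∧ tAssign p p' r r' (ta 1 1) = r' := fun r r' => tAssign_apply p p' r r'
  simp only [happ]
  have h1 : ∀ r : S × Fin N, ∑ r' : S × Fin N, (if x = r.1 then (1 : ℝ) else 0) * ((if x' = r'.1 then (1 : ℝ) else 0) * F p p' r r') =
      (if x = r.1 then (1 : ℝ) else 0) * ∑ c' : Fin N, F p p' r (x', c') := by
    intro r
    rw [← Finset.mul_sum, sum_delta_fst]
  simp only [h1]
  rw [sum_delta_fst]

/-- The A′-leg index assignment with the values `b` on `tv 0`, `b′` on `tv 1`. [cite: Balaban1983Higgs3, (3.25) p.439] -/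
def bAssign {Y : Type*} (b b' : Y) : VLeg kind36 → Y := fun ℓ => if ℓ = tv 0 then b else b'

/-- values of `bAssign`. [cite: Balaban1983Higgs3, (3.25) p.439] -/
theorem bAssign_apply {Y : Type*} (b b' : Y) : bAssign b b' (tv 0) = b ∧ bAssign b b' (tv 1) = b' := by
  have h : tv 1 ≠ tv 0 := fun h => absurd (tv_injective h) (by decide)
  simp [bAssign, h]

/-- **The Kronecker sum over the A′-leg assignments**: the two bond deltas of the polarized A′-legs put `tv 0` at `b` and `tv 1` at `b′`
(here the A′-legs are EXTERNAL: what is left is the external vector field read at `b`, `b′`). [cite: Balaban1983Higgs3, (3.25) p.439] -/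
theorem beta_sum2 {Y : Type*} [Fintype Y] [DecidableEq Y] (b b' : Y) (F : (VLeg kind36 → Y) → ℝ) :
    ∑ β : VLeg kind36 → Y, (if b = β (tv 0) then (1 : ℝ) else 0) * ((if b' = β (tv 1) then (1 : ℝ) else 0) * F β) = F (bAssign b b') := by
  obtain ⟨e0, e1⟩ := bAssign_apply b b'
  rw [Finset.sum_eq_single (bAssign b b')]
  · rw [e0, e1, if_pos rfl, if_pos rfl, one_mul, one_mul]
  · intro β _ hβ
    by_cases h0 : b = β (tv 0)
    · by_cases h1 : b' = β (tv 1)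
      · exfalso
        apply hβ
        funext ℓ
        rcases tv_cases ℓ with h | h <;> rw [h]
        · rw [e0]; exact h0.symm
        · rw [e1]; exact h1.symm
      · rw [if_neg h1, zero_mul, mul_zero]
    · rw [if_neg h0, zero_mul]
  · intro h
    exact absurd (Finset.mem_univ _) h

end Assignments

/-! ## §3 The evaluator on (3.25)₁ and (3.25)₂: the closed forms -/

section Eval

variable {P : HiggsLattice.Params} {N k : ℕ} {hn : 1 ≤ nbar}
variable [DecidableEq (HiggsLattice.PBond P 0)]

/-- **The rule (1.8)_{1,0} on basis fields** (prefactor `e·(−1)·η⁰/(1!0!) = −e`): the vertex `i` evaluated on the basis fields of an index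
assignment is `−e Σ_{b∈S} vterm` (FILE 5's `vterm`: localization weight, `η^d g_k(b₋)`, the site delta of the undifferentiated leg, the
bond delta of the A′-leg, the differentiated leg through `dq`). [cite: Balaban1983Higgs3, (1.8) p.413] -/
theorem rule18_basis (M : Model P N k) (w : HiggsLattice.PBond P 0 → ℝ) (i : Fin 2)
    (α : SLeg kind36 → HiggsLattice.Site P 0 × Fin N) (β : VLeg kind36 → HiggsLattice.PBond P 0) :
    rule18 M.C M.g M.B M.At 1 0 M.S w (fun j => basisE (α (ta i j))) (fun j => basisV (β ⟨i, j⟩)) =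
      -M.C.e * ∑ b ∈ M.S, vterm M w b (α (ta i 0)) (α (ta i 1)) (β (tv i)) := by
  unfold rule18
  have hv : ∀ b, vlegs (n := 1) M.g (fun j : Fin 1 => basisV (β ⟨i, j⟩)) b = (if b = β (tv i) then (1 : ℝ) else 0) * M.g b.src :=
    fun b => vlegs_one_basisV M.g _ (β (tv i)) rfl b
  simp only [hv, pleg18_basisE, add_zero, pow_one, pow_zero, mul_one, Nat.cast_one, Nat.cast_zero, sub_self, zpow_zero,
    Nat.factorial_one, Nat.factorial_zero, div_one]
  rw [Finset.mul_sum, Finset.mul_sum]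
  refine Finset.sum_congr rfl fun b _ => ?_
  unfold vterm dq
  ring

/-- kernel: the product of the two vertex sums against the remaining factors, rearranged with the bond sums outermost. [folklore] -/
private theorem rearrange2 {ι κ μ : Type*} [Fintype ι] [Fintype κ] (s : Finset μ) (e : ℝ) (A₀ A₁ : μ → ι → κ → ℝ) (X Y : ι → κ → ℝ) :
    ∑ α, ∑ β, -e * (∑ b ∈ s, A₀ b α β) * (-e * ∑ b' ∈ s, A₁ b' α β) * X α β * Y α β =
      e ^ 2 * ∑ b ∈ s, ∑ b' ∈ s, ∑ α, ∑ β, A₀ b α β * (A₁ b' α β * (X α β * Y α β)) := by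
  have h1 : ∀ α β, -e * (∑ b ∈ s, A₀ b α β) * (-e * ∑ b' ∈ s, A₁ b' α β) * X α β * Y α β =
      ∑ b ∈ s, ∑ b' ∈ s, e ^ 2 * (A₀ b α β * (A₁ b' α β * (X α β * Y α β))) := by
    intro α β
    calc -e * (∑ b ∈ s, A₀ b α β) * (-e * ∑ b' ∈ s, A₁ b' α β) * X α β * Y α β
        = e ^ 2 * (X α β * Y α β) * ((∑ b ∈ s, A₀ b α β) * ∑ b' ∈ s, A₁ b' α β) := by ring
      _ = e ^ 2 * (X α β * Y α β) * ∑ b ∈ s, ∑ b' ∈ s, A₀ b α β * A₁ b' α β := by rw [Finset.sum_mul_sum]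
      _ = ∑ b ∈ s, ∑ b' ∈ s, e ^ 2 * (A₀ b α β * (A₁ b' α β * (X α β * Y α β))) := by
          rw [Finset.mul_sum]
          refine Finset.sum_congr rfl fun b _ => ?_
          rw [Finset.mul_sum]
          refine Finset.sum_congr rfl fun b' _ => ?_
          ring
  simp only [h1]
  rw [sum_comm4, Finset.mul_sum]
  refine Finset.sum_congr rfl fun b _ => ?_
  rw [Finset.mul_sum]
  refine Finset.sum_congr rfl fun b' _ => ?_
  rw [Finset.mul_sum]
  refine Finset.sum_congr rfl fun α _ => ?_
  rw [Finset.mul_sum]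

/-! ### (3.25)₁ -/

/-- The evaluator on (3.25)₁ with its index assignments typed by p18's `kind36` (the vertex kinds of the picture) — FILE 1's `amp`
unfolded. [cite: Balaban1983Higgs3, p.420] -/
theorem graphAmp_eqA (M : Model P N k) (dm2 : Fin (g325a nbar hn).nV → HiggsLattice.Site P 0 → ℝ)
    (loc : Fin (g325a nbar hn).nV → Loc P k) (Po : OutPairing (g325a nbar hn))
    (Ks : SLine (g325a nbar hn) → HiggsLattice.Site P 0 × Fin N → HiggsLattice.Site P 0 × Fin N → ℝ)
    (Kv : VLine (g325a nbar hn) → HiggsLattice.PBond P 0 → HiggsLattice.PBond P 0 → ℝ)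
    (Ko : Po.Line oRank → HiggsLattice.Site P k × Fin N → HiggsLattice.Site P k × Fin N → ℝ)
    (Φ : (ExtSLeg (g325a nbar hn) → HiggsLattice.Site P 0 × Fin N) → ℝ) (A : (ExtVLeg (g325a nbar hn) → HiggsLattice.PBond P 0) → ℝ)
    (Ψ : (Po.Ext → HiggsLattice.Site P k × Fin N) → ℝ) :
    graphAmp (g325a nbar hn) M dm2 loc Po Ks Kv Ko Φ A Ψ =
      ∑ α : SLeg kind36 → HiggsLattice.Site P 0 × Fin N, ∑ β : VLeg kind36 → HiggsLattice.PBond P 0,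
        ∑ ο : OLeg kind36 → HiggsLattice.Site P k × Fin N,
          vertexFactor (rulesOf (g325a nbar hn) M dm2 loc) basisE basisV basisE α β ο *
            (Φ (fun ℓ => α ℓ.1) * A (fun ℓ => β ℓ.1) * Ψ (fun ℓ => ο ℓ.1)) *
            (sLineFactor Ks α * vLineFactor Kv β * oLineFactor Po Ko ο) := rfl

/-- **The evaluator EVALUATED on the picture (3.25)₁** (two vertices (1.8)_{1,0} at the bonds `b ∋ x`, `b′ ∋ x′`; the φ′-line `ℓ₀` from the
differentiated leg of `x` to the undifferentiated leg of `x′`, the φ′-line `ℓ₁` from the undifferentiated leg of `x` to the differentiated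
leg of `x′`; both A′-legs external): for the model data `M`, the localization weights `w₀`, `w₁` of the two vertices, ANY scalar line kernels
`Ks ℓ₀`, `Ks ℓ₁` (entries of `G_k(Ω,B̃)` or of (2.6) pieces `G^η_{(j)}`, `G^η_{(j′)}`) and ANY joint external fields `Φ` (no external φ′-leg:
the constant `Φ(∅)`), `A` (read at the two bonds), `Ψ`:
`E = Φ(∅)Ψ(∅) · e² Σ_{b,b′∈S} w₀(b)w₁(b′) η^{2d} g_k(b₋)g_k(b′₋) A(b,b′) Σ_{c,c′} dK1(Ks ℓ₀)(b, qe_c; (b′₋,c′)) · dK2(Ks ℓ₁)((b₋,c); b′, qe_{c′})`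
— each φ′-line *"replaced by the corresponding propagator"* differentiated at ONE end, the closed φ′-loop running through the two charge
matrices `q`. [cite: Balaban1983Higgs3, (3.25) p.439] [cite: Balaban1983Higgs3, (3.26) p.440] [cite: Balaban1983Higgs3, p.414] -/
theorem graphAmp_g325a (M : Model P N k) (dm2 : Fin (g325a nbar hn).nV → HiggsLattice.Site P 0 → ℝ)
    (loc : Fin (g325a nbar hn).nV → Loc P k) (Po : OutPairing (g325a nbar hn))
    (Ks : SLine (g325a nbar hn) → HiggsLattice.Site P 0 × Fin N → HiggsLattice.Site P 0 × Fin N → ℝ)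
    (Kv : VLine (g325a nbar hn) → HiggsLattice.PBond P 0 → HiggsLattice.PBond P 0 → ℝ)
    (Ko : Po.Line oRank → HiggsLattice.Site P k × Fin N → HiggsLattice.Site P k × Fin N → ℝ)
    (Φ : (ExtSLeg (g325a nbar hn) → HiggsLattice.Site P 0 × Fin N) → ℝ) (A : (ExtVLeg (g325a nbar hn) → HiggsLattice.PBond P 0) → ℝ)
    (Ψ : (Po.Ext → HiggsLattice.Site P k × Fin N) → ℝ) :
    graphAmp (g325a nbar hn) M dm2 loc Po Ks Kv Ko Φ A Ψ =
      (Φ (fun ℓ => isEmptyElim ℓ) * Ψ (fun ℓ => isEmptyElim ℓ)) *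
        (M.C.e ^ 2 * ∑ b ∈ M.S, ∑ b' ∈ M.S, (loc (vxa nbar hn 0)).wB b * (loc (vxa nbar hn 1)).wB b' *
          ((P.mesh 0 ^ P.d) ^ 2 * (M.g b.src * M.g b'.src) * A (fun ℓ => bAssign b b' ℓ.1) *
            ∑ c : Fin N, ∑ c' : Fin N, dK1 M.C M.B (Ks (lineA0 nbar hn)) b (M.C.q (EuclideanSpace.single c (1 : ℝ))) (b'.src, c') *
              dK2 M.C M.B (Ks (lineA1 nbar hn)) (b.src, c) b' (M.C.q (EuclideanSpace.single c' (1 : ℝ))))) := by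
  haveI : IsEmpty (Po.Line oRank) := ⟨fun l => IsEmpty.false l.1⟩
  haveI : IsEmpty Po.Ext := ⟨fun l => IsEmpty.false l.1⟩
  have hV : ∀ (α : SLeg kind36 → HiggsLattice.Site P 0 × Fin N) (β : VLeg kind36 → HiggsLattice.PBond P 0)
      (ο : OLeg kind36 → HiggsLattice.Site P k × Fin N),
      vertexFactor (rulesOf (g325a nbar hn) M dm2 loc) basisE basisV basisE α β ο =
        rule18 M.C M.g M.B M.At 1 0 M.S (loc (vxa nbar hn 0)).wB (fun j => basisE (α (ta 0 j))) (fun j => basisV (β ⟨0, j⟩)) *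
          rule18 M.C M.g M.B M.At 1 0 M.S (loc (vxa nbar hn 1)).wB (fun j => basisE (α (ta 1 j))) (fun j => basisV (β ⟨1, j⟩)) := by
    intro α β ο
    unfold vertexFactor
    exact Fin.prod_univ_two _
  have hs : ∀ α : SLeg kind36 → HiggsLattice.Site P 0 × Fin N,
      sLineFactor Ks α = Ks (lineA0 nbar hn) (α (ta 0 0)) (α (ta 1 1)) * Ks (lineA1 nbar hn) (α (ta 0 1)) (α (ta 1 0)) := by
    intro α
    unfold sLineFactor
    rw [show (∏ l : SLine (g325a nbar hn), Ks l (α l.1) (α ((sPairing (g325a nbar hn)).mate l.1))) =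
        ∏ l ∈ ({lineA0 nbar hn, lineA1 nbar hn} : Finset (SLine (g325a nbar hn))), Ks l (α l.1) (α ((sPairing (g325a nbar hn)).mate l.1)) by
          rw [← univ_slineA], Finset.prod_pair lineA0_ne_lineA1]
    show Ks (lineA0 nbar hn) (α (ta 0 0)) (α ((sPairing (g325a nbar hn)).mate (ta 0 0))) *
        Ks (lineA1 nbar hn) (α (ta 0 1)) (α ((sPairing (g325a nbar hn)).mate (ta 0 1))) = _
    rw [smateA.1, smateA.2]
  have hv : ∀ β : VLeg kind36 → HiggsLattice.PBond P 0, vLineFactor (G := g325a nbar hn) Kv β = 1 := by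
    intro β
    unfold vLineFactor
    exact Fintype.prod_empty _
  have ho : ∀ ο : OLeg kind36 → HiggsLattice.Site P k × Fin N, oLineFactor Po Ko ο = 1 := by
    intro ο
    unfold oLineFactor
    exact Fintype.prod_empty _
  have hΦ : ∀ α : SLeg kind36 → HiggsLattice.Site P 0 × Fin N, (fun ℓ : ExtSLeg (g325a nbar hn) => α ℓ.1) = fun ℓ => isEmptyElim ℓ :=
    fun α => funext fun ℓ => isEmptyElim ℓ
  have hΨ : ∀ ο : OLeg kind36 → HiggsLattice.Site P k × Fin N, (fun ℓ : Po.Ext => ο ℓ.1) = fun ℓ => isEmptyElim ℓ :=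
    fun ο => funext fun ℓ => isEmptyElim ℓ
  rw [graphAmp_eqA]
  simp only [Fintype.sum_unique, hV, hs, hv, ho, hΦ, hΨ, mul_one, rule18_basis]
  -- bond sums outermost
  have h := rearrange2 M.S M.C.e
    (fun b (α : SLeg kind36 → HiggsLattice.Site P 0 × Fin N) (β : VLeg kind36 → HiggsLattice.PBond P 0) =>
      vterm M (loc (vxa nbar hn 0)).wB b (α (ta 0 0)) (α (ta 0 1)) (β (tv 0)))
    (fun b (α : SLeg kind36 → HiggsLattice.Site P 0 × Fin N) (β : VLeg kind36 → HiggsLattice.PBond P 0) =>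
      vterm M (loc (vxa nbar hn 1)).wB b (α (ta 1 0)) (α (ta 1 1)) (β (tv 1)))
    (fun _ β => Φ (fun ℓ => isEmptyElim ℓ) * A (fun ℓ => β ℓ.1) * Ψ (fun ℓ => isEmptyElim ℓ))
    (fun α _ => Ks (lineA0 nbar hn) (α (ta 0 0)) (α (ta 1 1)) * Ks (lineA1 nbar hn) (α (ta 0 1)) (α (ta 1 0)))
  beta_reduce at h
  rw [h, mul_left_comm _ (M.C.e ^ 2) _]
  congr 1
  rw [Finset.mul_sum]
  refine Finset.sum_congr rfl fun b _ => ?_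
  rw [Finset.mul_sum]
  refine Finset.sum_congr rfl fun b' _ => ?_
  -- the summand with the two bond deltas in front
  have h2 : ∀ (α : SLeg kind36 → HiggsLattice.Site P 0 × Fin N) (β : VLeg kind36 → HiggsLattice.PBond P 0),
      vterm M (loc (vxa nbar hn 0)).wB b (α (ta 0 0)) (α (ta 0 1)) (β (tv 0)) *
          (vterm M (loc (vxa nbar hn 1)).wB b' (α (ta 1 0)) (α (ta 1 1)) (β (tv 1)) *
            (Φ (fun ℓ => isEmptyElim ℓ) * A (fun ℓ => β ℓ.1) * Ψ (fun ℓ => isEmptyElim ℓ) *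
              (Ks (lineA0 nbar hn) (α (ta 0 0)) (α (ta 1 1)) * Ks (lineA1 nbar hn) (α (ta 0 1)) (α (ta 1 0))))) =
        (if b = β (tv 0) then (1 : ℝ) else 0) * ((if b' = β (tv 1) then (1 : ℝ) else 0) *
          (A (fun ℓ => β ℓ.1) * ((Φ (fun ℓ => isEmptyElim ℓ) * Ψ (fun ℓ => isEmptyElim ℓ)) *
            ((loc (vxa nbar hn 0)).wB b * (P.mesh 0 ^ P.d * M.g b.src) * ((loc (vxa nbar hn 1)).wB b' * (P.mesh 0 ^ P.d * M.g b'.src))) *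
            ((if b.src = (α (ta 0 1)).1 then (1 : ℝ) else 0) * ((if b'.src = (α (ta 1 1)).1 then (1 : ℝ) else 0) *
              (dq M.C M.B (α (ta 0 0)) b (α (ta 0 1)).2 * dq M.C M.B (α (ta 1 0)) b' (α (ta 1 1)).2 *
                Ks (lineA0 nbar hn) (α (ta 0 0)) (α (ta 1 1)) * Ks (lineA1 nbar hn) (α (ta 0 1)) (α (ta 1 0)))))))) := by
    intro α β
    unfold vterm
    ring
  rw [Finset.sum_congr rfl fun α _ => Finset.sum_congr rfl fun β _ => h2 α β]
  -- the A′-leg sum: the external vector field read at b, b′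
  have h3 : ∀ α : SLeg kind36 → HiggsLattice.Site P 0 × Fin N,
      ∑ β : VLeg kind36 → HiggsLattice.PBond P 0, (if b = β (tv 0) then (1 : ℝ) else 0) * ((if b' = β (tv 1) then (1 : ℝ) else 0) *
          (A (fun ℓ => β ℓ.1) * ((Φ (fun ℓ => isEmptyElim ℓ) * Ψ (fun ℓ => isEmptyElim ℓ)) *
            ((loc (vxa nbar hn 0)).wB b * (P.mesh 0 ^ P.d * M.g b.src) * ((loc (vxa nbar hn 1)).wB b' * (P.mesh 0 ^ P.d * M.g b'.src))) *
            ((if b.src = (α (ta 0 1)).1 then (1 : ℝ) else 0) * ((if b'.src = (α (ta 1 1)).1 then (1 : ℝ) else 0) *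
              (dq M.C M.B (α (ta 0 0)) b (α (ta 0 1)).2 * dq M.C M.B (α (ta 1 0)) b' (α (ta 1 1)).2 *
                Ks (lineA0 nbar hn) (α (ta 0 0)) (α (ta 1 1)) * Ks (lineA1 nbar hn) (α (ta 0 1)) (α (ta 1 0)))))))) =
        A (fun ℓ => bAssign b b' ℓ.1) * ((Φ (fun ℓ => isEmptyElim ℓ) * Ψ (fun ℓ => isEmptyElim ℓ)) *
            ((loc (vxa nbar hn 0)).wB b * (P.mesh 0 ^ P.d * M.g b.src) * ((loc (vxa nbar hn 1)).wB b' * (P.mesh 0 ^ P.d * M.g b'.src))) *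
            ((if b.src = (α (ta 0 1)).1 then (1 : ℝ) else 0) * ((if b'.src = (α (ta 1 1)).1 then (1 : ℝ) else 0) *
              (dq M.C M.B (α (ta 0 0)) b (α (ta 0 1)).2 * dq M.C M.B (α (ta 1 0)) b' (α (ta 1 1)).2 *
                Ks (lineA0 nbar hn) (α (ta 0 0)) (α (ta 1 1)) * Ks (lineA1 nbar hn) (α (ta 0 1)) (α (ta 1 0)))))) := by
    intro α
    rw [beta_sum2]
  rw [Finset.sum_congr rfl fun α _ => h3 α, ← Finset.mul_sum, ← Finset.mul_sum]
  -- the φ′-leg sum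
  have h4 := alpha_sum2 b.src b'.src fun p p' r r' =>
    dq M.C M.B p b r.2 * dq M.C M.B p' b' r'.2 * Ks (lineA0 nbar hn) p r' * Ks (lineA1 nbar hn) r p'
  beta_reduce at h4
  rw [h4]
  -- the two index forms of the φ′-loop agree
  have h5 : ∑ p : HiggsLattice.Site P 0 × Fin N, ∑ p' : HiggsLattice.Site P 0 × Fin N, ∑ c : Fin N, ∑ c' : Fin N,
      dq M.C M.B p b (b.src, c).2 * dq M.C M.B p' b' (b'.src, c').2 * Ks (lineA0 nbar hn) p (b'.src, c') * Ks (lineA1 nbar hn) (b.src, c) p' =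
      ∑ c : Fin N, ∑ c' : Fin N, dK1 M.C M.B (Ks (lineA0 nbar hn)) b (M.C.q (EuclideanSpace.single c (1 : ℝ))) (b'.src, c') *
        dK2 M.C M.B (Ks (lineA1 nbar hn)) (b.src, c) b' (M.C.q (EuclideanSpace.single c' (1 : ℝ))) := by
    simp only [dK1_single, dK2_single, Finset.sum_mul_sum]
    rw [← sum_comm4]
    refine Finset.sum_congr rfl fun p _ => Finset.sum_congr rfl fun p' _ => Finset.sum_congr rfl fun c _ =>
      Finset.sum_congr rfl fun c' _ => ?_
    ring
  rw [h5]
  ring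

/-! ### (3.25)₂ -/

/-- The evaluator on (3.25)₂ with `kind36`-typed index assignments — FILE 1's `amp` unfolded. [cite: Balaban1983Higgs3, p.420] -/
theorem graphAmp_eqB (M : Model P N k) (dm2 : Fin (g325b nbar hn).nV → HiggsLattice.Site P 0 → ℝ)
    (loc : Fin (g325b nbar hn).nV → Loc P k) (Po : OutPairing (g325b nbar hn))
    (Ks : SLine (g325b nbar hn) → HiggsLattice.Site P 0 × Fin N → HiggsLattice.Site P 0 × Fin N → ℝ)
    (Kv : VLine (g325b nbar hn) → HiggsLattice.PBond P 0 → HiggsLattice.PBond P 0 → ℝ)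
    (Ko : Po.Line oRank → HiggsLattice.Site P k × Fin N → HiggsLattice.Site P k × Fin N → ℝ)
    (Φ : (ExtSLeg (g325b nbar hn) → HiggsLattice.Site P 0 × Fin N) → ℝ) (A : (ExtVLeg (g325b nbar hn) → HiggsLattice.PBond P 0) → ℝ)
    (Ψ : (Po.Ext → HiggsLattice.Site P k × Fin N) → ℝ) :
    graphAmp (g325b nbar hn) M dm2 loc Po Ks Kv Ko Φ A Ψ =
      ∑ α : SLeg kind36 → HiggsLattice.Site P 0 × Fin N, ∑ β : VLeg kind36 → HiggsLattice.PBond P 0,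
        ∑ ο : OLeg kind36 → HiggsLattice.Site P k × Fin N,
          vertexFactor (rulesOf (g325b nbar hn) M dm2 loc) basisE basisV basisE α β ο *
            (Φ (fun ℓ => α ℓ.1) * A (fun ℓ => β ℓ.1) * Ψ (fun ℓ => ο ℓ.1)) *
            (sLineFactor Ks α * vLineFactor Kv β * oLineFactor Po Ko ο) := rfl

/-- **The evaluator EVALUATED on the picture (3.25)₂** (two vertices (1.8)_{1,0}; the φ′-line `ℓ₀` through BOTH differentiated legs, the
φ′-line `ℓ₁` through both undifferentiated legs; both A′-legs external):
`E = Φ(∅)Ψ(∅) · e² Σ_{b,b′∈S} w₀(b)w₁(b′) η^{2d} g_k(b₋)g_k(b′₋) A(b,b′) Σ_{c,c′} dKs(Ks ℓ₀)(b, qe_c; b′, qe_{c′}) · Ks ℓ₁((b₋,c),(b′₋,c′))`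
— the line `ℓ₀` covariantly differentiated at both ends (FILE 5's `dKs`), the line `ℓ₁` plain between `b₋` and `b′₋`.
[cite: Balaban1983Higgs3, (3.25) p.439] [cite: Balaban1983Higgs3, (3.26) p.440] [cite: Balaban1983Higgs3, p.414] -/
theorem graphAmp_g325b (M : Model P N k) (dm2 : Fin (g325b nbar hn).nV → HiggsLattice.Site P 0 → ℝ)
    (loc : Fin (g325b nbar hn).nV → Loc P k) (Po : OutPairing (g325b nbar hn))
    (Ks : SLine (g325b nbar hn) → HiggsLattice.Site P 0 × Fin N → HiggsLattice.Site P 0 × Fin N → ℝ)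
    (Kv : VLine (g325b nbar hn) → HiggsLattice.PBond P 0 → HiggsLattice.PBond P 0 → ℝ)
    (Ko : Po.Line oRank → HiggsLattice.Site P k × Fin N → HiggsLattice.Site P k × Fin N → ℝ)
    (Φ : (ExtSLeg (g325b nbar hn) → HiggsLattice.Site P 0 × Fin N) → ℝ) (A : (ExtVLeg (g325b nbar hn) → HiggsLattice.PBond P 0) → ℝ)
    (Ψ : (Po.Ext → HiggsLattice.Site P k × Fin N) → ℝ) :
    graphAmp (g325b nbar hn) M dm2 loc Po Ks Kv Ko Φ A Ψ =
      (Φ (fun ℓ => isEmptyElim ℓ) * Ψ (fun ℓ => isEmptyElim ℓ)) *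
        (M.C.e ^ 2 * ∑ b ∈ M.S, ∑ b' ∈ M.S, (loc (vxb nbar hn 0)).wB b * (loc (vxb nbar hn 1)).wB b' *
          ((P.mesh 0 ^ P.d) ^ 2 * (M.g b.src * M.g b'.src) * A (fun ℓ => bAssign b b' ℓ.1) *
            ∑ c : Fin N, ∑ c' : Fin N, dKs M.C M.B (Ks (lineB0 nbar hn)) b (M.C.q (EuclideanSpace.single c (1 : ℝ))) b'
              (M.C.q (EuclideanSpace.single c' (1 : ℝ))) * Ks (lineB1 nbar hn) (b.src, c) (b'.src, c'))) := by
  haveI : IsEmpty (Po.Line oRank) := ⟨fun l => IsEmpty.false l.1⟩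
  haveI : IsEmpty Po.Ext := ⟨fun l => IsEmpty.false l.1⟩
  have hV : ∀ (α : SLeg kind36 → HiggsLattice.Site P 0 × Fin N) (β : VLeg kind36 → HiggsLattice.PBond P 0)
      (ο : OLeg kind36 → HiggsLattice.Site P k × Fin N),
      vertexFactor (rulesOf (g325b nbar hn) M dm2 loc) basisE basisV basisE α β ο =
        rule18 M.C M.g M.B M.At 1 0 M.S (loc (vxb nbar hn 0)).wB (fun j => basisE (α (ta 0 j))) (fun j => basisV (β ⟨0, j⟩)) *
          rule18 M.C M.g M.B M.At 1 0 M.S (loc (vxb nbar hn 1)).wB (fun j => basisE (α (ta 1 j))) (fun j => basisV (β ⟨1, j⟩)) := by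
    intro α β ο
    unfold vertexFactor
    exact Fin.prod_univ_two _
  have hs : ∀ α : SLeg kind36 → HiggsLattice.Site P 0 × Fin N,
      sLineFactor Ks α = Ks (lineB0 nbar hn) (α (ta 0 0)) (α (ta 1 0)) * Ks (lineB1 nbar hn) (α (ta 0 1)) (α (ta 1 1)) := by
    intro α
    unfold sLineFactor
    rw [show (∏ l : SLine (g325b nbar hn), Ks l (α l.1) (α ((sPairing (g325b nbar hn)).mate l.1))) =
        ∏ l ∈ ({lineB0 nbar hn, lineB1 nbar hn} : Finset (SLine (g325b nbar hn))), Ks l (α l.1) (α ((sPairing (g325b nbar hn)).mate l.1)) by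
          rw [← univ_slineB], Finset.prod_pair lineB0_ne_lineB1]
    show Ks (lineB0 nbar hn) (α (ta 0 0)) (α ((sPairing (g325b nbar hn)).mate (ta 0 0))) *
        Ks (lineB1 nbar hn) (α (ta 0 1)) (α ((sPairing (g325b nbar hn)).mate (ta 0 1))) = _
    rw [smateB.1, smateB.2]
  have hv : ∀ β : VLeg kind36 → HiggsLattice.PBond P 0, vLineFactor (G := g325b nbar hn) Kv β = 1 := by
    intro β
    unfold vLineFactor
    exact Fintype.prod_empty _
  have ho : ∀ ο : OLeg kind36 → HiggsLattice.Site P k × Fin N, oLineFactor Po Ko ο = 1 := by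
    intro ο
    unfold oLineFactor
    exact Fintype.prod_empty _
  have hΦ : ∀ α : SLeg kind36 → HiggsLattice.Site P 0 × Fin N, (fun ℓ : ExtSLeg (g325b nbar hn) => α ℓ.1) = fun ℓ => isEmptyElim ℓ :=
    fun α => funext fun ℓ => isEmptyElim ℓ
  have hΨ : ∀ ο : OLeg kind36 → HiggsLattice.Site P k × Fin N, (fun ℓ : Po.Ext => ο ℓ.1) = fun ℓ => isEmptyElim ℓ :=
    fun ο => funext fun ℓ => isEmptyElim ℓ
  rw [graphAmp_eqB]
  simp only [Fintype.sum_unique, hV, hs, hv, ho, hΦ, hΨ, mul_one, rule18_basis]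
  have h := rearrange2 M.S M.C.e
    (fun b (α : SLeg kind36 → HiggsLattice.Site P 0 × Fin N) (β : VLeg kind36 → HiggsLattice.PBond P 0) =>
      vterm M (loc (vxb nbar hn 0)).wB b (α (ta 0 0)) (α (ta 0 1)) (β (tv 0)))
    (fun b (α : SLeg kind36 → HiggsLattice.Site P 0 × Fin N) (β : VLeg kind36 → HiggsLattice.PBond P 0) =>
      vterm M (loc (vxb nbar hn 1)).wB b (α (ta 1 0)) (α (ta 1 1)) (β (tv 1)))
    (fun _ β => Φ (fun ℓ => isEmptyElim ℓ) * A (fun ℓ => β ℓ.1) * Ψ (fun ℓ => isEmptyElim ℓ))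
    (fun α _ => Ks (lineB0 nbar hn) (α (ta 0 0)) (α (ta 1 0)) * Ks (lineB1 nbar hn) (α (ta 0 1)) (α (ta 1 1)))
  beta_reduce at h
  rw [h, mul_left_comm _ (M.C.e ^ 2) _]
  congr 1
  rw [Finset.mul_sum]
  refine Finset.sum_congr rfl fun b _ => ?_
  rw [Finset.mul_sum]
  refine Finset.sum_congr rfl fun b' _ => ?_
  have h2 : ∀ (α : SLeg kind36 → HiggsLattice.Site P 0 × Fin N) (β : VLeg kind36 → HiggsLattice.PBond P 0),
      vterm M (loc (vxb nbar hn 0)).wB b (α (ta 0 0)) (α (ta 0 1)) (β (tv 0)) *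
          (vterm M (loc (vxb nbar hn 1)).wB b' (α (ta 1 0)) (α (ta 1 1)) (β (tv 1)) *
            (Φ (fun ℓ => isEmptyElim ℓ) * A (fun ℓ => β ℓ.1) * Ψ (fun ℓ => isEmptyElim ℓ) *
              (Ks (lineB0 nbar hn) (α (ta 0 0)) (α (ta 1 0)) * Ks (lineB1 nbar hn) (α (ta 0 1)) (α (ta 1 1))))) =
        (if b = β (tv 0) then (1 : ℝ) else 0) * ((if b' = β (tv 1) then (1 : ℝ) else 0) *
          (A (fun ℓ => β ℓ.1) * ((Φ (fun ℓ => isEmptyElim ℓ) * Ψ (fun ℓ => isEmptyElim ℓ)) *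
            ((loc (vxb nbar hn 0)).wB b * (P.mesh 0 ^ P.d * M.g b.src) * ((loc (vxb nbar hn 1)).wB b' * (P.mesh 0 ^ P.d * M.g b'.src))) *
            ((if b.src = (α (ta 0 1)).1 then (1 : ℝ) else 0) * ((if b'.src = (α (ta 1 1)).1 then (1 : ℝ) else 0) *
              (dq M.C M.B (α (ta 0 0)) b (α (ta 0 1)).2 * dq M.C M.B (α (ta 1 0)) b' (α (ta 1 1)).2 *
                Ks (lineB0 nbar hn) (α (ta 0 0)) (α (ta 1 0)) * Ks (lineB1 nbar hn) (α (ta 0 1)) (α (ta 1 1)))))))) := by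
    intro α β
    unfold vterm
    ring
  rw [Finset.sum_congr rfl fun α _ => Finset.sum_congr rfl fun β _ => h2 α β]
  have h3 : ∀ α : SLeg kind36 → HiggsLattice.Site P 0 × Fin N,
      ∑ β : VLeg kind36 → HiggsLattice.PBond P 0, (if b = β (tv 0) then (1 : ℝ) else 0) * ((if b' = β (tv 1) then (1 : ℝ) else 0) *
          (A (fun ℓ => β ℓ.1) * ((Φ (fun ℓ => isEmptyElim ℓ) * Ψ (fun ℓ => isEmptyElim ℓ)) *
            ((loc (vxb nbar hn 0)).wB b * (P.mesh 0 ^ P.d * M.g b.src) * ((loc (vxb nbar hn 1)).wB b' * (P.mesh 0 ^ P.d * M.g b'.src))) *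
            ((if b.src = (α (ta 0 1)).1 then (1 : ℝ) else 0) * ((if b'.src = (α (ta 1 1)).1 then (1 : ℝ) else 0) *
              (dq M.C M.B (α (ta 0 0)) b (α (ta 0 1)).2 * dq M.C M.B (α (ta 1 0)) b' (α (ta 1 1)).2 *
                Ks (lineB0 nbar hn) (α (ta 0 0)) (α (ta 1 0)) * Ks (lineB1 nbar hn) (α (ta 0 1)) (α (ta 1 1)))))))) =
        A (fun ℓ => bAssign b b' ℓ.1) * ((Φ (fun ℓ => isEmptyElim ℓ) * Ψ (fun ℓ => isEmptyElim ℓ)) *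
            ((loc (vxb nbar hn 0)).wB b * (P.mesh 0 ^ P.d * M.g b.src) * ((loc (vxb nbar hn 1)).wB b' * (P.mesh 0 ^ P.d * M.g b'.src))) *
            ((if b.src = (α (ta 0 1)).1 then (1 : ℝ) else 0) * ((if b'.src = (α (ta 1 1)).1 then (1 : ℝ) else 0) *
              (dq M.C M.B (α (ta 0 0)) b (α (ta 0 1)).2 * dq M.C M.B (α (ta 1 0)) b' (α (ta 1 1)).2 *
                Ks (lineB0 nbar hn) (α (ta 0 0)) (α (ta 1 0)) * Ks (lineB1 nbar hn) (α (ta 0 1)) (α (ta 1 1)))))) := by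
    intro α
    rw [beta_sum2]
  rw [Finset.sum_congr rfl fun α _ => h3 α, ← Finset.mul_sum, ← Finset.mul_sum]
  have h4 := alpha_sum2 b.src b'.src fun p p' r r' =>
    dq M.C M.B p b r.2 * dq M.C M.B p' b' r'.2 * Ks (lineB0 nbar hn) p p' * Ks (lineB1 nbar hn) r r'
  beta_reduce at h4
  rw [h4]
  have h5 : ∑ p : HiggsLattice.Site P 0 × Fin N, ∑ p' : HiggsLattice.Site P 0 × Fin N, ∑ c : Fin N, ∑ c' : Fin N,
      dq M.C M.B p b (b.src, c).2 * dq M.C M.B p' b' (b'.src, c').2 * Ks (lineB0 nbar hn) p p' * Ks (lineB1 nbar hn) (b.src, c) (b'.src, c') =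
      ∑ c : Fin N, ∑ c' : Fin N, dKs M.C M.B (Ks (lineB0 nbar hn)) b (M.C.q (EuclideanSpace.single c (1 : ℝ))) b'
        (M.C.q (EuclideanSpace.single c' (1 : ℝ))) * Ks (lineB1 nbar hn) (b.src, c) (b'.src, c') := by
    simp only [dKs_single, Finset.sum_mul]
    rw [← sum_comm4]
    refine Finset.sum_congr rfl fun p _ => Finset.sum_congr rfl fun p' _ => Finset.sum_congr rfl fun c _ =>
      Finset.sum_congr rfl fun c' _ => ?_
    ring
  rw [h5]
  ring

end Eval

/-! ## §4 Product external vector fields: `A` in the leg of `x`, `A′` in the leg of `x′` -/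

section ProductExt

variable {P : HiggsLattice.Params} {N k : ℕ} {hn : 1 ≤ nbar}

/-- The PRODUCT external vector field of (3.25)₁ with `A` in the A′-leg of `x` and `A′` in the A′-leg of `x′` (p. 440: *"g(x)A_μ(x) …
g′(x′)A′_{μ′}(x′)"*). [cite: Balaban1983Higgs3, (3.26) p.440] -/
def pairVA (A A' : HiggsLattice.VecField P 0) : ExtVLeg (g325a nbar hn) → HiggsLattice.VecField P 0 :=
  fun ℓ => if ℓ = evA nbar hn 0 then A else A'

/-- values of `pairVA`. [cite: Balaban1983Higgs3, (3.26) p.440] -/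
theorem pairVA_apply (A A' : HiggsLattice.VecField P 0) :
    pairVA (hn := hn) A A' (evA nbar hn 0) = A ∧ pairVA (hn := hn) A A' (evA nbar hn 1) = A' := by
  simp [pairVA, (evA0_ne_evA1 (hn := hn)).symm]

/-- FILE 1's product external vector field `prodExtV (pairVA A A′)` read at the bonds `b`, `b′` of the two vertices: `A(b)·A′(b′)`.
[cite: Balaban1983Higgs3, (3.26) p.440] -/
theorem prodExtV_pairVA (A A' : HiggsLattice.VecField P 0) (b b' : HiggsLattice.PBond P 0) :
    prodExtV (pairVA (hn := hn) A A') (fun ℓ : ExtVLeg (g325a nbar hn) => bAssign b b' ℓ.1) = A b * A' b' := by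
  unfold prodExtV
  obtain ⟨e0, e1⟩ := pairVA_apply (hn := hn) A A'
  obtain ⟨f0, f1⟩ := bAssign_apply b b'
  rw [show (∏ ℓ : ExtVLeg (g325a nbar hn), pairVA A A' ℓ (bAssign b b' ℓ.1)) =
      ∏ ℓ ∈ ({evA nbar hn 0, evA nbar hn 1} : Finset (ExtVLeg (g325a nbar hn))), pairVA A A' ℓ (bAssign b b' ℓ.1) by
        rw [← univ_extVLegA], Finset.prod_pair evA0_ne_evA1, e0, e1]
  show A (bAssign b b' (tv 0)) * A' (bAssign b b' (tv 1)) = _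
  rw [f0, f1]

/-- The product external vector field of (3.25)₂ (`A` at `x`, `A′` at `x′`). [cite: Balaban1983Higgs3, (3.26) p.440] -/
def pairVB (A A' : HiggsLattice.VecField P 0) : ExtVLeg (g325b nbar hn) → HiggsLattice.VecField P 0 :=
  fun ℓ => if ℓ = evB nbar hn 0 then A else A'

/-- values of `pairVB`. [cite: Balaban1983Higgs3, (3.26) p.440] -/
theorem pairVB_apply (A A' : HiggsLattice.VecField P 0) :
    pairVB (hn := hn) A A' (evB nbar hn 0) = A ∧ pairVB (hn := hn) A A' (evB nbar hn 1) = A' := by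
  simp [pairVB, (evB0_ne_evB1 (hn := hn)).symm]

/-- `prodExtV (pairVB A A′)` read at `b`, `b′`: `A(b)·A′(b′)`. [cite: Balaban1983Higgs3, (3.26) p.440] -/
theorem prodExtV_pairVB (A A' : HiggsLattice.VecField P 0) (b b' : HiggsLattice.PBond P 0) :
    prodExtV (pairVB (hn := hn) A A') (fun ℓ : ExtVLeg (g325b nbar hn) => bAssign b b' ℓ.1) = A b * A' b' := by
  unfold prodExtV
  obtain ⟨e0, e1⟩ := pairVB_apply (hn := hn) A A'
  obtain ⟨f0, f1⟩ := bAssign_apply b b'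
  rw [show (∏ ℓ : ExtVLeg (g325b nbar hn), pairVB A A' ℓ (bAssign b b' ℓ.1)) =
      ∏ ℓ ∈ ({evB nbar hn 0, evB nbar hn 1} : Finset (ExtVLeg (g325b nbar hn))), pairVB A A' ℓ (bAssign b b' ℓ.1) by
        rw [← univ_extVLegB], Finset.prod_pair evB0_ne_evB1, e0, e1]
  show A (bAssign b b' (tv 0)) * A' (bAssign b b' (tv 1)) = _
  rw [f0, f1]

end ProductExt

/-! ## §5 Zero background, free kernels: the values ARE (up to the global sign, see the header) the terms `T₁`, `T₂` of (3.26) -/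

section Free

variable {P : HiggsLattice.Params} {N k : ℕ} {hn : 1 ≤ nbar}

/-- **The generic two-leg pairing of (3.26)** on this carrier: `Σ_{x,x′} η^{2d} Σ_{μ,μ′=1}^d g(x)A_μ(x)·K_{μμ′}(x,x′)·F_{μ′}(x,x′)` — r15's
`B3Sect3VectorSelfEnergy.pairSum` symbol by symbol (`A_μ(x) = A ⟨x, μ⟩`). [cite: Balaban1983Higgs3, (3.26) p.440] -/
def pairSumT (η : ℝ) (K : Fin P.d → Fin P.d → HiggsLattice.Site P 0 → HiggsLattice.Site P 0 → ℝ) (g : HiggsLattice.Site P 0 → ℝ)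
    (A : HiggsLattice.VecField P 0) (F : Fin P.d → HiggsLattice.Site P 0 → HiggsLattice.Site P 0 → ℝ) : ℝ :=
  ∑ x : HiggsLattice.Site P 0, ∑ x' : HiggsLattice.Site P 0, η ^ (2 * P.d) *
    ∑ μ : Fin P.d, ∑ μ' : Fin P.d, g x * A ⟨x, μ⟩ * K μ μ' x x' * F μ' x x'

/-- The nonlocal second leg `F_{μ′}(x,x′) = g′(x′)A′_{μ′}(x′)` of the left side of (3.26) — r15's `legFar`. [cite: Balaban1983Higgs3, (3.26) p.440] -/
def legFarT (g' : HiggsLattice.Site P 0 → ℝ) (A' : HiggsLattice.VecField P 0) : Fin P.d → HiggsLattice.Site P 0 → HiggsLattice.Site P 0 → ℝ :=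
  fun μ' _ x' => g' x' * A' ⟨x', μ'⟩

/-- **The kernel of the first graph of (3.26)**: `tr q²(G^η_{(j)}(0)∂^{η*}_{μ′})(x,x′)(G^η_{(j′)}(0)∂^{η*}_μ)(x′,x)` — r15's `kerA η τ Gj Gj′`
symbol by symbol (`τ` = tr q²). [cite: Balaban1983Higgs3, (3.26) p.440] -/
def kerAT (η τ : ℝ) (Gj Gj' : HiggsLattice.Site P 0 → HiggsLattice.Site P 0 → ℝ) (μ μ' : Fin P.d) (x x' : HiggsLattice.Site P 0) : ℝ :=
  τ * (dKernelR η⁻¹ μ' Gj x x' * dKernelR η⁻¹ μ Gj' x' x)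

/-- **The kernel of the second graph of (3.26)**: `tr q² G^η_{(j)}(0;x,x′)(∂^η_{μ′}G^η_{(j′)}(0)∂^{η*}_μ)(x′,x)` — r15's `kerB η τ Gj Gj′`
symbol by symbol. [cite: Balaban1983Higgs3, (3.26) p.440] -/
def kerBT (η τ : ℝ) (Gj Gj' : HiggsLattice.Site P 0 → HiggsLattice.Site P 0 → ℝ) (μ μ' : Fin P.d) (x x' : HiggsLattice.Site P 0) : ℝ :=
  τ * (Gj x x' * d2KernelT η⁻¹ μ' μ Gj' x' x)

/-- **The first two terms of the LEFT SIDE of (3.26)** p. 440 [PDF 30], verbatim: *"− Σ_{x,x′} η^{2d} Σ_{μ,μ′=1}^d g(x)A_μ(x) tr q²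
(G^η_{(j)}(0)∂^{η*}_{μ′})(x,x′)(G^η_{(j′)}(0)∂^{η*}_μ)(x′,x) g′(x′)A′_{μ′}(x′) + Σ_{x,x′} η^{2d} Σ_{μ,μ′=1}^d g(x)A_μ(x) tr q² G^η_{(j)}(0;x,x′)
(∂^η_{μ′}G^η_{(j′)}(0)∂^{η*}_μ)(x′,x) g′(x′)A′_{μ′}(x′)"* — r15's `−pairSum η (kerA…) g A (legFar g′ A′) + pairSum η (kerB…) g A (legFar g′ A′)`
(the first half of `lhs326`; the two local terms `T₃`, `T₄` belong to the tadpoles (3.25)₃,₄). [cite: Balaban1983Higgs3, (3.26) p.440] -/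
def twoGraphs326T (η τ : ℝ) (Gj Gj' : HiggsLattice.Site P 0 → HiggsLattice.Site P 0 → ℝ) (g g' : HiggsLattice.Site P 0 → ℝ)
    (A A' : HiggsLattice.VecField P 0) : ℝ :=
  -pairSumT η (kerAT η τ Gj Gj') g A (legFarT g' A') + pairSumT η (kerBT η τ Gj Gj') g A (legFarT g' A')

/-- **The free evaluation of (3.25)₁**: at zero background, all bonds summed, site-valued localization functions `g₀`, `g₁`, the free
kernels `G₀ ⊗ 1_N` (line `ℓ₀`) and `G₁ ⊗ 1_N` (line `ℓ₁`) and the product external field `A(b)A′(b′)`, the bond double sum of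
`graphAmp_g325a` is `tr q² · Σ_{x,x′} η^{2d} Σ_{μ,μ′} g₀g_k(x)A_μ(x)·(∂^η_μG₀)(x,x′)(G₁∂^{η*}_{μ′})(x,x′)·g₁g_k(x′)A′_{μ′}(x′)` — the
crossed φ′-loop gives `Σ_{c,c′}(qe_c)_{c′}(qe_{c′})_c = +tr q²`. [cite: Balaban1983Higgs3, (3.26) p.440] -/
theorem free_evalA (M : Model P N k) (hB : M.B = 0) (hS : M.S = Finset.univ) (g₀ g₁ : HiggsLattice.Site P 0 → ℝ)
    (G₀ G₁ : HiggsLattice.Site P 0 → HiggsLattice.Site P 0 → ℝ) (A A' : HiggsLattice.VecField P 0) :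
    ∑ b ∈ M.S, ∑ b' ∈ M.S, g₀ b.src * g₁ b'.src * ((P.mesh 0 ^ P.d) ^ 2 * (M.g b.src * M.g b'.src) * (A b * A' b') *
        ∑ c : Fin N, ∑ c' : Fin N, dK1 M.C M.B (fun p p' => if p.2 = p'.2 then G₀ p.1 p'.1 else 0) b (M.C.q (EuclideanSpace.single c (1 : ℝ))) (b'.src, c') *
          dK2 M.C M.B (fun p p' => if p.2 = p'.2 then G₁ p.1 p'.1 else 0) (b.src, c) b' (M.C.q (EuclideanSpace.single c' (1 : ℝ)))) =
      trq2 M.C * pairSumT (P.mesh 0) (fun μ μ' x x' => dKernelL (P.mesh 0)⁻¹ μ G₀ x x' * dKernelR (P.mesh 0)⁻¹ μ' G₁ x x')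
        (fun x => g₀ x * M.g x) A (legFarT (fun x => g₁ x * M.g x) A') := by
  simp only [hS, hB]
  rw [sum_bond]
  simp only [sum_bond, dK1_zero_free, dK2_zero_free]
  have hc : ∀ (x : HiggsLattice.Site P 0) (μ : Fin P.d) (x' : HiggsLattice.Site P 0) (μ' : Fin P.d),
      ∑ c : Fin N, ∑ c' : Fin N, dKernelL (P.mesh 0)⁻¹ μ G₀ x x' * (M.C.q (EuclideanSpace.single c (1 : ℝ))) c' *
          (dKernelR (P.mesh 0)⁻¹ μ' G₁ x x' * (M.C.q (EuclideanSpace.single c' (1 : ℝ))) c) =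
        dKernelL (P.mesh 0)⁻¹ μ G₀ x x' * dKernelR (P.mesh 0)⁻¹ μ' G₁ x x' * trq2 M.C := by
    intro x μ x' μ'
    rw [← sum_q_single_cross M.C, Finset.mul_sum]
    refine Finset.sum_congr rfl fun c _ => ?_
    rw [Finset.mul_sum]
    refine Finset.sum_congr rfl fun c' _ => ?_
    ring
  simp only [hc]
  unfold pairSumT legFarT
  rw [Finset.mul_sum]
  refine Finset.sum_congr rfl fun x _ => ?_
  rw [Finset.sum_comm, Finset.mul_sum]
  refine Finset.sum_congr rfl fun x' _ => ?_
  rw [Finset.mul_sum, Finset.mul_sum]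
  refine Finset.sum_congr rfl fun μ _ => ?_
  rw [Finset.mul_sum, Finset.mul_sum]
  refine Finset.sum_congr rfl fun μ' _ => ?_
  beta_reduce
  ring

/-- **The free evaluation of (3.25)₂**: with the free kernels `G₀ ⊗ 1_N` on the doubly differentiated line `ℓ₀` and `G₁ ⊗ 1_N` on the
plain line `ℓ₁`, the bond double sum of `graphAmp_g325b` is `−tr q² · Σ_{x,x′} η^{2d} Σ_{μ,μ′} g₀g_k(x)A_μ(x)·G₁(x,x′)
(∂^η_μG₀∂^{η*}_{μ′})(x,x′)·g₁g_k(x′)A′_{μ′}(x′)` — the direct φ′-loop gives `Σ_c (qe_c)·(qe_c) = −tr q²`. [cite: Balaban1983Higgs3, (3.26) p.440] -/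
theorem free_evalB (M : Model P N k) (hB : M.B = 0) (hS : M.S = Finset.univ) (g₀ g₁ : HiggsLattice.Site P 0 → ℝ)
    (G₀ G₁ : HiggsLattice.Site P 0 → HiggsLattice.Site P 0 → ℝ) (A A' : HiggsLattice.VecField P 0) :
    ∑ b ∈ M.S, ∑ b' ∈ M.S, g₀ b.src * g₁ b'.src * ((P.mesh 0 ^ P.d) ^ 2 * (M.g b.src * M.g b'.src) * (A b * A' b') *
        ∑ c : Fin N, ∑ c' : Fin N, dKs M.C M.B (fun p p' => if p.2 = p'.2 then G₀ p.1 p'.1 else 0) b (M.C.q (EuclideanSpace.single c (1 : ℝ))) b'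
          (M.C.q (EuclideanSpace.single c' (1 : ℝ))) * (if c = c' then G₁ b.src b'.src else 0)) =
      -(trq2 M.C * pairSumT (P.mesh 0) (fun μ μ' x x' => G₁ x x' * d2KernelT (P.mesh 0)⁻¹ μ μ' G₀ x x')
        (fun x => g₀ x * M.g x) A (legFarT (fun x => g₁ x * M.g x) A')) := by
  simp only [hS, hB]
  rw [sum_bond]
  simp only [sum_bond, dKs_zero_free2]
  have hc : ∀ (x : HiggsLattice.Site P 0) (μ : Fin P.d) (x' : HiggsLattice.Site P 0) (μ' : Fin P.d),
      ∑ c : Fin N, ∑ c' : Fin N, d2KernelT (P.mesh 0)⁻¹ μ μ' G₀ x x' *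
          ⟪M.C.q (EuclideanSpace.single c (1 : ℝ)), M.C.q (EuclideanSpace.single c' (1 : ℝ))⟫_ℝ * (if c = c' then G₁ x x' else 0) =
        -(G₁ x x' * d2KernelT (P.mesh 0)⁻¹ μ μ' G₀ x x' * trq2 M.C) := by
    intro x μ x' μ'
    have h1 : ∀ c : Fin N, ∑ c' : Fin N, d2KernelT (P.mesh 0)⁻¹ μ μ' G₀ x x' *
        ⟪M.C.q (EuclideanSpace.single c (1 : ℝ)), M.C.q (EuclideanSpace.single c' (1 : ℝ))⟫_ℝ * (if c = c' then G₁ x x' else 0) =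
        d2KernelT (P.mesh 0)⁻¹ μ μ' G₀ x x' * G₁ x x' * ⟪M.C.q (EuclideanSpace.single c (1 : ℝ)), M.C.q (EuclideanSpace.single c (1 : ℝ))⟫_ℝ := by
      intro c
      simp only [mul_ite, mul_zero, Finset.sum_ite_eq, Finset.mem_univ, if_true]
      ring
    simp only [h1, ← Finset.mul_sum, sum_inner_q_single]
    ring
  simp only [hc]
  unfold pairSumT legFarT
  rw [Finset.mul_sum, ← Finset.sum_neg_distrib]
  refine Finset.sum_congr rfl fun x _ => ?_
  rw [Finset.sum_comm, Finset.mul_sum, ← Finset.sum_neg_distrib]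
  refine Finset.sum_congr rfl fun x' _ => ?_
  rw [Finset.mul_sum, Finset.mul_sum, ← Finset.sum_neg_distrib]
  refine Finset.sum_congr rfl fun μ _ => ?_
  rw [Finset.mul_sum, Finset.mul_sum, ← Finset.sum_neg_distrib]
  refine Finset.sum_congr rfl fun μ' _ => ?_
  beta_reduce
  ring

variable [DecidableEq (HiggsLattice.PBond P 0)]

/-- **E((3.25)₁) AT ZERO BACKGROUND WITH THE FREE KERNELS** (p. 433 *"we put B̃ = 0"*, propagators `G_{(j)}(0)`): for `B̃ = 0`, all
bonds, site-valued localization functions `g₀`, `g₁` of the two vertices, the free kernels `G₀ ⊗ 1_N` (line `ℓ₀`: differentiated at `x`,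
plain at `x′`) and `G₁ ⊗ 1_N` (line `ℓ₁`: plain at `x`, differentiated at `x′`) and the product external vector field `A(b)A′(b′)`:
`E = Φ(∅)Ψ(∅) · e² · tr q² · Σ_{x,x′} η^{2d} Σ_{μ,μ′} g₀g_k(x)A_μ(x)·(∂^η_μG₀)(x,x′)(G₁∂^{η*}_{μ′})(x,x′)·g₁g_k(x′)A′_{μ′}(x′)`.
[cite: Balaban1983Higgs3, (3.26) p.440] [cite: Balaban1983Higgs3, (3.25) p.439] -/
theorem graphAmp_g325a_free (M : Model P N k) (hB : M.B = 0) (hS : M.S = Finset.univ)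
    (dm2 : Fin (g325a nbar hn).nV → HiggsLattice.Site P 0 → ℝ) (loc : Fin (g325a nbar hn).nV → Loc P k)
    (g₀ g₁ : HiggsLattice.Site P 0 → ℝ) (hw₀ : ∀ b, (loc (vxa nbar hn 0)).wB b = g₀ b.src) (hw₁ : ∀ b, (loc (vxa nbar hn 1)).wB b = g₁ b.src)
    (Po : OutPairing (g325a nbar hn)) (Ks : SLine (g325a nbar hn) → HiggsLattice.Site P 0 × Fin N → HiggsLattice.Site P 0 × Fin N → ℝ)
    (Kv : VLine (g325a nbar hn) → HiggsLattice.PBond P 0 → HiggsLattice.PBond P 0 → ℝ)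
    (Ko : Po.Line oRank → HiggsLattice.Site P k × Fin N → HiggsLattice.Site P k × Fin N → ℝ)
    (G₀ G₁ : HiggsLattice.Site P 0 → HiggsLattice.Site P 0 → ℝ)
    (hK₀ : ∀ p p', Ks (lineA0 nbar hn) p p' = if p.2 = p'.2 then G₀ p.1 p'.1 else 0)
    (hK₁ : ∀ p p', Ks (lineA1 nbar hn) p p' = if p.2 = p'.2 then G₁ p.1 p'.1 else 0)
    (Φ : (ExtSLeg (g325a nbar hn) → HiggsLattice.Site P 0 × Fin N) → ℝ) (A A' : HiggsLattice.VecField P 0)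
    (Ψ : (Po.Ext → HiggsLattice.Site P k × Fin N) → ℝ) :
    graphAmp (g325a nbar hn) M dm2 loc Po Ks Kv Ko Φ (prodExtV (pairVA A A')) Ψ =
      (Φ (fun ℓ => isEmptyElim ℓ) * Ψ (fun ℓ => isEmptyElim ℓ)) *
        (M.C.e ^ 2 * (trq2 M.C * pairSumT (P.mesh 0) (fun μ μ' x x' => dKernelL (P.mesh 0)⁻¹ μ G₀ x x' * dKernelR (P.mesh 0)⁻¹ μ' G₁ x x')
          (fun x => g₀ x * M.g x) A (legFarT (fun x => g₁ x * M.g x) A'))) := by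
  rw [graphAmp_g325a]
  have hK0 : Ks (lineA0 nbar hn) = fun p p' => if p.2 = p'.2 then G₀ p.1 p'.1 else 0 := funext fun p => funext fun p' => hK₀ p p'
  have hK1 : Ks (lineA1 nbar hn) = fun p p' => if p.2 = p'.2 then G₁ p.1 p'.1 else 0 := funext fun p => funext fun p' => hK₁ p p'
  simp only [prodExtV_pairVA, hw₀, hw₁, hK0, hK1]
  rw [free_evalA M hB hS g₀ g₁ G₀ G₁ A A']

/-- **E((3.25)₂) AT ZERO BACKGROUND WITH THE FREE KERNELS**: with `G₀ ⊗ 1_N` on the doubly differentiated line `ℓ₀` and `G₁ ⊗ 1_N` on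
the plain line `ℓ₁`: `E = −Φ(∅)Ψ(∅) · e² · tr q² · Σ_{x,x′} η^{2d} Σ_{μ,μ′} g₀g_k(x)A_μ(x)·G₁(x,x′)(∂^η_μG₀∂^{η*}_{μ′})(x,x′)·g₁g_k(x′)A′_{μ′}(x′)`.
[cite: Balaban1983Higgs3, (3.26) p.440] [cite: Balaban1983Higgs3, (3.25) p.439] -/
theorem graphAmp_g325b_free (M : Model P N k) (hB : M.B = 0) (hS : M.S = Finset.univ)
    (dm2 : Fin (g325b nbar hn).nV → HiggsLattice.Site P 0 → ℝ) (loc : Fin (g325b nbar hn).nV → Loc P k)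
    (g₀ g₁ : HiggsLattice.Site P 0 → ℝ) (hw₀ : ∀ b, (loc (vxb nbar hn 0)).wB b = g₀ b.src) (hw₁ : ∀ b, (loc (vxb nbar hn 1)).wB b = g₁ b.src)
    (Po : OutPairing (g325b nbar hn)) (Ks : SLine (g325b nbar hn) → HiggsLattice.Site P 0 × Fin N → HiggsLattice.Site P 0 × Fin N → ℝ)
    (Kv : VLine (g325b nbar hn) → HiggsLattice.PBond P 0 → HiggsLattice.PBond P 0 → ℝ)
    (Ko : Po.Line oRank → HiggsLattice.Site P k × Fin N → HiggsLattice.Site P k × Fin N → ℝ)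
    (G₀ G₁ : HiggsLattice.Site P 0 → HiggsLattice.Site P 0 → ℝ)
    (hK₀ : ∀ p p', Ks (lineB0 nbar hn) p p' = if p.2 = p'.2 then G₀ p.1 p'.1 else 0)
    (hK₁ : ∀ p p', Ks (lineB1 nbar hn) p p' = if p.2 = p'.2 then G₁ p.1 p'.1 else 0)
    (Φ : (ExtSLeg (g325b nbar hn) → HiggsLattice.Site P 0 × Fin N) → ℝ) (A A' : HiggsLattice.VecField P 0)
    (Ψ : (Po.Ext → HiggsLattice.Site P k × Fin N) → ℝ) :
    graphAmp (g325b nbar hn) M dm2 loc Po Ks Kv Ko Φ (prodExtV (pairVB A A')) Ψ =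
      (Φ (fun ℓ => isEmptyElim ℓ) * Ψ (fun ℓ => isEmptyElim ℓ)) *
        (M.C.e ^ 2 * -(trq2 M.C * pairSumT (P.mesh 0) (fun μ μ' x x' => G₁ x x' * d2KernelT (P.mesh 0)⁻¹ μ μ' G₀ x x')
          (fun x => g₀ x * M.g x) A (legFarT (fun x => g₁ x * M.g x) A'))) := by
  rw [graphAmp_g325b]
  have hK0 : Ks (lineB0 nbar hn) = fun p p' => if p.2 = p'.2 then G₀ p.1 p'.1 else 0 := funext fun p => funext fun p' => hK₀ p p'
  simp only [prodExtV_pairVB, hw₀, hw₁, hK0, hK₁]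
  rw [free_evalB M hB hS g₀ g₁ G₀ G₁ A A']

end Free

/-! ## §6 The identification with print's `T₁`, `T₂` (symmetric propagators) and the relative sign -/

section Print

variable {P : HiggsLattice.Params} {N k : ℕ} {hn : 1 ≤ nbar}

/-- a constant multiplies the kernel of `pairSumT`. [cite: Balaban1983Higgs3, (3.26) p.440] -/
theorem mul_pairSumT (τ η : ℝ) (K : Fin P.d → Fin P.d → HiggsLattice.Site P 0 → HiggsLattice.Site P 0 → ℝ) (g : HiggsLattice.Site P 0 → ℝ)
    (A : HiggsLattice.VecField P 0) (F : Fin P.d → HiggsLattice.Site P 0 → HiggsLattice.Site P 0 → ℝ) :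
    τ * pairSumT η K g A F = pairSumT η (fun μ μ' x x' => τ * K μ μ' x x') g A F := by
  simp only [pairSumT, Finset.mul_sum]
  exact Finset.sum_congr rfl fun x _ => Finset.sum_congr rfl fun x' _ => Finset.sum_congr rfl fun μ _ =>
    Finset.sum_congr rfl fun μ' _ => by ring

/-- For a SYMMETRIC propagator `G₀` on the line `ℓ₀` the natural kernel of the free value of (3.25)₁ IS print's `kerA` with
`G_{(j)} = G₁` (the line plain at `x`: `(G_{(j)}∂^{η*}_{μ′})(x,x′)`) and `G_{(j′)} = G₀` (the line differentiated at `x`: `(G_{(j′)}∂^{η*}_μ)(x′,x)`).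
[cite: Balaban1983Higgs3, (3.26) p.440] -/
theorem kerAT_eq (η τ : ℝ) (G₀ G₁ : HiggsLattice.Site P 0 → HiggsLattice.Site P 0 → ℝ) (hG₀ : ∀ a b, G₀ a b = G₀ b a) :
    (fun μ μ' x x' => τ * (dKernelL η⁻¹ μ G₀ x x' * dKernelR η⁻¹ μ' G₁ x x')) = kerAT η τ G₁ G₀ := by
  funext μ μ' x x'
  unfold kerAT
  rw [dKernelL_of_symm _ _ _ hG₀]
  ring

/-- For a symmetric propagator `G₀` on the doubly differentiated line the natural kernel of the free value of (3.25)₂ IS print's `kerB`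
with `G_{(j)} = G₁` (the plain line `G_{(j)}(0;x,x′)`) and `G_{(j′)} = G₀` (`(∂^η_{μ′}G_{(j′)}∂^{η*}_μ)(x′,x)`). [cite: Balaban1983Higgs3, (3.26) p.440] -/
theorem kerBT_eq (η τ : ℝ) (G₀ G₁ : HiggsLattice.Site P 0 → HiggsLattice.Site P 0 → ℝ) (hG₀ : ∀ a b, G₀ a b = G₀ b a) :
    (fun μ μ' x x' => τ * (G₁ x x' * d2KernelT η⁻¹ μ μ' G₀ x x')) = kerBT η τ G₁ G₀ := by
  funext μ μ' x x'
  unfold kerBT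
  rw [d2KernelT_of_symm _ _ _ _ hG₀]

variable [DecidableEq (HiggsLattice.PBond P 0)]

/-- **E((3.25)₁), free, = `+e²·T₁`**: with a symmetric propagator on the line `ℓ₀` (print's `G^η_{(j′)}(0)`; all propagators `G^η_{(j)}(0)`
of Sect. 3 are symmetric) the free value of (3.25)₁ is `Φ(∅)Ψ(∅)·e²·T₁`, `T₁ = Σ_{x,x′} η^{2d} Σ_{μ,μ′} g(x)A_μ(x) tr q²
(G^η_{(j)}(0)∂^{η*}_{μ′})(x,x′)(G^η_{(j′)}(0)∂^{η*}_μ)(x′,x) g′(x′)A′_{μ′}(x′)` the first term of (3.26) WITHOUT its printed minus sign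
(`g = g₀g_k`, `g′ = g₁g_k`; r15's `pairSum η (kerA η τ Gj Gj′) g A (legFar g′ A′)` on this carrier, `τ = tr q²`).
[cite: Balaban1983Higgs3, (3.26) p.440] [cite: Balaban1983Higgs3, (3.25) p.439] -/
theorem graphAmp_g325a_free_print (M : Model P N k) (hB : M.B = 0) (hS : M.S = Finset.univ)
    (dm2 : Fin (g325a nbar hn).nV → HiggsLattice.Site P 0 → ℝ) (loc : Fin (g325a nbar hn).nV → Loc P k)
    (g₀ g₁ : HiggsLattice.Site P 0 → ℝ) (hw₀ : ∀ b, (loc (vxa nbar hn 0)).wB b = g₀ b.src) (hw₁ : ∀ b, (loc (vxa nbar hn 1)).wB b = g₁ b.src)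
    (Po : OutPairing (g325a nbar hn)) (Ks : SLine (g325a nbar hn) → HiggsLattice.Site P 0 × Fin N → HiggsLattice.Site P 0 × Fin N → ℝ)
    (Kv : VLine (g325a nbar hn) → HiggsLattice.PBond P 0 → HiggsLattice.PBond P 0 → ℝ)
    (Ko : Po.Line oRank → HiggsLattice.Site P k × Fin N → HiggsLattice.Site P k × Fin N → ℝ)
    (Gj Gj' : HiggsLattice.Site P 0 → HiggsLattice.Site P 0 → ℝ) (hGj' : ∀ a b, Gj' a b = Gj' b a)
    (hK₀ : ∀ p p', Ks (lineA0 nbar hn) p p' = if p.2 = p'.2 then Gj' p.1 p'.1 else 0)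
    (hK₁ : ∀ p p', Ks (lineA1 nbar hn) p p' = if p.2 = p'.2 then Gj p.1 p'.1 else 0)
    (Φ : (ExtSLeg (g325a nbar hn) → HiggsLattice.Site P 0 × Fin N) → ℝ) (A A' : HiggsLattice.VecField P 0)
    (Ψ : (Po.Ext → HiggsLattice.Site P k × Fin N) → ℝ) :
    graphAmp (g325a nbar hn) M dm2 loc Po Ks Kv Ko Φ (prodExtV (pairVA A A')) Ψ =
      (Φ (fun ℓ => isEmptyElim ℓ) * Ψ (fun ℓ => isEmptyElim ℓ)) *
        (M.C.e ^ 2 * pairSumT (P.mesh 0) (kerAT (P.mesh 0) (trq2 M.C) Gj Gj') (fun x => g₀ x * M.g x) A (legFarT (fun x => g₁ x * M.g x) A')) := by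
  rw [graphAmp_g325a_free M hB hS dm2 loc g₀ g₁ hw₀ hw₁ Po Ks Kv Ko Gj' Gj hK₀ hK₁ Φ A A' Ψ, mul_pairSumT, kerAT_eq _ _ _ _ hGj']

/-- **E((3.25)₂), free, = `−e²·T₂`**: with a symmetric propagator on the doubly differentiated line (print's `G^η_{(j′)}(0)`) the free
value of (3.25)₂ is `−Φ(∅)Ψ(∅)·e²·T₂`, `T₂ = Σ_{x,x′} η^{2d} Σ_{μ,μ′} g(x)A_μ(x) tr q² G^η_{(j)}(0;x,x′)(∂^η_{μ′}G^η_{(j′)}(0)∂^{η*}_μ)(x′,x)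
g′(x′)A′_{μ′}(x′)` the second term of (3.26) (r15's `pairSum η (kerB η τ Gj Gj′) g A (legFar g′ A′)` on this carrier).
[cite: Balaban1983Higgs3, (3.26) p.440] [cite: Balaban1983Higgs3, (3.25) p.439] -/
theorem graphAmp_g325b_free_print (M : Model P N k) (hB : M.B = 0) (hS : M.S = Finset.univ)
    (dm2 : Fin (g325b nbar hn).nV → HiggsLattice.Site P 0 → ℝ) (loc : Fin (g325b nbar hn).nV → Loc P k)
    (g₀ g₁ : HiggsLattice.Site P 0 → ℝ) (hw₀ : ∀ b, (loc (vxb nbar hn 0)).wB b = g₀ b.src) (hw₁ : ∀ b, (loc (vxb nbar hn 1)).wB b = g₁ b.src)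
    (Po : OutPairing (g325b nbar hn)) (Ks : SLine (g325b nbar hn) → HiggsLattice.Site P 0 × Fin N → HiggsLattice.Site P 0 × Fin N → ℝ)
    (Kv : VLine (g325b nbar hn) → HiggsLattice.PBond P 0 → HiggsLattice.PBond P 0 → ℝ)
    (Ko : Po.Line oRank → HiggsLattice.Site P k × Fin N → HiggsLattice.Site P k × Fin N → ℝ)
    (Gj Gj' : HiggsLattice.Site P 0 → HiggsLattice.Site P 0 → ℝ) (hGj' : ∀ a b, Gj' a b = Gj' b a)
    (hK₀ : ∀ p p', Ks (lineB0 nbar hn) p p' = if p.2 = p'.2 then Gj' p.1 p'.1 else 0)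
    (hK₁ : ∀ p p', Ks (lineB1 nbar hn) p p' = if p.2 = p'.2 then Gj p.1 p'.1 else 0)
    (Φ : (ExtSLeg (g325b nbar hn) → HiggsLattice.Site P 0 × Fin N) → ℝ) (A A' : HiggsLattice.VecField P 0)
    (Ψ : (Po.Ext → HiggsLattice.Site P k × Fin N) → ℝ) :
    graphAmp (g325b nbar hn) M dm2 loc Po Ks Kv Ko Φ (prodExtV (pairVB A A')) Ψ =
      (Φ (fun ℓ => isEmptyElim ℓ) * Ψ (fun ℓ => isEmptyElim ℓ)) *
        -(M.C.e ^ 2 * pairSumT (P.mesh 0) (kerBT (P.mesh 0) (trq2 M.C) Gj Gj') (fun x => g₀ x * M.g x) A (legFarT (fun x => g₁ x * M.g x) A')) := by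
  rw [graphAmp_g325b_free M hB hS dm2 loc g₀ g₁ hw₀ hw₁ Po Ks Kv Ko Gj' Gj hK₀ hK₁ Φ A A' Ψ, mul_pairSumT, kerBT_eq _ _ _ _ hGj', mul_neg]

/-- **THE TWO NONLOCAL GRAPHS OF (3.25) AGAINST THE FIRST TWO TERMS OF (3.26), free**: with no external φ′-leg and no averaging output
read trivially (`Φ = Ψ = 1`), the same model data, localization functions `g₀` (vertex `x`) and `g₁` (vertex `x′`) in both pictures, the
plain-at-`x` line of each picture carrying `G^η_{(j)}(0) ⊗ 1_N` and the other line the symmetric `G^η_{(j′)}(0) ⊗ 1_N`, and the product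
external vector field `A`, `A′`:  `E((3.25)₁) + E((3.25)₂) = −e²·(−T₁ + T₂)` — the kernel finds print's first two terms of (3.26),
*"−Σ…(G∂^*)(G∂^*)… + Σ…G(∂G∂^*)…"*, multiplied by `−e²` (for (3.9) FILE 5 found the factor `+e²`: under one and the same typed set of rules
(1.8), (1.10) and pairings the printed (3.26) carries the opposite global sign relative to the printed (3.9); the sign of the class is
immaterial for Proposition 1, which bounds absolute values — recorded here as a reading note, not used anywhere).
[cite: Balaban1983Higgs3, (3.26) p.440] [cite: Balaban1983Higgs3, (3.25) p.439] [cite: Balaban1983Higgs3, (3.9) p.435] -/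
theorem graphAmp_g325ab_free_print (M : Model P N k) (hB : M.B = 0) (hS : M.S = Finset.univ) (g₀ g₁ : HiggsLattice.Site P 0 → ℝ)
    (dm2a : Fin (g325a nbar hn).nV → HiggsLattice.Site P 0 → ℝ) (loca : Fin (g325a nbar hn).nV → Loc P k)
    (hw₀a : ∀ b, (loca (vxa nbar hn 0)).wB b = g₀ b.src) (hw₁a : ∀ b, (loca (vxa nbar hn 1)).wB b = g₁ b.src)
    (Poa : OutPairing (g325a nbar hn)) (Ksa : SLine (g325a nbar hn) → HiggsLattice.Site P 0 × Fin N → HiggsLattice.Site P 0 × Fin N → ℝ)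
    (Kva : VLine (g325a nbar hn) → HiggsLattice.PBond P 0 → HiggsLattice.PBond P 0 → ℝ)
    (Koa : Poa.Line oRank → HiggsLattice.Site P k × Fin N → HiggsLattice.Site P k × Fin N → ℝ)
    (dm2b : Fin (g325b nbar hn).nV → HiggsLattice.Site P 0 → ℝ) (locb : Fin (g325b nbar hn).nV → Loc P k)
    (hw₀b : ∀ b, (locb (vxb nbar hn 0)).wB b = g₀ b.src) (hw₁b : ∀ b, (locb (vxb nbar hn 1)).wB b = g₁ b.src)
    (Pob : OutPairing (g325b nbar hn)) (Ksb : SLine (g325b nbar hn) → HiggsLattice.Site P 0 × Fin N → HiggsLattice.Site P 0 × Fin N → ℝ)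
    (Kvb : VLine (g325b nbar hn) → HiggsLattice.PBond P 0 → HiggsLattice.PBond P 0 → ℝ)
    (Kob : Pob.Line oRank → HiggsLattice.Site P k × Fin N → HiggsLattice.Site P k × Fin N → ℝ)
    (Gj Gj' : HiggsLattice.Site P 0 → HiggsLattice.Site P 0 → ℝ) (hGj' : ∀ a b, Gj' a b = Gj' b a)
    (hKa₀ : ∀ p p', Ksa (lineA0 nbar hn) p p' = if p.2 = p'.2 then Gj' p.1 p'.1 else 0)
    (hKa₁ : ∀ p p', Ksa (lineA1 nbar hn) p p' = if p.2 = p'.2 then Gj p.1 p'.1 else 0)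
    (hKb₀ : ∀ p p', Ksb (lineB0 nbar hn) p p' = if p.2 = p'.2 then Gj' p.1 p'.1 else 0)
    (hKb₁ : ∀ p p', Ksb (lineB1 nbar hn) p p' = if p.2 = p'.2 then Gj p.1 p'.1 else 0)
    (A A' : HiggsLattice.VecField P 0) :
    graphAmp (g325a nbar hn) M dm2a loca Poa Ksa Kva Koa (fun _ => 1) (prodExtV (pairVA A A')) (fun _ => 1) +
        graphAmp (g325b nbar hn) M dm2b locb Pob Ksb Kvb Kob (fun _ => 1) (prodExtV (pairVB A A')) (fun _ => 1) =
      -(M.C.e ^ 2 * twoGraphs326T (P.mesh 0) (trq2 M.C) Gj Gj' (fun x => g₀ x * M.g x) (fun x => g₁ x * M.g x) A A') := by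
  rw [graphAmp_g325a_free_print M hB hS dm2a loca g₀ g₁ hw₀a hw₁a Poa Ksa Kva Koa Gj Gj' hGj' hKa₀ hKa₁,
    graphAmp_g325b_free_print M hB hS dm2b locb g₀ g₁ hw₀b hw₁b Pob Ksb Kvb Kob Gj Gj' hGj' hKb₀ hKb₁]
  unfold twoGraphs326T
  ring

end Print

/-! ## §7 The two local pictures (3.25)₃ (p18's `g325c`: the φ′-loop at the vertex (1.10)_{2,0}) and (3.25)₄ (`g325d`: the φ′-loop at
the vertex (1.8)_{2,0} through its differentiated leg), both A′-legs external -/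

section Tadpoles

/-- The vertex kind of (3.25)₃: one vertex (1.10)_{2,0}. [cite: Balaban1983Higgs3, (3.25) p.439] -/
def kindC : Fin 1 → VertexKind := fun _ => .v110 2 0

/-- The vertex kind of (3.25)₄: one vertex (1.8)_{2,0}. [cite: Balaban1983Higgs3, (3.25) p.439] -/
def kindD : Fin 1 → VertexKind := fun _ => .v18 2 0

/-- the φ′-leg `j` of (3.25)₃ (`j = 0`: `φ′(b₋)·`, `j = 1`: `·q²φ′(b₋)`). [cite: Balaban1983Higgs3, (3.25) p.439] -/
def sc (j : Fin 2) : SLeg kindC := ⟨0, j⟩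

/-- the A′-leg `j` of (3.25)₃. [cite: Balaban1983Higgs3, (3.25) p.439] -/
def vc (j : Fin 2) : VLeg kindC := ⟨0, j⟩

/-- the φ′-leg `j` of (3.25)₄ (`j = 0`: the differentiated leg, `j = 1`: `·q²φ′(b₋)`). [cite: Balaban1983Higgs3, (3.25) p.439] -/
def sd (j : Fin 2) : SLeg kindD := ⟨0, j⟩

/-- the A′-leg `j` of (3.25)₄. [cite: Balaban1983Higgs3, (3.25) p.439] -/
def vd (j : Fin 2) : VLeg kindD := ⟨0, j⟩

/-- every φ′-leg of (3.25)₃ is `sc 0` or `sc 1`. [cite: Balaban1983Higgs3, (3.25) p.439] -/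
theorem sc_cases : ∀ ℓ : SLeg kindC, ℓ = sc 0 ∨ ℓ = sc 1 := by decide

/-- every A′-leg of (3.25)₃ is `vc 0` or `vc 1`. [cite: Balaban1983Higgs3, (3.25) p.439] -/
theorem vc_cases : ∀ ℓ : VLeg kindC, ℓ = vc 0 ∨ ℓ = vc 1 := by decide

/-- every φ′-leg of (3.25)₄ is `sd 0` or `sd 1`. [cite: Balaban1983Higgs3, (3.25) p.439] -/
theorem sd_cases : ∀ ℓ : SLeg kindD, ℓ = sd 0 ∨ ℓ = sd 1 := by decide

/-- every A′-leg of (3.25)₄ is `vd 0` or `vd 1`. [cite: Balaban1983Higgs3, (3.25) p.439] -/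
theorem vd_cases : ∀ ℓ : VLeg kindD, ℓ = vd 0 ∨ ℓ = vd 1 := by decide

/-- `sc 1 ≠ sc 0`, `vc 1 ≠ vc 0`, `sd 1 ≠ sd 0`, `vd 1 ≠ vd 0`. [cite: Balaban1983Higgs3, (3.25) p.439] -/
theorem legsCD_ne : sc 1 ≠ sc 0 ∧ vc 1 ≠ vc 0 ∧ sd 1 ≠ sd 0 ∧ vd 1 ≠ vd 0 := by decide

variable {hn2 : 2 ≤ nbar}

/-- The vertex of (3.25)₃. [cite: Balaban1983Higgs3, (3.25) p.439] -/
def vxc (nbar : ℕ) (hn2 : 2 ≤ nbar) : Fin (g325c nbar hn2).nV := ⟨0, Nat.one_pos⟩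

/-- The vertex of (3.25)₄. [cite: Balaban1983Higgs3, (3.25) p.439] -/
def vxd (nbar : ℕ) (hn2 : 2 ≤ nbar) : Fin (g325d nbar hn2).nV := ⟨0, Nat.one_pos⟩

/-- **The φ′-loop of (3.25)₃**: the partner of `sc j` is `sc (1−j)` (p18's `g325c.other`). [cite: Balaban1983Higgs3, (3.25) p.439] -/
theorem sotherC (j : Fin 2) : (sPairing (g325c nbar hn2)).other (sc j) = some (sc j.rev) := by
  show spartner (g325c nbar hn2) (sc j) = some (sc j.rev)
  refine (spartner_eq_some_iff _ _ _).2 ?_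
  fin_cases j <;> rfl

/-- the A′-legs of (3.25)₃ are external. [cite: Balaban1983Higgs3, (3.25) p.439] -/
theorem votherC (j : Fin 2) : (vPairing (g325c nbar hn2)).other (vc j) = none := by
  show vpartner (g325c nbar hn2) (vc j) = none
  refine (vpartner_eq_none_iff _ _).2 ?_
  fin_cases j <;> rfl

/-- **The φ′-loop of (3.25)₄**: the partner of `sd j` is `sd (1−j)` (p18's `g325d.other`). [cite: Balaban1983Higgs3, (3.25) p.439] -/
theorem sotherD (j : Fin 2) : (sPairing (g325d nbar hn2)).other (sd j) = some (sd j.rev) := by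
  show spartner (g325d nbar hn2) (sd j) = some (sd j.rev)
  refine (spartner_eq_some_iff _ _ _).2 ?_
  fin_cases j <;> rfl

/-- the A′-legs of (3.25)₄ are external. [cite: Balaban1983Higgs3, (3.25) p.439] -/
theorem votherD (j : Fin 2) : (vPairing (g325d nbar hn2)).other (vd j) = none := by
  show vpartner (g325d nbar hn2) (vd j) = none
  refine (vpartner_eq_none_iff _ _).2 ?_
  fin_cases j <;> rfl

/-- `sc 0` is the lower endpoint of the φ′-loop of (3.25)₃ and the only one. [cite: Balaban1983Higgs3, (3.25) p.439] -/
theorem slowerC_iff : ∀ ℓ : SLeg (g325c nbar hn2).kind, (sPairing (g325c nbar hn2)).isLower sRank ℓ = true ↔ ℓ = sc 0 := by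
  show ∀ ℓ : SLeg (g325c 2 le_rfl).kind, (sPairing (g325c 2 le_rfl)).isLower sRank ℓ = true ↔ ℓ = sc 0
  decide

/-- `sd 0` is the lower endpoint of the φ′-loop of (3.25)₄ and the only one. [cite: Balaban1983Higgs3, (3.25) p.439] -/
theorem slowerD_iff : ∀ ℓ : SLeg (g325d nbar hn2).kind, (sPairing (g325d nbar hn2)).isLower sRank ℓ = true ↔ ℓ = sd 0 := by
  show ∀ ℓ : SLeg (g325d 2 le_rfl).kind, (sPairing (g325d 2 le_rfl)).isLower sRank ℓ = true ↔ ℓ = sd 0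
  decide

/-- The φ′-loop of (3.25)₃ as a line (lower endpoint `sc 0`, mate `sc 1`). [cite: Balaban1983Higgs3, (3.25) p.439] -/
def lineC (nbar : ℕ) (hn2 : 2 ≤ nbar) : SLine (g325c nbar hn2) := ⟨sc 0, (slowerC_iff _).2 rfl⟩

/-- The φ′-loop of (3.25)₄ as a line (lower endpoint `sd 0`, mate `sd 1`). [cite: Balaban1983Higgs3, (3.25) p.439] -/
def lineD (nbar : ℕ) (hn2 : 2 ≤ nbar) : SLine (g325d nbar hn2) := ⟨sd 0, (slowerD_iff _).2 rfl⟩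

/-- the φ′-loop is the only scalar line of (3.25)₃. [cite: Balaban1983Higgs3, (3.25) p.439] -/
instance uniqueSLineC : Unique (SLine (g325c nbar hn2)) where
  default := lineC nbar hn2
  uniq := fun l => Subtype.ext ((slowerC_iff l.1).1 l.2)

/-- the φ′-loop is the only scalar line of (3.25)₄. [cite: Balaban1983Higgs3, (3.25) p.439] -/
instance uniqueSLineD : Unique (SLine (g325d nbar hn2)) where
  default := lineD nbar hn2
  uniq := fun l => Subtype.ext ((slowerD_iff l.1).1 l.2)

/-- the mates: `sc 0 ↦ sc 1`, `sd 0 ↦ sd 1`. [cite: Balaban1983Higgs3, (3.25) p.439] -/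
theorem smateCD : (sPairing (g325c nbar hn2)).mate (sc 0) = sc 1 ∧ (sPairing (g325d nbar hn2)).mate (sd 0) = sd 1 :=
  ⟨(sPairing (g325c nbar hn2)).mate_eq (sotherC 0), (sPairing (g325d nbar hn2)).mate_eq (sotherD 0)⟩

/-- (3.25)₃ has no internal A′-line. [cite: Balaban1983Higgs3, (3.25) p.439] -/
instance instIsEmptyVLineC : IsEmpty (VLine (g325c nbar hn2)) :=
  ⟨fun l => by
    have h := l.2
    rcases vc_cases l.1 with e | e <;> rw [e, (vPairing (g325c nbar hn2)).not_isLower_of_none vRank (votherC _)] at h <;> exact Bool.false_ne_true h⟩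

/-- (3.25)₄ has no internal A′-line. [cite: Balaban1983Higgs3, (3.25) p.439] -/
instance instIsEmptyVLineD : IsEmpty (VLine (g325d nbar hn2)) :=
  ⟨fun l => by
    have h := l.2
    rcases vd_cases l.1 with e | e <;> rw [e, (vPairing (g325d nbar hn2)).not_isLower_of_none vRank (votherD _)] at h <;> exact Bool.false_ne_true h⟩

/-- (3.25)₃ has no external φ′-leg. [cite: Balaban1983Higgs3, (3.25) p.439] -/
instance instIsEmptyExtSLegC : IsEmpty (ExtSLeg (g325c nbar hn2)) :=
  ⟨fun l => by
    have h := l.2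
    rcases sc_cases l.1 with e | e <;> rw [e, sotherC] at h <;> cases h⟩

/-- (3.25)₄ has no external φ′-leg. [cite: Balaban1983Higgs3, (3.25) p.439] -/
instance instIsEmptyExtSLegD : IsEmpty (ExtSLeg (g325d nbar hn2)) :=
  ⟨fun l => by
    have h := l.2
    rcases sd_cases l.1 with e | e <;> rw [e, sotherD] at h <;> cases h⟩

/-- no averaging output. [cite: Balaban1983Higgs3, (3.25) p.439] -/
instance instIsEmptyOLegC : IsEmpty (OLeg kindC) := ⟨fun ℓ => Fin.elim0 (ℓ.2 : Fin 0)⟩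

/-- no averaging output. [cite: Balaban1983Higgs3, (3.25) p.439] -/
instance instIsEmptyOLegD : IsEmpty (OLeg kindD) := ⟨fun ℓ => Fin.elim0 (ℓ.2 : Fin 0)⟩

/-- no averaging output. [cite: Balaban1983Higgs3, (3.25) p.439] -/
instance instIsEmptyOLegC' : IsEmpty (OLeg (g325c nbar hn2).kind) := ⟨fun ℓ => Fin.elim0 (ℓ.2 : Fin 0)⟩

/-- no averaging output. [cite: Balaban1983Higgs3, (3.25) p.439] -/
instance instIsEmptyOLegD' : IsEmpty (OLeg (g325d nbar hn2).kind) := ⟨fun ℓ => Fin.elim0 (ℓ.2 : Fin 0)⟩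

/-- The external A′-leg `j` of (3.25)₃. [cite: Balaban1983Higgs3, (3.25) p.439] -/
def evC (nbar : ℕ) (hn2 : 2 ≤ nbar) (j : Fin 2) : ExtVLeg (g325c nbar hn2) := ⟨vc j, votherC j⟩

/-- The external A′-leg `j` of (3.25)₄. [cite: Balaban1983Higgs3, (3.25) p.439] -/
def evD (nbar : ℕ) (hn2 : 2 ≤ nbar) (j : Fin 2) : ExtVLeg (g325d nbar hn2) := ⟨vd j, votherD j⟩

/-- `evC 0 ≠ evC 1`. [cite: Balaban1983Higgs3, (3.25) p.439] -/
theorem evC0_ne_evC1 : evC nbar hn2 0 ≠ evC nbar hn2 1 := fun h => absurd (congrArg Subtype.val h).symm legsCD_ne.2.1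

/-- `evD 0 ≠ evD 1`. [cite: Balaban1983Higgs3, (3.25) p.439] -/
theorem evD0_ne_evD1 : evD nbar hn2 0 ≠ evD nbar hn2 1 := fun h => absurd (congrArg Subtype.val h).symm legsCD_ne.2.2.2

/-- the external A′-legs of (3.25)₃ are exactly `evC 0`, `evC 1`. [cite: Balaban1983Higgs3, (3.25) p.439] -/
theorem univ_extVLegC : (univ : Finset (ExtVLeg (g325c nbar hn2))) = {evC nbar hn2 0, evC nbar hn2 1} := by
  ext l
  simp only [Finset.mem_univ, Finset.mem_insert, Finset.mem_singleton, true_iff]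
  rcases vc_cases l.1 with h | h
  · left; exact Subtype.ext h
  · right; exact Subtype.ext h

/-- the external A′-legs of (3.25)₄ are exactly `evD 0`, `evD 1`. [cite: Balaban1983Higgs3, (3.25) p.439] -/
theorem univ_extVLegD : (univ : Finset (ExtVLeg (g325d nbar hn2))) = {evD nbar hn2 0, evD nbar hn2 1} := by
  ext l
  simp only [Finset.mem_univ, Finset.mem_insert, Finset.mem_singleton, true_iff]
  rcases vd_cases l.1 with h | h
  · left; exact Subtype.ext h
  · right; exact Subtype.ext h

variable {P : HiggsLattice.Params} {N k : ℕ}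

/-- kernel: the conjunction delta is the product of the two deltas. [folklore] -/
private theorem ite_and_one (a b : Prop) [Decidable a] [Decidable b] :
    (if a ∧ b then (1 : ℝ) else 0) = (if a then (1 : ℝ) else 0) * (if b then (1 : ℝ) else 0) := by
  by_cases ha : a <;> by_cases hb : b <;> simp [ha, hb]

/-- The polarized A′-legs of a vertex with TWO vector legs on basis bond fields: `[b = β₀][b = β₁]·g(b₋)²`. [cite: Balaban1983Higgs3, (1.8) p.413] -/
theorem vlegs_two_basisV [DecidableEq (HiggsLattice.PBond P 0)] (g : HiggsLattice.Site P 0 → ℝ) (a : Fin 2 → HiggsLattice.VecField P 0)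
    (β₀ β₁ : HiggsLattice.PBond P 0) (h0 : a 0 = basisV β₀) (h1 : a 1 = basisV β₁) (b : HiggsLattice.PBond P 0) :
    vlegs g a b = (if b = β₀ ∧ b = β₁ then (1 : ℝ) else 0) * g b.src ^ 2 := by
  unfold vlegs
  rw [Fin.prod_univ_two, h0, h1, ite_and_one]
  unfold basisV
  ring

/-- The φ′-leg index assignment of a one-vertex picture with the values `p` on the leg 0 and `r` on the leg 1 ((3.25)₃).
[cite: Balaban1983Higgs3, (3.25) p.439] -/
def cAssign {X : Type*} (p r : X) : SLeg kindC → X := fun ℓ => if ℓ = sc 0 then p else r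

/-- the same for (3.25)₄. [cite: Balaban1983Higgs3, (3.25) p.439] -/
def dAssign {X : Type*} (p r : X) : SLeg kindD → X := fun ℓ => if ℓ = sd 0 then p else r

/-- values of `cAssign`, `dAssign`. [cite: Balaban1983Higgs3, (3.25) p.439] -/
theorem cdAssign_apply {X : Type*} (p r : X) :
    cAssign p r (sc 0) = p ∧ cAssign p r (sc 1) = r ∧ dAssign p r (sd 0) = p ∧ dAssign p r (sd 1) = r := by
  obtain ⟨h1, -, h3, -⟩ := legsCD_ne
  simp [cAssign, dAssign, h1, h3]

/-- the φ′-leg assignments of (3.25)₃ ↔ pairs of values. [cite: Balaban1983Higgs3, (3.25) p.439] -/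
def cEquiv (X : Type*) : X × X ≃ (SLeg kindC → X) where
  toFun q := cAssign q.1 q.2
  invFun α := (α (sc 0), α (sc 1))
  left_inv q := by
    obtain ⟨p, r⟩ := q
    obtain ⟨e1, e2, -, -⟩ := cdAssign_apply p r
    simp only [e1, e2]
  right_inv α := by
    funext ℓ
    obtain ⟨e1, e2, -, -⟩ := cdAssign_apply (α (sc 0)) (α (sc 1))
    rcases sc_cases ℓ with h | h <;> rw [h]
    · exact e1
    · exact e2

/-- the φ′-leg assignments of (3.25)₄ ↔ pairs of values. [cite: Balaban1983Higgs3, (3.25) p.439] -/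
def dEquiv (X : Type*) : X × X ≃ (SLeg kindD → X) where
  toFun q := dAssign q.1 q.2
  invFun α := (α (sd 0), α (sd 1))
  left_inv q := by
    obtain ⟨p, r⟩ := q
    obtain ⟨-, -, e1, e2⟩ := cdAssign_apply p r
    simp only [e1, e2]
  right_inv α := by
    funext ℓ
    obtain ⟨-, -, e1, e2⟩ := cdAssign_apply (α (sd 0)) (α (sd 1))
    rcases sd_cases ℓ with h | h <;> rw [h]
    · exact e1
    · exact e2

/-- **The sum over the φ′-leg assignments of (3.25)₃ with the two site deltas of (1.10)**: both legs sit at `x`, their internal indices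
`a`, `a′` free. [cite: Balaban1983Higgs3, (3.25) p.439] -/
theorem alpha_sumC {S : Type*} [Fintype S] [DecidableEq S] (x : S) (F : S × Fin N → S × Fin N → ℝ) :
    ∑ α : SLeg kindC → S × Fin N, (if x = (α (sc 0)).1 ∧ x = (α (sc 1)).1 then (1 : ℝ) else 0) * F (α (sc 0)) (α (sc 1)) =
      ∑ a : Fin N, ∑ a' : Fin N, F (x, a) (x, a') := by
  rw [← Fintype.sum_equiv (cEquiv (S × Fin N)) (fun q => (if x = (cEquiv (S × Fin N) q (sc 0)).1 ∧ x = (cEquiv (S × Fin N) q (sc 1)).1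
      then (1 : ℝ) else 0) * F (cEquiv (S × Fin N) q (sc 0)) (cEquiv (S × Fin N) q (sc 1))) _ fun _ => rfl, Fintype.sum_prod_type]
  have happ : ∀ p r : S × Fin N, cEquiv (S × Fin N) (p, r) (sc 0) = p ∧ cEquiv (S × Fin N) (p, r) (sc 1) = r :=
    fun p r => ⟨(cdAssign_apply p r).1, (cdAssign_apply p r).2.1⟩
  simp only [happ, ite_and_one, mul_assoc]
  have h1 : ∀ p : S × Fin N, ∑ r : S × Fin N, (if x = p.1 then (1 : ℝ) else 0) * ((if x = r.1 then (1 : ℝ) else 0) * F p r) =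
      (if x = p.1 then (1 : ℝ) else 0) * ∑ a' : Fin N, F p (x, a') := by
    intro p
    rw [← Finset.mul_sum, sum_delta_fst]
  simp only [h1]
  rw [sum_delta_fst]

/-- **The sum over the φ′-leg assignments of (3.25)₄ with the site delta of the undifferentiated leg of (1.8)**: the differentiated leg
runs over all indices `p`, the other leg sits at `x` with free internal index `c`. [cite: Balaban1983Higgs3, (3.25) p.439] -/
theorem alpha_sumD {S : Type*} [Fintype S] [DecidableEq S] (x : S) (F : S × Fin N → S × Fin N → ℝ) :
    ∑ α : SLeg kindD → S × Fin N, (if x = (α (sd 1)).1 then (1 : ℝ) else 0) * F (α (sd 0)) (α (sd 1)) =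
      ∑ p : S × Fin N, ∑ c : Fin N, F p (x, c) := by
  rw [← Fintype.sum_equiv (dEquiv (S × Fin N)) (fun q => (if x = (dEquiv (S × Fin N) q (sd 1)).1 then (1 : ℝ) else 0) *
      F (dEquiv (S × Fin N) q (sd 0)) (dEquiv (S × Fin N) q (sd 1))) _ fun _ => rfl, Fintype.sum_prod_type]
  have happ : ∀ p r : S × Fin N, dEquiv (S × Fin N) (p, r) (sd 0) = p ∧ dEquiv (S × Fin N) (p, r) (sd 1) = r :=
    fun p r => ⟨(cdAssign_apply p r).2.2.1, (cdAssign_apply p r).2.2.2⟩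
  simp only [happ]
  exact Finset.sum_congr rfl fun p _ => sum_delta_fst x (F p)

/-- **The Kronecker sum over the A′-leg assignments of a one-vertex picture with two A′-legs**: both legs at the bond `b`.
[cite: Balaban1983Higgs3, (3.25) p.439] -/
theorem beta_sumC {Y : Type*} [Fintype Y] [DecidableEq Y] (b : Y) (F : (VLeg kindC → Y) → ℝ) :
    ∑ β : VLeg kindC → Y, (if b = β (vc 0) ∧ b = β (vc 1) then (1 : ℝ) else 0) * F β = F (fun _ => b) := by
  rw [Finset.sum_eq_single (fun _ => b)]
  · simp
  · intro β _ hβ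
    have : ¬(b = β (vc 0) ∧ b = β (vc 1)) := by
      rintro ⟨h0, h1⟩
      apply hβ
      funext ℓ
      rcases vc_cases ℓ with h | h <;> rw [h]
      · exact h0.symm
      · exact h1.symm
    rw [if_neg this, zero_mul]
  · intro h
    exact absurd (Finset.mem_univ _) h

/-- the same for (3.25)₄. [cite: Balaban1983Higgs3, (3.25) p.439] -/
theorem beta_sumD {Y : Type*} [Fintype Y] [DecidableEq Y] (b : Y) (F : (VLeg kindD → Y) → ℝ) :
    ∑ β : VLeg kindD → Y, (if b = β (vd 0) ∧ b = β (vd 1) then (1 : ℝ) else 0) * F β = F (fun _ => b) := by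
  rw [Finset.sum_eq_single (fun _ => b)]
  · simp
  · intro β _ hβ
    have : ¬(b = β (vd 0) ∧ b = β (vd 1)) := by
      rintro ⟨h0, h1⟩
      apply hβ
      funext ℓ
      rcases vd_cases ℓ with h | h <;> rw [h]
      · exact h0.symm
      · exact h1.symm
    rw [if_neg this, zero_mul]
  · intro h
    exact absurd (Finset.mem_univ _) h

/-- The product external vector field of (3.25)₃: `A` on the A′-leg 0, `A′` on the A′-leg 1 (ONE of the two ways of attaching the two
external fields to the two legs of the vertex; the other is `pairVC A′ A`). [cite: Balaban1983Higgs3, (3.26) p.440] -/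
def pairVC (A A' : HiggsLattice.VecField P 0) : ExtVLeg (g325c nbar hn2) → HiggsLattice.VecField P 0 :=
  fun ℓ => if ℓ = evC nbar hn2 0 then A else A'

/-- The product external vector field of (3.25)₄ (`A` on leg 0, `A′` on leg 1). [cite: Balaban1983Higgs3, (3.26) p.440] -/
def pairVD (A A' : HiggsLattice.VecField P 0) : ExtVLeg (g325d nbar hn2) → HiggsLattice.VecField P 0 :=
  fun ℓ => if ℓ = evD nbar hn2 0 then A else A'

/-- `prodExtV (pairVC A A′)` with both legs at `b`: `A(b)A′(b)`. [cite: Balaban1983Higgs3, (3.26) p.440] -/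
theorem prodExtV_pairVC (A A' : HiggsLattice.VecField P 0) (b : HiggsLattice.PBond P 0) :
    prodExtV (pairVC (hn2 := hn2) A A') (fun _ : ExtVLeg (g325c nbar hn2) => b) = A b * A' b := by
  unfold prodExtV
  have e : pairVC (hn2 := hn2) A A' (evC nbar hn2 0) = A ∧ pairVC (hn2 := hn2) A A' (evC nbar hn2 1) = A' := by
    simp [pairVC, (evC0_ne_evC1 (hn2 := hn2)).symm]
  rw [show (∏ ℓ : ExtVLeg (g325c nbar hn2), pairVC A A' ℓ b) = ∏ ℓ ∈ ({evC nbar hn2 0, evC nbar hn2 1} : Finset (ExtVLeg (g325c nbar hn2))),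
      pairVC A A' ℓ b by rw [← univ_extVLegC], Finset.prod_pair evC0_ne_evC1, e.1, e.2]

/-- `prodExtV (pairVD A A′)` with both legs at `b`: `A(b)A′(b)`. [cite: Balaban1983Higgs3, (3.26) p.440] -/
theorem prodExtV_pairVD (A A' : HiggsLattice.VecField P 0) (b : HiggsLattice.PBond P 0) :
    prodExtV (pairVD (hn2 := hn2) A A') (fun _ : ExtVLeg (g325d nbar hn2) => b) = A b * A' b := by
  unfold prodExtV
  have e : pairVD (hn2 := hn2) A A' (evD nbar hn2 0) = A ∧ pairVD (hn2 := hn2) A A' (evD nbar hn2 1) = A' := by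
    simp [pairVD, (evD0_ne_evD1 (hn2 := hn2)).symm]
  rw [show (∏ ℓ : ExtVLeg (g325d nbar hn2), pairVD A A' ℓ b) = ∏ ℓ ∈ ({evD nbar hn2 0, evD nbar hn2 1} : Finset (ExtVLeg (g325d nbar hn2))),
      pairVD A A' ℓ b by rw [← univ_extVLegD], Finset.prod_pair evD0_ne_evD1, e.1, e.2]

/-- `Σ_a e_a·q²e_a = tr q²` for the operator square `q^2` of (1.10). [cite: Balaban1983Higgs3, (3.26) p.440] -/
theorem sum_opCoeff_sq_diag (C : ChargeData N) : ∑ a : Fin N, opCoeff (C.q ^ 2) a a = trq2 C := by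
  unfold opCoeff trq2
  refine Finset.sum_congr rfl fun a _ => ?_
  rw [sq]
  rfl

/-- `Σ_c (q²e_c)_c = tr q²`. [cite: Balaban1983Higgs3, (3.26) p.440] -/
theorem sum_sq_single_apply (C : ChargeData N) : ∑ c : Fin N, ((C.q ^ 2) (EuclideanSpace.single c (1 : ℝ))) c = trq2 C := by
  unfold trq2
  refine Finset.sum_congr rfl fun c _ => ?_
  rw [sq, EuclideanSpace.inner_single_left, map_one, one_mul]
  rfl

variable [DecidableEq (HiggsLattice.PBond P 0)]

/-- The evaluator on (3.25)₃ with `kindC`-typed index assignments — FILE 1's `amp` unfolded. [cite: Balaban1983Higgs3, p.420] -/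
theorem graphAmp_eqC (M : Model P N k) (dm2 : Fin (g325c nbar hn2).nV → HiggsLattice.Site P 0 → ℝ)
    (loc : Fin (g325c nbar hn2).nV → Loc P k) (Po : OutPairing (g325c nbar hn2))
    (Ks : SLine (g325c nbar hn2) → HiggsLattice.Site P 0 × Fin N → HiggsLattice.Site P 0 × Fin N → ℝ)
    (Kv : VLine (g325c nbar hn2) → HiggsLattice.PBond P 0 → HiggsLattice.PBond P 0 → ℝ)
    (Ko : Po.Line oRank → HiggsLattice.Site P k × Fin N → HiggsLattice.Site P k × Fin N → ℝ)
    (Φ : (ExtSLeg (g325c nbar hn2) → HiggsLattice.Site P 0 × Fin N) → ℝ) (A : (ExtVLeg (g325c nbar hn2) → HiggsLattice.PBond P 0) → ℝ)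
    (Ψ : (Po.Ext → HiggsLattice.Site P k × Fin N) → ℝ) :
    graphAmp (g325c nbar hn2) M dm2 loc Po Ks Kv Ko Φ A Ψ =
      ∑ α : SLeg kindC → HiggsLattice.Site P 0 × Fin N, ∑ β : VLeg kindC → HiggsLattice.PBond P 0,
        ∑ ο : OLeg kindC → HiggsLattice.Site P k × Fin N,
          vertexFactor (rulesOf (g325c nbar hn2) M dm2 loc) basisE basisV basisE α β ο *
            (Φ (fun ℓ => α ℓ.1) * A (fun ℓ => β ℓ.1) * Ψ (fun ℓ => ο ℓ.1)) *
            (sLineFactor Ks α * vLineFactor Kv β * oLineFactor Po Ko ο) := rfl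

/-- The evaluator on (3.25)₄ with `kindD`-typed index assignments. [cite: Balaban1983Higgs3, p.420] -/
theorem graphAmp_eqD (M : Model P N k) (dm2 : Fin (g325d nbar hn2).nV → HiggsLattice.Site P 0 → ℝ)
    (loc : Fin (g325d nbar hn2).nV → Loc P k) (Po : OutPairing (g325d nbar hn2))
    (Ks : SLine (g325d nbar hn2) → HiggsLattice.Site P 0 × Fin N → HiggsLattice.Site P 0 × Fin N → ℝ)
    (Kv : VLine (g325d nbar hn2) → HiggsLattice.PBond P 0 → HiggsLattice.PBond P 0 → ℝ)
    (Ko : Po.Line oRank → HiggsLattice.Site P k × Fin N → HiggsLattice.Site P k × Fin N → ℝ)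
    (Φ : (ExtSLeg (g325d nbar hn2) → HiggsLattice.Site P 0 × Fin N) → ℝ) (A : (ExtVLeg (g325d nbar hn2) → HiggsLattice.PBond P 0) → ℝ)
    (Ψ : (Po.Ext → HiggsLattice.Site P k × Fin N) → ℝ) :
    graphAmp (g325d nbar hn2) M dm2 loc Po Ks Kv Ko Φ A Ψ =
      ∑ α : SLeg kindD → HiggsLattice.Site P 0 × Fin N, ∑ β : VLeg kindD → HiggsLattice.PBond P 0,
        ∑ ο : OLeg kindD → HiggsLattice.Site P k × Fin N,
          vertexFactor (rulesOf (g325d nbar hn2) M dm2 loc) basisE basisV basisE α β ο *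
            (Φ (fun ℓ => α ℓ.1) * A (fun ℓ => β ℓ.1) * Ψ (fun ℓ => ο ℓ.1)) *
            (sLineFactor Ks α * vLineFactor Kv β * oLineFactor Po Ko ο) := rfl

/-- **The rule (1.10)_{2,0} on basis fields** (prefactor `e²η⁰/(2!0!) = e²/2`): `Σ_{b∈S} (e²/2)(w(b)η^d)·([b₋ = p.1][b₋ = r.1] e_{p.2}·q²e_{r.2})·
([b = β₀][b = β₁] g_k(b₋)²)`. [cite: Balaban1983Higgs3, (1.10) p.413] -/
theorem rule110_two_zero_basis (M : Model P N k) (w : HiggsLattice.PBond P 0 → ℝ)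
    (α : SLeg kindC → HiggsLattice.Site P 0 × Fin N) (β : VLeg kindC → HiggsLattice.PBond P 0) :
    rule110 M.C M.g M.At 2 0 M.S w (fun j => basisE (α (sc j))) (fun j => basisV (β (vc j))) =
      ∑ b ∈ M.S, (M.C.e ^ 2 / 2 * (w b * P.mesh 0 ^ P.d)) *
        (((if b.src = (α (sc 0)).1 ∧ b.src = (α (sc 1)).1 then (1 : ℝ) else 0) * opCoeff (M.C.q ^ 2) (α (sc 0)).2 (α (sc 1)).2) *
          ((if b = β (vc 0) ∧ b = β (vc 1) then (1 : ℝ) else 0) * M.g b.src ^ 2)) := by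
  unfold rule110
  have hv : ∀ b, vlegs M.g (fun j => basisV (β (vc j))) b = (if b = β (vc 0) ∧ b = β (vc 1) then (1 : ℝ) else 0) * M.g b.src ^ 2 :=
    fun b => vlegs_two_basisV M.g _ (β (vc 0)) (β (vc 1)) rfl rfl b
  simp only [pleg110_basisE, hv, pow_zero, mul_one, add_zero]
  rw [Finset.mul_sum]
  refine Finset.sum_congr rfl fun b _ => ?_
  simp only [Nat.cast_ofNat, Nat.factorial, Nat.cast_one, mul_one]
  norm_num
  ring

/-- **The rule (1.8)_{2,0} on basis fields** (prefactor `e²(−1)²η¹/(2!0!) = e²η/2`): `Σ_{b∈S} (e²η/2)(w(b)η^d)·([b₋ = r.1]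
(D^η_B̃δ_p)(b)·q²e_{r.2})·([b = β₀][b = β₁] g_k(b₋)²)`. [cite: Balaban1983Higgs3, (1.8) p.413] -/
theorem rule18_two_zero_basis (M : Model P N k) (w : HiggsLattice.PBond P 0 → ℝ)
    (α : SLeg kindD → HiggsLattice.Site P 0 × Fin N) (β : VLeg kindD → HiggsLattice.PBond P 0) :
    rule18 M.C M.g M.B M.At 2 0 M.S w (fun j => basisE (α (sd j))) (fun j => basisV (β (vd j))) =
      ∑ b ∈ M.S, (M.C.e ^ 2 * P.mesh 0 / 2 * (w b * P.mesh 0 ^ P.d)) *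
        (((if b.src = (α (sd 1)).1 then (1 : ℝ) else 0) *
            ⟪covDeriv M.C M.B (basisE (α (sd 0))) b, (M.C.q ^ 2) (EuclideanSpace.single (α (sd 1)).2 (1 : ℝ))⟫_ℝ) *
          ((if b = β (vd 0) ∧ b = β (vd 1) then (1 : ℝ) else 0) * M.g b.src ^ 2)) := by
  unfold rule18
  have hv : ∀ b, vlegs M.g (fun j => basisV (β (vd j))) b = (if b = β (vd 0) ∧ b = β (vd 1) then (1 : ℝ) else 0) * M.g b.src ^ 2 :=
    fun b => vlegs_two_basisV M.g _ (β (vd 0)) (β (vd 1)) rfl rfl b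
  simp only [pleg18_basisE, hv, pow_zero, mul_one, add_zero]
  rw [Finset.mul_sum]
  refine Finset.sum_congr rfl fun b _ => ?_
  simp only [Nat.cast_ofNat, Nat.factorial, Nat.cast_one, mul_one]
  norm_num
  ring

/-- **The evaluator EVALUATED on the picture (3.25)₃** (the vertex (1.10)_{2,0} `(e²/2!)Σ_b η^d[φ′(b₋)·q²φ′(b₋)](g_kA′_b)²` with its two
φ′-legs joined — the φ′-loop — and its two A′-legs external): `E = Φ(∅)Ψ(∅)·(e²/2) Σ_{b∈S} w(b) η^d g_k(b₋)² A(b,b) Σ_{a,a′}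
(e_a·q²e_{a′}) Ks((b₋,a),(b₋,a′))` — the loop *"replaced by the corresponding propagator"* at coinciding points, traced against `q²`.
[cite: Balaban1983Higgs3, (3.25) p.439] [cite: Balaban1983Higgs3, (1.10) p.413] [cite: Balaban1983Higgs3, p.414] -/
theorem graphAmp_g325c (M : Model P N k) (dm2 : Fin (g325c nbar hn2).nV → HiggsLattice.Site P 0 → ℝ)
    (loc : Fin (g325c nbar hn2).nV → Loc P k) (Po : OutPairing (g325c nbar hn2))
    (Ks : SLine (g325c nbar hn2) → HiggsLattice.Site P 0 × Fin N → HiggsLattice.Site P 0 × Fin N → ℝ)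
    (Kv : VLine (g325c nbar hn2) → HiggsLattice.PBond P 0 → HiggsLattice.PBond P 0 → ℝ)
    (Ko : Po.Line oRank → HiggsLattice.Site P k × Fin N → HiggsLattice.Site P k × Fin N → ℝ)
    (Φ : (ExtSLeg (g325c nbar hn2) → HiggsLattice.Site P 0 × Fin N) → ℝ) (A : (ExtVLeg (g325c nbar hn2) → HiggsLattice.PBond P 0) → ℝ)
    (Ψ : (Po.Ext → HiggsLattice.Site P k × Fin N) → ℝ) :
    graphAmp (g325c nbar hn2) M dm2 loc Po Ks Kv Ko Φ A Ψ =
      (Φ (fun ℓ => isEmptyElim ℓ) * Ψ (fun ℓ => isEmptyElim ℓ)) *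
        (M.C.e ^ 2 / 2 * ∑ b ∈ M.S, (loc (vxc nbar hn2)).wB b * (P.mesh 0 ^ P.d * M.g b.src ^ 2 * A (fun _ => b) *
          ∑ a : Fin N, ∑ a' : Fin N, opCoeff (M.C.q ^ 2) a a' * Ks (lineC nbar hn2) (b.src, a) (b.src, a'))) := by
  haveI : IsEmpty (Po.Line oRank) := ⟨fun l => IsEmpty.false l.1⟩
  haveI : IsEmpty Po.Ext := ⟨fun l => IsEmpty.false l.1⟩
  have hV : ∀ (α : SLeg kindC → HiggsLattice.Site P 0 × Fin N) (β : VLeg kindC → HiggsLattice.PBond P 0)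
      (ο : OLeg kindC → HiggsLattice.Site P k × Fin N),
      vertexFactor (rulesOf (g325c nbar hn2) M dm2 loc) basisE basisV basisE α β ο =
        rule110 M.C M.g M.At 2 0 M.S (loc (vxc nbar hn2)).wB (fun j => basisE (α (sc j))) (fun j => basisV (β (vc j))) := by
    intro α β ο
    unfold vertexFactor
    exact Fin.prod_univ_one _
  have hs : ∀ α : SLeg kindC → HiggsLattice.Site P 0 × Fin N, sLineFactor Ks α = Ks (lineC nbar hn2) (α (sc 0)) (α (sc 1)) := by
    intro α
    unfold sLineFactor
    rw [Fintype.prod_unique]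
    show Ks (lineC nbar hn2) (α (sc 0)) (α ((sPairing (g325c nbar hn2)).mate (sc 0))) = _
    rw [smateCD.1]
  have hv : ∀ β : VLeg kindC → HiggsLattice.PBond P 0, vLineFactor (G := g325c nbar hn2) Kv β = 1 := by
    intro β
    unfold vLineFactor
    exact Fintype.prod_empty _
  have ho : ∀ ο : OLeg kindC → HiggsLattice.Site P k × Fin N, oLineFactor Po Ko ο = 1 := by
    intro ο
    unfold oLineFactor
    exact Fintype.prod_empty _
  have hΦ : ∀ α : SLeg kindC → HiggsLattice.Site P 0 × Fin N, (fun ℓ : ExtSLeg (g325c nbar hn2) => α ℓ.1) = fun ℓ => isEmptyElim ℓ :=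
    fun α => funext fun ℓ => isEmptyElim ℓ
  have hΨ : ∀ ο : OLeg kindC → HiggsLattice.Site P k × Fin N, (fun ℓ : Po.Ext => ο ℓ.1) = fun ℓ => isEmptyElim ℓ :=
    fun ο => funext fun ℓ => isEmptyElim ℓ
  rw [graphAmp_eqC]
  simp only [Fintype.sum_unique, hV, hs, hv, ho, hΦ, hΨ, mul_one, rule110_two_zero_basis]
  -- bond sum outermost
  have h1 : ∀ (α : SLeg kindC → HiggsLattice.Site P 0 × Fin N) (β : VLeg kindC → HiggsLattice.PBond P 0),
      (∑ b ∈ M.S, (M.C.e ^ 2 / 2 * ((loc (vxc nbar hn2)).wB b * P.mesh 0 ^ P.d)) *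
          (((if b.src = (α (sc 0)).1 ∧ b.src = (α (sc 1)).1 then (1 : ℝ) else 0) * opCoeff (M.C.q ^ 2) (α (sc 0)).2 (α (sc 1)).2) *
            ((if b = β (vc 0) ∧ b = β (vc 1) then (1 : ℝ) else 0) * M.g b.src ^ 2))) *
          (Φ (fun ℓ => isEmptyElim ℓ) * A (fun ℓ => β ℓ.1) * Ψ (fun ℓ => isEmptyElim ℓ)) * Ks (lineC nbar hn2) (α (sc 0)) (α (sc 1)) =
        ∑ b ∈ M.S, (if b = β (vc 0) ∧ b = β (vc 1) then (1 : ℝ) else 0) *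
          (A (fun ℓ => β ℓ.1) * ((Φ (fun ℓ => isEmptyElim ℓ) * Ψ (fun ℓ => isEmptyElim ℓ)) *
            (M.C.e ^ 2 / 2 * ((loc (vxc nbar hn2)).wB b * (P.mesh 0 ^ P.d * M.g b.src ^ 2))) *
            ((if b.src = (α (sc 0)).1 ∧ b.src = (α (sc 1)).1 then (1 : ℝ) else 0) *
              (opCoeff (M.C.q ^ 2) (α (sc 0)).2 (α (sc 1)).2 * Ks (lineC nbar hn2) (α (sc 0)) (α (sc 1)))))) := by
    intro α β
    rw [Finset.sum_mul, Finset.sum_mul]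
    exact Finset.sum_congr rfl fun b _ => by ring
  rw [Finset.sum_congr rfl fun α _ => Finset.sum_congr rfl fun β _ => h1 α β]
  have h2 : ∀ α : SLeg kindC → HiggsLattice.Site P 0 × Fin N,
      ∑ β : VLeg kindC → HiggsLattice.PBond P 0, ∑ b ∈ M.S, (if b = β (vc 0) ∧ b = β (vc 1) then (1 : ℝ) else 0) *
          (A (fun ℓ => β ℓ.1) * ((Φ (fun ℓ => isEmptyElim ℓ) * Ψ (fun ℓ => isEmptyElim ℓ)) *
            (M.C.e ^ 2 / 2 * ((loc (vxc nbar hn2)).wB b * (P.mesh 0 ^ P.d * M.g b.src ^ 2))) *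
            ((if b.src = (α (sc 0)).1 ∧ b.src = (α (sc 1)).1 then (1 : ℝ) else 0) *
              (opCoeff (M.C.q ^ 2) (α (sc 0)).2 (α (sc 1)).2 * Ks (lineC nbar hn2) (α (sc 0)) (α (sc 1)))))) =
        ∑ b ∈ M.S, A (fun _ => b) * ((Φ (fun ℓ => isEmptyElim ℓ) * Ψ (fun ℓ => isEmptyElim ℓ)) *
            (M.C.e ^ 2 / 2 * ((loc (vxc nbar hn2)).wB b * (P.mesh 0 ^ P.d * M.g b.src ^ 2))) *
            ((if b.src = (α (sc 0)).1 ∧ b.src = (α (sc 1)).1 then (1 : ℝ) else 0) *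
              (opCoeff (M.C.q ^ 2) (α (sc 0)).2 (α (sc 1)).2 * Ks (lineC nbar hn2) (α (sc 0)) (α (sc 1))))) := by
    intro α
    rw [Finset.sum_comm]
    refine Finset.sum_congr rfl fun b _ => ?_
    rw [beta_sumC b fun β => A (fun ℓ => β ℓ.1) * ((Φ (fun ℓ => isEmptyElim ℓ) * Ψ (fun ℓ => isEmptyElim ℓ)) *
            (M.C.e ^ 2 / 2 * ((loc (vxc nbar hn2)).wB b * (P.mesh 0 ^ P.d * M.g b.src ^ 2))) *
            ((if b.src = (α (sc 0)).1 ∧ b.src = (α (sc 1)).1 then (1 : ℝ) else 0) *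
              (opCoeff (M.C.q ^ 2) (α (sc 0)).2 (α (sc 1)).2 * Ks (lineC nbar hn2) (α (sc 0)) (α (sc 1)))))]
  rw [Finset.sum_congr rfl fun α _ => h2 α, Finset.sum_comm, Finset.mul_sum, Finset.mul_sum]
  refine Finset.sum_congr rfl fun b _ => ?_
  have h3 : ∀ α : SLeg kindC → HiggsLattice.Site P 0 × Fin N,
      A (fun _ : ExtVLeg (g325c nbar hn2) => b) * ((Φ (fun ℓ => isEmptyElim ℓ) * Ψ (fun ℓ => isEmptyElim ℓ)) *
            (M.C.e ^ 2 / 2 * ((loc (vxc nbar hn2)).wB b * (P.mesh 0 ^ P.d * M.g b.src ^ 2))) *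
            ((if b.src = (α (sc 0)).1 ∧ b.src = (α (sc 1)).1 then (1 : ℝ) else 0) *
              (opCoeff (M.C.q ^ 2) (α (sc 0)).2 (α (sc 1)).2 * Ks (lineC nbar hn2) (α (sc 0)) (α (sc 1))))) =
        (A (fun _ : ExtVLeg (g325c nbar hn2) => b) * (Φ (fun ℓ => isEmptyElim ℓ) * Ψ (fun ℓ => isEmptyElim ℓ)) *
            (M.C.e ^ 2 / 2 * ((loc (vxc nbar hn2)).wB b * (P.mesh 0 ^ P.d * M.g b.src ^ 2)))) *
          ((if b.src = (α (sc 0)).1 ∧ b.src = (α (sc 1)).1 then (1 : ℝ) else 0) *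
            (opCoeff (M.C.q ^ 2) (α (sc 0)).2 (α (sc 1)).2 * Ks (lineC nbar hn2) (α (sc 0)) (α (sc 1)))) := by
    intro α
    ring
  rw [Finset.sum_congr rfl fun α _ => h3 α, ← Finset.mul_sum,
    alpha_sumC b.src fun p r => opCoeff (M.C.q ^ 2) p.2 r.2 * Ks (lineC nbar hn2) p r]
  ring

/-- **The evaluator EVALUATED on the picture (3.25)₄** (the vertex (1.8)_{2,0} `(e²η/2!)Σ_b η^d[(D^η_B̃φ′)(b)·q²φ′(b₋)](g_kA′_b)²` with its
two φ′-legs joined and its two A′-legs external): `E = Φ(∅)Ψ(∅)·(e²η/2) Σ_{b∈S} w(b) η^d g_k(b₋)² A(b,b) Σ_c dK1(Ks)(b, q²e_c; (b₋,c))` —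
the loop differentiated at one end. [cite: Balaban1983Higgs3, (3.25) p.439] [cite: Balaban1983Higgs3, (1.8) p.413] [cite: Balaban1983Higgs3, p.414] -/
theorem graphAmp_g325d (M : Model P N k) (dm2 : Fin (g325d nbar hn2).nV → HiggsLattice.Site P 0 → ℝ)
    (loc : Fin (g325d nbar hn2).nV → Loc P k) (Po : OutPairing (g325d nbar hn2))
    (Ks : SLine (g325d nbar hn2) → HiggsLattice.Site P 0 × Fin N → HiggsLattice.Site P 0 × Fin N → ℝ)
    (Kv : VLine (g325d nbar hn2) → HiggsLattice.PBond P 0 → HiggsLattice.PBond P 0 → ℝ)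
    (Ko : Po.Line oRank → HiggsLattice.Site P k × Fin N → HiggsLattice.Site P k × Fin N → ℝ)
    (Φ : (ExtSLeg (g325d nbar hn2) → HiggsLattice.Site P 0 × Fin N) → ℝ) (A : (ExtVLeg (g325d nbar hn2) → HiggsLattice.PBond P 0) → ℝ)
    (Ψ : (Po.Ext → HiggsLattice.Site P k × Fin N) → ℝ) :
    graphAmp (g325d nbar hn2) M dm2 loc Po Ks Kv Ko Φ A Ψ =
      (Φ (fun ℓ => isEmptyElim ℓ) * Ψ (fun ℓ => isEmptyElim ℓ)) *
        (M.C.e ^ 2 * P.mesh 0 / 2 * ∑ b ∈ M.S, (loc (vxd nbar hn2)).wB b * (P.mesh 0 ^ P.d * M.g b.src ^ 2 * A (fun _ => b) *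
          ∑ c : Fin N, dK1 M.C M.B (Ks (lineD nbar hn2)) b ((M.C.q ^ 2) (EuclideanSpace.single c (1 : ℝ))) (b.src, c))) := by
  haveI : IsEmpty (Po.Line oRank) := ⟨fun l => IsEmpty.false l.1⟩
  haveI : IsEmpty Po.Ext := ⟨fun l => IsEmpty.false l.1⟩
  have hV : ∀ (α : SLeg kindD → HiggsLattice.Site P 0 × Fin N) (β : VLeg kindD → HiggsLattice.PBond P 0)
      (ο : OLeg kindD → HiggsLattice.Site P k × Fin N),
      vertexFactor (rulesOf (g325d nbar hn2) M dm2 loc) basisE basisV basisE α β ο =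
        rule18 M.C M.g M.B M.At 2 0 M.S (loc (vxd nbar hn2)).wB (fun j => basisE (α (sd j))) (fun j => basisV (β (vd j))) := by
    intro α β ο
    unfold vertexFactor
    exact Fin.prod_univ_one _
  have hs : ∀ α : SLeg kindD → HiggsLattice.Site P 0 × Fin N, sLineFactor Ks α = Ks (lineD nbar hn2) (α (sd 0)) (α (sd 1)) := by
    intro α
    unfold sLineFactor
    rw [Fintype.prod_unique]
    show Ks (lineD nbar hn2) (α (sd 0)) (α ((sPairing (g325d nbar hn2)).mate (sd 0))) = _
    rw [smateCD.2]
  have hv : ∀ β : VLeg kindD → HiggsLattice.PBond P 0, vLineFactor (G := g325d nbar hn2) Kv β = 1 := by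
    intro β
    unfold vLineFactor
    exact Fintype.prod_empty _
  have ho : ∀ ο : OLeg kindD → HiggsLattice.Site P k × Fin N, oLineFactor Po Ko ο = 1 := by
    intro ο
    unfold oLineFactor
    exact Fintype.prod_empty _
  have hΦ : ∀ α : SLeg kindD → HiggsLattice.Site P 0 × Fin N, (fun ℓ : ExtSLeg (g325d nbar hn2) => α ℓ.1) = fun ℓ => isEmptyElim ℓ :=
    fun α => funext fun ℓ => isEmptyElim ℓ
  have hΨ : ∀ ο : OLeg kindD → HiggsLattice.Site P k × Fin N, (fun ℓ : Po.Ext => ο ℓ.1) = fun ℓ => isEmptyElim ℓ :=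
    fun ο => funext fun ℓ => isEmptyElim ℓ
  rw [graphAmp_eqD]
  simp only [Fintype.sum_unique, hV, hs, hv, ho, hΦ, hΨ, mul_one, rule18_two_zero_basis]
  have h1 : ∀ (α : SLeg kindD → HiggsLattice.Site P 0 × Fin N) (β : VLeg kindD → HiggsLattice.PBond P 0),
      (∑ b ∈ M.S, (M.C.e ^ 2 * P.mesh 0 / 2 * ((loc (vxd nbar hn2)).wB b * P.mesh 0 ^ P.d)) *
          (((if b.src = (α (sd 1)).1 then (1 : ℝ) else 0) *
              ⟪covDeriv M.C M.B (basisE (α (sd 0))) b, (M.C.q ^ 2) (EuclideanSpace.single (α (sd 1)).2 (1 : ℝ))⟫_ℝ) *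
            ((if b = β (vd 0) ∧ b = β (vd 1) then (1 : ℝ) else 0) * M.g b.src ^ 2))) *
          (Φ (fun ℓ => isEmptyElim ℓ) * A (fun ℓ => β ℓ.1) * Ψ (fun ℓ => isEmptyElim ℓ)) * Ks (lineD nbar hn2) (α (sd 0)) (α (sd 1)) =
        ∑ b ∈ M.S, (if b = β (vd 0) ∧ b = β (vd 1) then (1 : ℝ) else 0) *
          (A (fun ℓ => β ℓ.1) * ((Φ (fun ℓ => isEmptyElim ℓ) * Ψ (fun ℓ => isEmptyElim ℓ)) *
            (M.C.e ^ 2 * P.mesh 0 / 2 * ((loc (vxd nbar hn2)).wB b * (P.mesh 0 ^ P.d * M.g b.src ^ 2))) *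
            ((if b.src = (α (sd 1)).1 then (1 : ℝ) else 0) *
              (⟪covDeriv M.C M.B (basisE (α (sd 0))) b, (M.C.q ^ 2) (EuclideanSpace.single (α (sd 1)).2 (1 : ℝ))⟫_ℝ *
                Ks (lineD nbar hn2) (α (sd 0)) (α (sd 1)))))) := by
    intro α β
    rw [Finset.sum_mul, Finset.sum_mul]
    exact Finset.sum_congr rfl fun b _ => by ring
  rw [Finset.sum_congr rfl fun α _ => Finset.sum_congr rfl fun β _ => h1 α β]
  have h2 : ∀ α : SLeg kindD → HiggsLattice.Site P 0 × Fin N,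
      ∑ β : VLeg kindD → HiggsLattice.PBond P 0, ∑ b ∈ M.S, (if b = β (vd 0) ∧ b = β (vd 1) then (1 : ℝ) else 0) *
          (A (fun ℓ => β ℓ.1) * ((Φ (fun ℓ => isEmptyElim ℓ) * Ψ (fun ℓ => isEmptyElim ℓ)) *
            (M.C.e ^ 2 * P.mesh 0 / 2 * ((loc (vxd nbar hn2)).wB b * (P.mesh 0 ^ P.d * M.g b.src ^ 2))) *
            ((if b.src = (α (sd 1)).1 then (1 : ℝ) else 0) *
              (⟪covDeriv M.C M.B (basisE (α (sd 0))) b, (M.C.q ^ 2) (EuclideanSpace.single (α (sd 1)).2 (1 : ℝ))⟫_ℝ *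
                Ks (lineD nbar hn2) (α (sd 0)) (α (sd 1)))))) =
        ∑ b ∈ M.S, A (fun _ => b) * ((Φ (fun ℓ => isEmptyElim ℓ) * Ψ (fun ℓ => isEmptyElim ℓ)) *
            (M.C.e ^ 2 * P.mesh 0 / 2 * ((loc (vxd nbar hn2)).wB b * (P.mesh 0 ^ P.d * M.g b.src ^ 2))) *
            ((if b.src = (α (sd 1)).1 then (1 : ℝ) else 0) *
              (⟪covDeriv M.C M.B (basisE (α (sd 0))) b, (M.C.q ^ 2) (EuclideanSpace.single (α (sd 1)).2 (1 : ℝ))⟫_ℝ *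
                Ks (lineD nbar hn2) (α (sd 0)) (α (sd 1))))) := by
    intro α
    rw [Finset.sum_comm]
    refine Finset.sum_congr rfl fun b _ => ?_
    rw [beta_sumD b fun β => A (fun ℓ => β ℓ.1) * ((Φ (fun ℓ => isEmptyElim ℓ) * Ψ (fun ℓ => isEmptyElim ℓ)) *
            (M.C.e ^ 2 * P.mesh 0 / 2 * ((loc (vxd nbar hn2)).wB b * (P.mesh 0 ^ P.d * M.g b.src ^ 2))) *
            ((if b.src = (α (sd 1)).1 then (1 : ℝ) else 0) *
              (⟪covDeriv M.C M.B (basisE (α (sd 0))) b, (M.C.q ^ 2) (EuclideanSpace.single (α (sd 1)).2 (1 : ℝ))⟫_ℝ *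
                Ks (lineD nbar hn2) (α (sd 0)) (α (sd 1)))))]
  rw [Finset.sum_congr rfl fun α _ => h2 α, Finset.sum_comm, Finset.mul_sum, Finset.mul_sum]
  refine Finset.sum_congr rfl fun b _ => ?_
  have h3 : ∀ α : SLeg kindD → HiggsLattice.Site P 0 × Fin N,
      A (fun _ : ExtVLeg (g325d nbar hn2) => b) * ((Φ (fun ℓ => isEmptyElim ℓ) * Ψ (fun ℓ => isEmptyElim ℓ)) *
            (M.C.e ^ 2 * P.mesh 0 / 2 * ((loc (vxd nbar hn2)).wB b * (P.mesh 0 ^ P.d * M.g b.src ^ 2))) *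
            ((if b.src = (α (sd 1)).1 then (1 : ℝ) else 0) *
              (⟪covDeriv M.C M.B (basisE (α (sd 0))) b, (M.C.q ^ 2) (EuclideanSpace.single (α (sd 1)).2 (1 : ℝ))⟫_ℝ *
                Ks (lineD nbar hn2) (α (sd 0)) (α (sd 1))))) =
        (A (fun _ : ExtVLeg (g325d nbar hn2) => b) * (Φ (fun ℓ => isEmptyElim ℓ) * Ψ (fun ℓ => isEmptyElim ℓ)) *
            (M.C.e ^ 2 * P.mesh 0 / 2 * ((loc (vxd nbar hn2)).wB b * (P.mesh 0 ^ P.d * M.g b.src ^ 2)))) *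
          ((if b.src = (α (sd 1)).1 then (1 : ℝ) else 0) *
            (⟪covDeriv M.C M.B (basisE (α (sd 0))) b, (M.C.q ^ 2) (EuclideanSpace.single (α (sd 1)).2 (1 : ℝ))⟫_ℝ *
              Ks (lineD nbar hn2) (α (sd 0)) (α (sd 1)))) := by
    intro α
    ring
  rw [Finset.sum_congr rfl fun α _ => h3 α, ← Finset.mul_sum,
    alpha_sumD b.src fun p r => ⟪covDeriv M.C M.B (basisE p) b, (M.C.q ^ 2) (EuclideanSpace.single r.2 (1 : ℝ))⟫_ℝ * Ks (lineD nbar hn2) p r]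
  have h4 : ∑ p : HiggsLattice.Site P 0 × Fin N, ∑ c : Fin N,
      ⟪covDeriv M.C M.B (basisE p) b, (M.C.q ^ 2) (EuclideanSpace.single (b.src, c).2 (1 : ℝ))⟫_ℝ * Ks (lineD nbar hn2) p (b.src, c) =
      ∑ c : Fin N, dK1 M.C M.B (Ks (lineD nbar hn2)) b ((M.C.q ^ 2) (EuclideanSpace.single c (1 : ℝ))) (b.src, c) := by
    rw [Finset.sum_comm]
    unfold dK1
    exact Finset.sum_congr rfl fun c _ => Finset.sum_congr rfl fun p _ => by ring
  rw [h4]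
  ring

/-! ### The free evaluation of the two local pictures: `T₃`, `T₄` -/

/-- The third term of (3.26) without its sign: `Σ_x η^d Σ_μ g(x)A_μ(x)g′(x)A′_μ(x) tr q² G^η_{(j″)}(0;x,x)` — r15's `term3` symbol by symbol.
[cite: Balaban1983Higgs3, (3.26) p.440] -/
def term3T (η τ : ℝ) (Gj'' : HiggsLattice.Site P 0 → HiggsLattice.Site P 0 → ℝ) (g g' : HiggsLattice.Site P 0 → ℝ)
    (A A' : HiggsLattice.VecField P 0) : ℝ :=
  ∑ x : HiggsLattice.Site P 0, η ^ P.d * ∑ μ : Fin P.d, g x * A ⟨x, μ⟩ * g' x * A' ⟨x, μ⟩ * (τ * Gj'' x x)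

/-- The fourth term of (3.26) without its sign: `Σ_x η^d Σ_μ g(x)A_μ(x)g′(x)A′_μ(x) tr q² η(G^η_{(j″)}(0)∂^{η*}_μ)(x,x)` — r15's `term4`.
[cite: Balaban1983Higgs3, (3.26) p.440] -/
def term4T (η τ : ℝ) (Gj'' : HiggsLattice.Site P 0 → HiggsLattice.Site P 0 → ℝ) (g g' : HiggsLattice.Site P 0 → ℝ)
    (A A' : HiggsLattice.VecField P 0) : ℝ :=
  ∑ x : HiggsLattice.Site P 0, η ^ P.d * ∑ μ : Fin P.d, g x * A ⟨x, μ⟩ * g' x * A' ⟨x, μ⟩ * (τ * (η * dKernelR η⁻¹ μ Gj'' x x))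

omit [DecidableEq (HiggsLattice.PBond P 0)] in
/-- **The free evaluation of (3.25)₃**: all bonds, site-valued localization `g₀`, the free kernel `G ⊗ 1_N` on the loop, product external
field: the bond sum of `graphAmp_g325c` is `Σ_x η^d Σ_μ g₀g_k(x)A_μ(x)·g_k(x)A′_μ(x)·tr q²·G(x,x)` = `T₃` with `g = g₀g_k`, `g′ = g_k`
(the loop trace `Σ_a e_a·q²e_a = tr q²`). [cite: Balaban1983Higgs3, (3.26) p.440] -/
theorem free_evalC (M : Model P N k) (hS : M.S = Finset.univ) (g₀ : HiggsLattice.Site P 0 → ℝ)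
    (G : HiggsLattice.Site P 0 → HiggsLattice.Site P 0 → ℝ) (A A' : HiggsLattice.VecField P 0) :
    ∑ b ∈ M.S, g₀ b.src * (P.mesh 0 ^ P.d * M.g b.src ^ 2 * (A b * A' b) *
        ∑ a : Fin N, ∑ a' : Fin N, opCoeff (M.C.q ^ 2) a a' * (if a = a' then G b.src b.src else 0)) =
      term3T (P.mesh 0) (trq2 M.C) G (fun x => g₀ x * M.g x) M.g A A' := by
  simp only [hS, mul_ite, mul_zero, Finset.sum_ite_eq, Finset.mem_univ, if_true]
  simp only [← Finset.sum_mul, sum_opCoeff_sq_diag]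
  rw [sum_bond]
  unfold term3T
  refine Finset.sum_congr rfl fun x _ => ?_
  rw [Finset.mul_sum]
  refine Finset.sum_congr rfl fun μ _ => ?_
  ring

omit [DecidableEq (HiggsLattice.PBond P 0)] in
/-- **The free evaluation of (3.25)₄**: zero background, all bonds, `G ⊗ 1_N` on the loop: the bond sum of `graphAmp_g325d` is
`Σ_x η^d Σ_μ g₀g_k(x)A_μ(x)·g_k(x)A′_μ(x)·tr q²·(∂^η_μG)(x,x)` (the loop trace `Σ_c (q²e_c)_c = tr q²`); for a symmetric `G`,
`(∂^η_μG)(x,x) = (G∂^{η*}_μ)(x,x)` and `η·` this is `T₄` with `g = g₀g_k`, `g′ = g_k`. [cite: Balaban1983Higgs3, (3.26) p.440] -/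
theorem free_evalD (M : Model P N k) (hB : M.B = 0) (hS : M.S = Finset.univ) (g₀ : HiggsLattice.Site P 0 → ℝ)
    (G : HiggsLattice.Site P 0 → HiggsLattice.Site P 0 → ℝ) (hG : ∀ a b, G a b = G b a) (A A' : HiggsLattice.VecField P 0) :
    P.mesh 0 * ∑ b ∈ M.S, g₀ b.src * (P.mesh 0 ^ P.d * M.g b.src ^ 2 * (A b * A' b) *
        ∑ c : Fin N, dK1 M.C M.B (fun p p' => if p.2 = p'.2 then G p.1 p'.1 else 0) b ((M.C.q ^ 2) (EuclideanSpace.single c (1 : ℝ))) (b.src, c)) =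
      term4T (P.mesh 0) (trq2 M.C) G (fun x => g₀ x * M.g x) M.g A A' := by
  simp only [hS, hB]
  rw [sum_bond]
  have hc : ∀ (x : HiggsLattice.Site P 0) (μ : Fin P.d),
      ∑ c : Fin N, dKernelL (P.mesh 0)⁻¹ μ G x x * ((M.C.q ^ 2) (EuclideanSpace.single c (1 : ℝ))) c = dKernelL (P.mesh 0)⁻¹ μ G x x * trq2 M.C :=
    fun x μ => by rw [← Finset.mul_sum, sum_sq_single_apply]
  simp only [dK1_zero_free, hc]
  unfold term4T
  rw [Finset.mul_sum]
  refine Finset.sum_congr rfl fun x _ => ?_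
  rw [Finset.mul_sum, Finset.mul_sum]
  refine Finset.sum_congr rfl fun μ _ => ?_
  rw [dKernelL_of_symm _ _ _ hG]
  ring

/-- **E((3.25)₃) WITH THE FREE KERNEL = `(e²/2)·T₃`** (one of the two attachments of `A`, `A′` to the two legs): all bonds, site-valued
localization `g₀` of the vertex, `G^η_{(j″)}(0) ⊗ 1_N` on the loop: `E = Φ(∅)Ψ(∅)·(e²/2)·T₃`, `T₃ = Σ_x η^d Σ_μ g(x)A_μ(x)g′(x)A′_μ(x)
tr q² G^η_{(j″)}(0;x,x)` the third term of (3.26) without its printed minus sign (`g = g₀g_k`, `g′ = g_k`).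
[cite: Balaban1983Higgs3, (3.26) p.440] [cite: Balaban1983Higgs3, (3.25) p.439] -/
theorem graphAmp_g325c_free (M : Model P N k) (hS : M.S = Finset.univ)
    (dm2 : Fin (g325c nbar hn2).nV → HiggsLattice.Site P 0 → ℝ) (loc : Fin (g325c nbar hn2).nV → Loc P k)
    (g₀ : HiggsLattice.Site P 0 → ℝ) (hw₀ : ∀ b, (loc (vxc nbar hn2)).wB b = g₀ b.src)
    (Po : OutPairing (g325c nbar hn2)) (Ks : SLine (g325c nbar hn2) → HiggsLattice.Site P 0 × Fin N → HiggsLattice.Site P 0 × Fin N → ℝ)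
    (Kv : VLine (g325c nbar hn2) → HiggsLattice.PBond P 0 → HiggsLattice.PBond P 0 → ℝ)
    (Ko : Po.Line oRank → HiggsLattice.Site P k × Fin N → HiggsLattice.Site P k × Fin N → ℝ)
    (Gj'' : HiggsLattice.Site P 0 → HiggsLattice.Site P 0 → ℝ) (hK : ∀ p p', Ks (lineC nbar hn2) p p' = if p.2 = p'.2 then Gj'' p.1 p'.1 else 0)
    (Φ : (ExtSLeg (g325c nbar hn2) → HiggsLattice.Site P 0 × Fin N) → ℝ) (A A' : HiggsLattice.VecField P 0)
    (Ψ : (Po.Ext → HiggsLattice.Site P k × Fin N) → ℝ) :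
    graphAmp (g325c nbar hn2) M dm2 loc Po Ks Kv Ko Φ (prodExtV (pairVC A A')) Ψ =
      (Φ (fun ℓ => isEmptyElim ℓ) * Ψ (fun ℓ => isEmptyElim ℓ)) *
        (M.C.e ^ 2 / 2 * term3T (P.mesh 0) (trq2 M.C) Gj'' (fun x => g₀ x * M.g x) M.g A A') := by
  rw [graphAmp_g325c]
  simp only [prodExtV_pairVC, hw₀, hK]
  rw [free_evalC M hS g₀ Gj'' A A']

/-- **E((3.25)₄) AT ZERO BACKGROUND WITH THE FREE KERNEL = `(e²/2)·T₄`**: `E = Φ(∅)Ψ(∅)·(e²/2)·T₄`, `T₄ = Σ_x η^d Σ_μ g(x)A_μ(x)g′(x)A′_μ(x)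
tr q² η(G^η_{(j″)}(0)∂^{η*}_μ)(x,x)` the fourth term of (3.26) without its printed minus sign (symmetric `G^η_{(j″)}(0)`; `g = g₀g_k`,
`g′ = g_k`). [cite: Balaban1983Higgs3, (3.26) p.440] [cite: Balaban1983Higgs3, (3.25) p.439] -/
theorem graphAmp_g325d_free (M : Model P N k) (hB : M.B = 0) (hS : M.S = Finset.univ)
    (dm2 : Fin (g325d nbar hn2).nV → HiggsLattice.Site P 0 → ℝ) (loc : Fin (g325d nbar hn2).nV → Loc P k)
    (g₀ : HiggsLattice.Site P 0 → ℝ) (hw₀ : ∀ b, (loc (vxd nbar hn2)).wB b = g₀ b.src)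
    (Po : OutPairing (g325d nbar hn2)) (Ks : SLine (g325d nbar hn2) → HiggsLattice.Site P 0 × Fin N → HiggsLattice.Site P 0 × Fin N → ℝ)
    (Kv : VLine (g325d nbar hn2) → HiggsLattice.PBond P 0 → HiggsLattice.PBond P 0 → ℝ)
    (Ko : Po.Line oRank → HiggsLattice.Site P k × Fin N → HiggsLattice.Site P k × Fin N → ℝ)
    (Gj'' : HiggsLattice.Site P 0 → HiggsLattice.Site P 0 → ℝ) (hGj'' : ∀ a b, Gj'' a b = Gj'' b a)
    (hK : ∀ p p', Ks (lineD nbar hn2) p p' = if p.2 = p'.2 then Gj'' p.1 p'.1 else 0)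
    (Φ : (ExtSLeg (g325d nbar hn2) → HiggsLattice.Site P 0 × Fin N) → ℝ) (A A' : HiggsLattice.VecField P 0)
    (Ψ : (Po.Ext → HiggsLattice.Site P k × Fin N) → ℝ) :
    graphAmp (g325d nbar hn2) M dm2 loc Po Ks Kv Ko Φ (prodExtV (pairVD A A')) Ψ =
      (Φ (fun ℓ => isEmptyElim ℓ) * Ψ (fun ℓ => isEmptyElim ℓ)) *
        (M.C.e ^ 2 / 2 * term4T (P.mesh 0) (trq2 M.C) Gj'' (fun x => g₀ x * M.g x) M.g A A') := by
  rw [graphAmp_g325d]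
  have hK' : Ks (lineD nbar hn2) = fun p p' => if p.2 = p'.2 then Gj'' p.1 p'.1 else 0 := funext fun p => funext fun p' => hK p p'
  simp only [prodExtV_pairVD, hw₀, hK']
  rw [← free_evalD M hB hS g₀ Gj'' hGj'' A A']
  ring

end Tadpoles

/-! ## §8 The four pictures (3.25) against the whole left side of (3.26) -/

section Class325

variable {P : HiggsLattice.Params} {N k : ℕ} {hn : 1 ≤ nbar} {hn2 : 2 ≤ nbar}

/-- **(3.26)** p. 440 [PDF 30], LEFT SIDE, verbatim: *"− Σ_{x,x′} η^{2d} Σ_{μ,μ′=1}^d g(x)A_μ(x) tr q²(G^η_{(j)}(0)∂^{η*}_{μ′})(x,x′)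
(G^η_{(j′)}(0)∂^{η*}_μ)(x′,x) g′(x′)A′_{μ′}(x′) + Σ_{x,x′} η^{2d} Σ_{μ,μ′=1}^d g(x)A_μ(x) tr q² G^η_{(j)}(0;x,x′)(∂^η_{μ′}G^η_{(j′)}(0)∂^{η*}_μ)(x′,x)
g′(x′)A′_{μ′}(x′) − Σ_x η^d Σ_{μ=1}^d g(x)A_μ(x)g′(x)A′_μ(x) tr q² G^η_{(j″)}(0;x,x) − Σ_x η^d Σ_{μ=1}^d g(x)A_μ(x)g′(x)A′_μ(x) tr q²
η(G^η_{(j″)}(0)∂^{η*}_μ)(x,x) = …"* — r15's `B3Sect3VectorSelfEnergy.lhs326 = −T₁ + T₂ − T₃ − T₄` symbol by symbol on this carrier.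
[cite: Balaban1983Higgs3, (3.26) p.440] -/
def lhs326T (η τ : ℝ) (Gj Gj' Gj'' : HiggsLattice.Site P 0 → HiggsLattice.Site P 0 → ℝ) (g g' : HiggsLattice.Site P 0 → ℝ)
    (A A' : HiggsLattice.VecField P 0) : ℝ :=
  -pairSumT η (kerAT η τ Gj Gj') g A (legFarT g' A') + pairSumT η (kerBT η τ Gj Gj') g A (legFarT g' A')
    - term3T η τ Gj'' g g' A A' - term4T η τ Gj'' g g' A A'

/-- `T₃` is symmetric in the two external vector fields. [cite: Balaban1983Higgs3, (3.26) p.440] -/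
theorem term3T_swap (η τ : ℝ) (G : HiggsLattice.Site P 0 → HiggsLattice.Site P 0 → ℝ) (g g' : HiggsLattice.Site P 0 → ℝ)
    (A A' : HiggsLattice.VecField P 0) : term3T η τ G g g' A' A = term3T η τ G g g' A A' := by
  unfold term3T
  exact Finset.sum_congr rfl fun x _ => by rw [show (∑ μ : Fin P.d, g x * A' ⟨x, μ⟩ * g' x * A ⟨x, μ⟩ * (τ * G x x)) =
    ∑ μ : Fin P.d, g x * A ⟨x, μ⟩ * g' x * A' ⟨x, μ⟩ * (τ * G x x) from Finset.sum_congr rfl fun μ _ => by ring]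

/-- `T₄` is symmetric in the two external vector fields. [cite: Balaban1983Higgs3, (3.26) p.440] -/
theorem term4T_swap (η τ : ℝ) (G : HiggsLattice.Site P 0 → HiggsLattice.Site P 0 → ℝ) (g g' : HiggsLattice.Site P 0 → ℝ)
    (A A' : HiggsLattice.VecField P 0) : term4T η τ G g g' A' A = term4T η τ G g g' A A' := by
  unfold term4T
  exact Finset.sum_congr rfl fun x _ => by rw [show (∑ μ : Fin P.d, g x * A' ⟨x, μ⟩ * g' x * A ⟨x, μ⟩ * (τ * (η * dKernelR η⁻¹ μ G x x))) =
    ∑ μ : Fin P.d, g x * A ⟨x, μ⟩ * g' x * A' ⟨x, μ⟩ * (τ * (η * dKernelR η⁻¹ μ G x x)) from Finset.sum_congr rfl fun μ _ => by ring]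

/-- `T₃` only sees the product `g(x)g′(x)` of the two localization functions. [cite: Balaban1983Higgs3, (3.26) p.440] -/
theorem term3T_loc (η τ : ℝ) (G : HiggsLattice.Site P 0 → HiggsLattice.Site P 0 → ℝ) (g₀ g₁ gk : HiggsLattice.Site P 0 → ℝ)
    (A A' : HiggsLattice.VecField P 0) :
    term3T η τ G (fun x => g₀ x * g₁ x * gk x) gk A A' = term3T η τ G (fun x => g₀ x * gk x) (fun x => g₁ x * gk x) A A' := by
  unfold term3T
  exact Finset.sum_congr rfl fun x _ => by rw [show (∑ μ : Fin P.d, g₀ x * g₁ x * gk x * A ⟨x, μ⟩ * gk x * A' ⟨x, μ⟩ * (τ * G x x)) =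
    ∑ μ : Fin P.d, g₀ x * gk x * A ⟨x, μ⟩ * (g₁ x * gk x) * A' ⟨x, μ⟩ * (τ * G x x) from Finset.sum_congr rfl fun μ _ => by ring]

/-- `T₄` only sees the product `g(x)g′(x)`. [cite: Balaban1983Higgs3, (3.26) p.440] -/
theorem term4T_loc (η τ : ℝ) (G : HiggsLattice.Site P 0 → HiggsLattice.Site P 0 → ℝ) (g₀ g₁ gk : HiggsLattice.Site P 0 → ℝ)
    (A A' : HiggsLattice.VecField P 0) :
    term4T η τ G (fun x => g₀ x * g₁ x * gk x) gk A A' = term4T η τ G (fun x => g₀ x * gk x) (fun x => g₁ x * gk x) A A' := by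
  unfold term4T
  exact Finset.sum_congr rfl fun x _ => by rw [show (∑ μ : Fin P.d, g₀ x * g₁ x * gk x * A ⟨x, μ⟩ * gk x * A' ⟨x, μ⟩ * (τ * (η * dKernelR η⁻¹ μ G x x))) =
    ∑ μ : Fin P.d, g₀ x * gk x * A ⟨x, μ⟩ * (g₁ x * gk x) * A' ⟨x, μ⟩ * (τ * (η * dKernelR η⁻¹ μ G x x)) from
      Finset.sum_congr rfl fun μ _ => by ring]

variable [DecidableEq (HiggsLattice.PBond P 0)]

/-- **THE FOUR PICTURES (3.25) AGAINST THE LEFT SIDE OF (3.26), free kernels, zero background.**  The model data `M` with `B̃ = 0` and all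
bonds; localization functions `g₀` at the vertex `x` and `g₁` at the vertex `x′` of the two nonlocal pictures, and the weight `g₀g₁` at the
single vertex of the two local ones (print's `g(x)…g′(x)` at the same point); free kernels: in each nonlocal picture the line plain at `x`
carries `G^η_{(j)}(0) ⊗ 1_N` and the other line the symmetric `G^η_{(j′)}(0) ⊗ 1_N`, the loops of the local pictures carry the symmetric
`G^η_{(j″)}(0) ⊗ 1_N`; the external vector fields `A` (at `x`) and `A′` (at `x′`), the local pictures summed over the TWO ways of attaching
`A`, `A′` to the two A′-legs of their vertex (the polarization of the quadratic vertices (1.10)_{2,0}, (1.8)_{2,0}; each attachment gives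
`(e²/2)·T₃` resp. `(e²/2)·T₄`); no external φ′-leg, no output (`Φ = Ψ = 1`).  Then
`E((3.25)₁) + E((3.25)₂) + ΣE((3.25)₃) + ΣE((3.25)₄) = −e² · [−T₁ + T₂ − T₃ − T₄] = −e² · (left side of (3.26))`
with `g = g₀g_k`, `g′ = g₁g_k`, `tr q²` the trace of `q²`: the kernel recovers print's four terms with print's relative signs, the whole
class multiplied by `−e²` (for (3.9) FILE 5 found `+e²`; the global sign of a class is immaterial for Proposition 1 and is recorded as a
reading note only). [cite: Balaban1983Higgs3, (3.26) p.440] [cite: Balaban1983Higgs3, (3.25) p.439] -/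
theorem class325_free_print (M : Model P N k) (hB : M.B = 0) (hS : M.S = Finset.univ) (g₀ g₁ : HiggsLattice.Site P 0 → ℝ)
    (Gj Gj' Gj'' : HiggsLattice.Site P 0 → HiggsLattice.Site P 0 → ℝ) (hGj' : ∀ a b, Gj' a b = Gj' b a) (hGj'' : ∀ a b, Gj'' a b = Gj'' b a)
    (A A' : HiggsLattice.VecField P 0)
    -- (3.25)₁
    (dm2a : Fin (g325a nbar hn).nV → HiggsLattice.Site P 0 → ℝ) (loca : Fin (g325a nbar hn).nV → Loc P k)
    (hw₀a : ∀ b, (loca (vxa nbar hn 0)).wB b = g₀ b.src) (hw₁a : ∀ b, (loca (vxa nbar hn 1)).wB b = g₁ b.src)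
    (Poa : OutPairing (g325a nbar hn)) (Ksa : SLine (g325a nbar hn) → HiggsLattice.Site P 0 × Fin N → HiggsLattice.Site P 0 × Fin N → ℝ)
    (Kva : VLine (g325a nbar hn) → HiggsLattice.PBond P 0 → HiggsLattice.PBond P 0 → ℝ)
    (Koa : Poa.Line oRank → HiggsLattice.Site P k × Fin N → HiggsLattice.Site P k × Fin N → ℝ)
    (hKa₀ : ∀ p p', Ksa (lineA0 nbar hn) p p' = if p.2 = p'.2 then Gj' p.1 p'.1 else 0)
    (hKa₁ : ∀ p p', Ksa (lineA1 nbar hn) p p' = if p.2 = p'.2 then Gj p.1 p'.1 else 0)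
    -- (3.25)₂
    (dm2b : Fin (g325b nbar hn).nV → HiggsLattice.Site P 0 → ℝ) (locb : Fin (g325b nbar hn).nV → Loc P k)
    (hw₀b : ∀ b, (locb (vxb nbar hn 0)).wB b = g₀ b.src) (hw₁b : ∀ b, (locb (vxb nbar hn 1)).wB b = g₁ b.src)
    (Pob : OutPairing (g325b nbar hn)) (Ksb : SLine (g325b nbar hn) → HiggsLattice.Site P 0 × Fin N → HiggsLattice.Site P 0 × Fin N → ℝ)
    (Kvb : VLine (g325b nbar hn) → HiggsLattice.PBond P 0 → HiggsLattice.PBond P 0 → ℝ)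
    (Kob : Pob.Line oRank → HiggsLattice.Site P k × Fin N → HiggsLattice.Site P k × Fin N → ℝ)
    (hKb₀ : ∀ p p', Ksb (lineB0 nbar hn) p p' = if p.2 = p'.2 then Gj' p.1 p'.1 else 0)
    (hKb₁ : ∀ p p', Ksb (lineB1 nbar hn) p p' = if p.2 = p'.2 then Gj p.1 p'.1 else 0)
    -- (3.25)₃
    (dm2c : Fin (g325c nbar hn2).nV → HiggsLattice.Site P 0 → ℝ) (locc : Fin (g325c nbar hn2).nV → Loc P k)
    (hwc : ∀ b, (locc (vxc nbar hn2)).wB b = g₀ b.src * g₁ b.src)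
    (Poc : OutPairing (g325c nbar hn2)) (Ksc : SLine (g325c nbar hn2) → HiggsLattice.Site P 0 × Fin N → HiggsLattice.Site P 0 × Fin N → ℝ)
    (Kvc : VLine (g325c nbar hn2) → HiggsLattice.PBond P 0 → HiggsLattice.PBond P 0 → ℝ)
    (Koc : Poc.Line oRank → HiggsLattice.Site P k × Fin N → HiggsLattice.Site P k × Fin N → ℝ)
    (hKc : ∀ p p', Ksc (lineC nbar hn2) p p' = if p.2 = p'.2 then Gj'' p.1 p'.1 else 0)
    -- (3.25)₄
    (dm2d : Fin (g325d nbar hn2).nV → HiggsLattice.Site P 0 → ℝ) (locd : Fin (g325d nbar hn2).nV → Loc P k)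
    (hwd : ∀ b, (locd (vxd nbar hn2)).wB b = g₀ b.src * g₁ b.src)
    (Pod : OutPairing (g325d nbar hn2)) (Ksd : SLine (g325d nbar hn2) → HiggsLattice.Site P 0 × Fin N → HiggsLattice.Site P 0 × Fin N → ℝ)
    (Kvd : VLine (g325d nbar hn2) → HiggsLattice.PBond P 0 → HiggsLattice.PBond P 0 → ℝ)
    (Kod : Pod.Line oRank → HiggsLattice.Site P k × Fin N → HiggsLattice.Site P k × Fin N → ℝ)
    (hKd : ∀ p p', Ksd (lineD nbar hn2) p p' = if p.2 = p'.2 then Gj'' p.1 p'.1 else 0) :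
    graphAmp (g325a nbar hn) M dm2a loca Poa Ksa Kva Koa (fun _ => 1) (prodExtV (pairVA A A')) (fun _ => 1) +
      graphAmp (g325b nbar hn) M dm2b locb Pob Ksb Kvb Kob (fun _ => 1) (prodExtV (pairVB A A')) (fun _ => 1) +
      (graphAmp (g325c nbar hn2) M dm2c locc Poc Ksc Kvc Koc (fun _ => 1) (prodExtV (pairVC A A')) (fun _ => 1) +
        graphAmp (g325c nbar hn2) M dm2c locc Poc Ksc Kvc Koc (fun _ => 1) (prodExtV (pairVC A' A)) (fun _ => 1)) +
      (graphAmp (g325d nbar hn2) M dm2d locd Pod Ksd Kvd Kod (fun _ => 1) (prodExtV (pairVD A A')) (fun _ => 1) +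
        graphAmp (g325d nbar hn2) M dm2d locd Pod Ksd Kvd Kod (fun _ => 1) (prodExtV (pairVD A' A)) (fun _ => 1)) =
      -(M.C.e ^ 2 * lhs326T (P.mesh 0) (trq2 M.C) Gj Gj' Gj'' (fun x => g₀ x * M.g x) (fun x => g₁ x * M.g x) A A') := by
  rw [graphAmp_g325a_free_print M hB hS dm2a loca g₀ g₁ hw₀a hw₁a Poa Ksa Kva Koa Gj Gj' hGj' hKa₀ hKa₁,
    graphAmp_g325b_free_print M hB hS dm2b locb g₀ g₁ hw₀b hw₁b Pob Ksb Kvb Kob Gj Gj' hGj' hKb₀ hKb₁,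
    graphAmp_g325c_free M hS dm2c locc (fun x => g₀ x * g₁ x) hwc Poc Ksc Kvc Koc Gj'' hKc,
    graphAmp_g325c_free M hS dm2c locc (fun x => g₀ x * g₁ x) hwc Poc Ksc Kvc Koc Gj'' hKc,
    graphAmp_g325d_free M hB hS dm2d locd (fun x => g₀ x * g₁ x) hwd Pod Ksd Kvd Kod Gj'' hGj'' hKd,
    graphAmp_g325d_free M hB hS dm2d locd (fun x => g₀ x * g₁ x) hwd Pod Ksd Kvd Kod Gj'' hGj'' hKd]
  rw [term3T_loc, term3T_loc, term4T_loc, term4T_loc,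
    term3T_swap (P.mesh 0) (trq2 M.C) Gj'' (fun x => g₀ x * M.g x) (fun x => g₁ x * M.g x) A A',
    term4T_swap (P.mesh 0) (trq2 M.C) Gj'' (fun x => g₀ x * M.g x) (fun x => g₁ x * M.g x) A A']
  unfold lhs326T
  ring

end Class325

end

end Literature.MathematicalPhysics.QuantumFieldTheory.Balaban1983to89.B3Eq326FromFeynmanRules
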